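import Summits.HodgeConjecture.HodgeConjecture.Cruxes.BlochSeedDiscOne.DiamondLevelLaws

/-!
# CeilingPair2 — second workfile of the `h`-uniform ABSENT families of ◇_h (`h = 2m+4`) over the twin-fork base
# `{c·ℓ_φ, 2I + m·ℓ_u}` and the unit-pair base `{ℓ_φ, cu_χ, cu_χ'}` (control lens, g21, v1.4): the `r`-line three nodes below the ceiling, the
# FREE-SLOT ∕ HALF-FREE-SLOT families of the full-letter, sub-apex and sub-full frames, and (§3) the unit-pair completions with their `(h−2)I` and
# `s_m` lifts, and (§4) the apex `2I` as second letter.  ALL TABLES, NUMBERS, RESIDUE AND TOOLS: memo `CEILING-PAIR2-g21.md` beside this file.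

`line stmt-HodgeConjecture-18881 Cruxes/BlochSeedDiscOne/Lines/birth.lean 814a6a70c14e831a stub_rung_pad4_seedAt` — crux-chain WORKFILE of
`BlochSeedDiscOne` (route `EightfoldBlochSeeds`, FRONTIER); planner seat `plan-lens-HodgeAV-control-g21` (lens «control»; director-hodge req-36,
booking R19.743: «control g21 continues in a SECOND workfile at the 200 KB cap» — `CeilingPair.lean` v1.6 is 198 828 B).

HONEST FRAMING.  Nothing here proves HC, HC_CM, HC_AV, the hinge H2 = `stmt-18881`, `(T_h)`, `KAbsent_h` or touches `stub_rung_pad4_seedAt`;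
HC_CM is a displayed binder only.  This is kernel arithmetic about the typed ENCODER MODEL of the hsemireg experiment
(`Summits/Ventures/HSemireg/Pad4Tower*.lean`: two-level designs `C : MConfig` in the diamond ◇_h obeying RULE D (`RuleDMu4N/P`), the X⁺ law
(`XPlusClosed`) and the `G₁ = ⟨S₄, Δ⟩` symmetry (`PermClosed`)).  CENSUS-NEUTRAL: every family is checked against the peel census of record
(gs-eng-2 g54 j318002: ◇₈ peel table sha16 a459e02921a60310, ◇₁₀ 74004db439790926; bc5-plan g8 ◇₈ r3 j305149; ◇₁₀ G₁ j308425) and agrees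
with it on every orbit — 0 counterexamples, no member is a census survivor or of peel round ≥ 3; it re-derives census facts inside the kernel
and adds no SAT/UNSAT row.

WHAT IS PROVED (sorry-free; every `h : ℤ`, no parity, no `h ≤ 10`, no level law; hypotheses ◇_h = `C.InDiamond h`, RULE D on both levels, X⁺,
`PermClosed C.upper`; one ◇₁₀ census representative per family over `MConfig.G1Closed`, `MConfig.StaticH1`).  Letters as in `CeilingPair.lean`:
`c·ℓ_φ = floorLetter φ c`, `2I + n·ℓ_u = nodeTwoLetter u n`, `cu_χ = ceilingUnit h χ`, the ceiling line `y_d = ceilLetter h v d`, `s_k =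
subCeilLetter m v k` (top `h−2`), `t_k = subSubLetter m v k` (top `h−4`), and NEW `r_k = rLetter m v k = 2kI + (m−1−k)ℓ_v` (top `h−6`); slots in
the order 0,1,2,3.  Families (numbering continues `CeilingPair.lean` TP1–TP21, TN0–TN18): §1 the `r`-line TP22 TN19 TP23 TP24 TN20 TP25; §2 the
ONE MECHANISM behind every family — a ceiling-line letter is a PIN FROM ABOVE (`upLine_of_ruleDMu4P`), a floor letter a PIN FROM BELOW
(`below_floorLetter`), and RULE D on (pin) × (a NODE frame, or any frame of a fourth letter) has no cover branch and moves ONE letter along ONE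
line — hence FREE-SLOT families (`x ≠ O`) and HALF-FREE families (`2 ≤ nodeLevel W`): TN21 TN21′ TP30 TN23 TP31 TP29 (full-letter frame),
`subApex_upServer` TP26 TP27 TP27F TN25 (sub-apex `(h−2)·I`), TP33 TN26 TP34 TP32 (sub-full frame); §3 (v1.1) the UNIT-PAIR base
`{ℓ_φ, cu_χ, cu_χ'}` (`χ' ≠ χ`, law-free over the pair forks A1 A2 TN2): UN1 UN2 (`N`-completions by `c·ℓ_ψ`, `4I + n·ℓ_u`), UP1 UP2 UP3 ∕ VN1 VN3
(the sub-apex `(h−2)·I` over `{ℓ_φ, X, cu_χ}`, both levels), TN27 (half-free `N{FL, B, (h−2)I, W}`), WP1a WP1c (the sub-top letter `s_m` over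
`{ℓ_φ, X, cu_χ}`, `subTopNode_upServer`), WP2; §4 (v1.2) the APEX `2I` as second letter (apex engines `servedBelow_floor_apex`,
`servedAbove_ceiling_apex`: `¬ isApex` traded for `∃ r`) — UN3 UP4 VN4 UP5 WP1d; §5 (v1.3∕1.4) node-2 line, floor CLIMBS: VN5 UP5g UP6 UN4.
COVERAGE of the ◇₁₀ peel census (round-2 orbits typed by a kernel family, cumulative with `CeilingPair.lean` v1.6): 45.0 % → 54.0 % (v1.0) →
57.7 % (v1.1) → 58.2 % (v1.2) → 59.7 % (v1.4: 14 237 ∕ 23 861; ◇₈ 42.8 → 49.7 → 54.1 → 54.9 → 56.4 %), round 1 unchanged 3 275 ∕ 3 357;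
0 survivors, 0 round ≥ 3 members (`tools/fam[K-O].py`, `cover.py`).

BUILD NOTE. §0 restates VERBATIM (credited) the lemmas of `CeilingPair.lean` v1.6 (sha16 776b0a3f2106ba61, control g20; its own §0 restates
`CeilingFork.lean` g18 ∕ `CeilingUnitApex.lean` g19) that are called here, because only `DiamondLevelLaws` is importable on the farm
(`import …CeilingPair` ⇒ rc 75 `unbuilt`, 3 probes 2026-08-31).  `lean check`: rc 0 · 0 sorry · 0 error · 0 warning.
-/

set_option linter.dupNamespace false
set_option linter.unusedSimpArgs false

namespace Summit.HodgeConjecture.HodgeConjecture.Cruxes.BlochSeedDiscOne.CeilingPair2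

open Finset Summit.Ventures.HSemireg.Pad4Tower
open Summit.HodgeConjecture.HodgeConjecture.Cruxes.BlochSeedDiscOne.DiamondLevelLaws

/-! ## §0 Restated verbatim from `CeilingPair.lean` v1.6 776b0a3f2106ba61 (control g20; g18 ∕ g19 lemmas as credited there) — not new -/

/-- [g18 `CeilingFork.xplus_unit_fork`] the X⁺ fork at a ceiling apex with two UNIT children needs no side condition. -/
theorem xplus_unit_fork {h : ℤ} {C : MConfig} (hU : C.InDiamond h) (hX : XPlusClosed C) {Z : MCell} (hZ : Z ∈ C.lower)
    {g f : Fin 4} (hfg : f ≠ g) (hg : Z g = (h, 0, 0)) (hf : Z f = (h, 0, 0)) {P₁ P₂ : MCell}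
    (hP₁ : P₁ ∈ C.upper) (hP₂ : P₂ ∈ C.upper) {r₁ r₂ : Fin 4} (hr : r₂ ≠ r₁) (h1 : UPartner Z P₁ g r₁) (h2 : UPartner Z P₂ g r₂)
    (hd₁ : (P₁ g).1 = h - 1) (hd₂ : (P₂ g).1 = h - 1) : False := by
  have hZg1 : (Z g).1 = h := by rw [hg]
  have h1ray : ((h, 0, 0) : BPoint) = ray (P₁ g) r₁ (h - (P₁ g).1) := by have := h1.2.2; rw [hg] at this; exact this
  refine hX (dualCell 0 P₁) (dualCell_mem_dual_lower hP₁) (dualCell 0 Z) (dualCell_mem_dual_upper hZ) (dualCell 0 P₂)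
    (dualCell_mem_dual_lower hP₂) g r₁ r₂ f ⟨?_, hfg, (uPartner_dual 0 Z P₁ g r₁).mpr h1, ?_, hr, ?_, ?_, ?_, ?_, ?_⟩
  · exact fun hap => not_isApex_below_apex (by omega) h1ray ((isApex_dual 0 (P₁ g)).mp hap)
  · intro P hP hPu
    obtain ⟨X, hXl, rfl⟩ := Finset.mem_image.mp hP
    have hu : UPartner X P₁ g r₁ := (uPartner_dual 0 X P₁ g r₁).mp hPu
    show 0 - (X g).1 ≤ 0 - (Z g).1
    have hlt : (P₁ g).1 < (X g).1 := hu.2.1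
    have hle : (X g).1 ≤ h := fst_le_of_inDiamond (hU.1 X hXl g)
    omega
  · exact ⟨magree_dual.mpr (fun j hj => (h2.1 j hj).symm), (ray_dual_iff 0 (Z g) (P₂ g) r₂).mpr ⟨h2.2.1, h2.2.2⟩⟩
  · intro P hP _ hlt1 hlt2 _
    obtain ⟨X, hXl, rfl⟩ := Finset.mem_image.mp hP
    exfalso
    change 0 - (Z g).1 < 0 - (X g).1 at hlt1
    change 0 - (X g).1 < 0 - (P₂ g).1 at hlt2
    have hle : (X g).1 ≤ h := fst_le_of_inDiamond (hU.1 X hXl g)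
    omega
  · intro P hP _ _ _ _
    obtain ⟨X, hXl, rfl⟩ := Finset.mem_image.mp hP
    show Effective (bsub (dualPt 0 (X g)) (dualPt 0 (Z g)))
    rw [bsub_dualPt0, hg]
    exact effective_ceilingApex_sub (hU.1 X hXl g)
  · intro P hP _ hnb _
    obtain ⟨X, hXl, rfl⟩ := Finset.mem_image.mp hP
    exfalso
    have e1 : (P₁ f).1 = h := by rw [(h1.1 f hfg).trans hf]
    have := hnb.1
    change 0 - (X f).1 < 0 - (P₁ f).1 at this
    have hle := fst_le_of_inDiamond (hU.1 X hXl f)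
    omega
  · intro P hP hnb
    obtain ⟨X, hXl, rfl⟩ := Finset.mem_image.mp hP
    exfalso
    have e1 : (P₁ f).1 = h := by rw [(h1.1 f hfg).trans hf]
    have := hnb.1
    change 0 - (X f).1 < 0 - (P₁ f).1 at this
    have hle := fst_le_of_inDiamond (hU.1 X hXl f)
    omega

/-- [g18] the unit floor letter `ℓ_φ = O + n_φ`. -/
abbrev floorUnit (φ : Fin 4) : BPoint := ray ((0, 0, 0) : BPoint) φ 1

/-- [g18] the unit ceiling letter `(h−2)I + ℓ_χ`. -/
abbrev ceilingUnit (h : ℤ) (χ : Fin 4) : BPoint := ray ((h - 2, 0, 0) : BPoint) χ 1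

/-- [g18] the floor letter `c·ℓ_φ` (node `0`, top `2c`). -/
abbrev floorLetter (φ : Fin 4) (c : ℤ) : BPoint := ray ((0, 0, 0) : BPoint) φ c

/-- [g18] the letter `2I + n·ℓ_u` (node `2`, top `2 + 2n`). -/
abbrev nodeTwoLetter (u : Fin 4) (n : ℤ) : BPoint := ray ((2, 0, 0) : BPoint) u n

theorem floorUnit_top (φ : Fin 4) : Adapted (floorUnit φ) φ ∧ coord (floorUnit φ) φ = 2 := by
  fin_cases φ <;> simp [ray, coord, Adapted]

theorem ceilingUnit_not_isApex (h : ℤ) (χ : Fin 4) : ¬ isApex (ceilingUnit h χ) := by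
  fin_cases χ <;> simp [ray, isApex]

theorem ceilingUnit_fst (h : ℤ) (χ : Fin 4) : (ceilingUnit h χ).1 = h - 1 := by
  fin_cases χ <;> simp [ray] <;> omega

theorem ceilingUnit_node (h : ℤ) (χ : Fin 4) : Adapted (ceilingUnit h χ) (χ + 2) ∧ coord (ceilingUnit h χ) (χ + 2) = h - 2 := by
  fin_cases χ <;> simp [ray, coord, Adapted]

theorem ceilingApex_eq_ray_ceilingUnit (h : ℤ) (χ : Fin 4) : ((h, 0, 0) : BPoint) = ray (ceilingUnit h χ) (χ + 2) 1 := by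
  fin_cases χ <;> simp [ray] <;> omega

/-- [g18] below a unit floor letter there is only `O`, along the letter's own ray. -/
theorem below_floorUnit {h : ℤ} {y : BPoint} (hy : InDiamond h y) {φ r : Fin 4} {d : ℤ} (hd : 0 < d)
    (he : floorUnit φ = ray y r d) : r = φ ∧ y = (0, 0, 0) := by
  obtain ⟨α, a, b⟩ := y
  obtain ⟨hax, h1, -, -⟩ := hy
  simp only [AxisPt, absCharge, chargeOf, ray, Prod.mk.injEq] at hax h1 he
  fin_cases φ <;> fin_cases r <;> simp at he hax ⊢ <;>
    (simp only [abs_eq_max_neg, max_def] at h1; split_ifs at h1 <;> omega)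

/-- [g18] above a unit ceiling letter there is only `hI`, along the node direction. -/
theorem above_ceilingUnit {h : ℤ} {y : BPoint} (hy : InDiamond h y) {χ r : Fin 4} {e : ℤ} (he0 : 0 < e)
    (he : y = ray (ceilingUnit h χ) r e) : r = χ + 2 ∧ y = (h, 0, 0) := by
  subst he
  obtain ⟨hax, h1, -, h3⟩ := hy
  simp only [AxisPt, absCharge, chargeOf, ray, Prod.mk.injEq] at hax h1 h3 ⊢
  fin_cases χ <;> fin_cases r <;> simp at hax h1 h3 ⊢ <;>
    (simp only [abs_eq_max_neg, max_def] at h1 h3; split_ifs at h1 h3 <;> omega)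

theorem floorLetter_not_isApex (φ : Fin 4) {c : ℤ} (hc : c ≠ 0) : ¬ isApex (floorLetter φ c) := by
  fin_cases φ <;> simp [ray, isApex, hc]

theorem nodeTwoLetter_not_isApex (u : Fin 4) {n : ℤ} (hn : n ≠ 0) : ¬ isApex (nodeTwoLetter u n) := by
  fin_cases u <;> simp [ray, isApex, hn]

theorem floorLetter_node (φ : Fin 4) (c : ℤ) : Adapted (floorLetter φ c) (φ + 2) ∧ coord (floorLetter φ c) (φ + 2) = 0 :=
  ⟨(adapted_ray_apex 0 φ c).2, coord_ray_apex_antip 0 φ c⟩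

theorem nodeTwoLetter_node (u : Fin 4) (n : ℤ) : Adapted (nodeTwoLetter u n) (u + 2) ∧ coord (nodeTwoLetter u n) (u + 2) = 2 :=
  ⟨(adapted_ray_apex 2 u n).2, coord_ray_apex_antip 2 u n⟩

theorem nodeTwoLetter_fst (u : Fin 4) (n : ℤ) : (nodeTwoLetter u n).1 = 2 + n := by
  fin_cases u <;> simp [ray]

theorem floorLetter_fst (φ : Fin 4) (c : ℤ) : (floorLetter φ c).1 = c := by
  fin_cases φ <;> simp [ray]

/-- [g18] below a floor-node letter `c·ℓ_φ` (`c ≥ 0`) only its own ray. -/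
theorem below_floorLetter {h c d : ℤ} {z : BPoint} (hz : InDiamond h z) {φ r : Fin 4} (hc : 0 ≤ c) (hd : 0 < d)
    (he : floorLetter φ c = ray z r d) : r = φ := by
  obtain ⟨α, a, b⟩ := z
  obtain ⟨hax, h1, -, -⟩ := hz
  simp only [AxisPt, absCharge, chargeOf, ray, Prod.mk.injEq] at hax h1 he
  fin_cases φ <;> fin_cases r <;> simp at hax h1 he ⊢ <;>
    (simp only [abs_eq_max_neg, max_def] at h1; split_ifs at h1 <;> omega)

/-- [g18 `lift_of_ceilingUnit`] a unit ceiling letter next to a ceiling letter forces the lift `P(d ↦ hI)`, as a `(χ+2)`-partner. -/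
theorem lift_of_ceilingUnit {h : ℤ} {C : MConfig} (hU : C.InDiamond h) {P : MCell} (hP : P ∈ C.upper) (hD : RuleDMu4P C P)
    {a d : Fin 4} (had : a ≠ d) (hac : OnCeiling h (P a)) {χ : Fin 4} (hd : P d = ceilingUnit h χ) :
    ∃ N ∈ C.lower, UPartner N P d (χ + 2) ∧ N d = (h, 0, 0) := by
  have hna : ¬ isApex (P d) := by rw [hd]; exact ceilingUnit_not_isApex h χ
  have hk : Adapted (P d) (χ + 2) := by rw [hd]; exact (ceilingUnit_node h χ).1
  have hkh : coord (P d) (χ + 2) ≠ h := by rw [hd, (ceilingUnit_node h χ).2]; omega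
  obtain ⟨N, hN, hNP⟩ := upLine_of_ruleDMu4P hU hP hD had hac hna hk hkh
  have he0 : 0 < (N d).1 - (P d).1 := by have := hNP.2.1; omega
  have e : N d = ray (ceilingUnit h χ) (χ + 2) ((N d).1 - (P d).1) := by rw [← hd]; exact hNP.2.2
  exact ⟨N, hN, hNP, (above_ceilingUnit (hU.1 N hN d) he0 e).2⟩

/-- [g18 `fork_core`] `X = N{·, ·, hI, hI}` (slots 2, 3 apices) with two `P`-children `X(2 ↦ cu_χ)`, `X(2 ↦ cu_χ')`, `χ ≠ χ'` ⇒ X⁺ violated. -/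
theorem fork_core {h : ℤ} {C : MConfig} (hU : C.InDiamond h) (hX : XPlusClosed C) {X : MCell} (hXl : X ∈ C.lower)
    (hX2 : X 2 = (h, 0, 0)) (hX3 : X 3 = (h, 0, 0)) {P₁ P₂ : MCell} (hP₁ : P₁ ∈ C.upper) (hP₂ : P₂ ∈ C.upper)
    {χ χ' : Fin 4} (hχ : χ' ≠ χ) (h1 : MAgree P₁ X 2) (hP₁2 : P₁ 2 = ceilingUnit h χ) (h2 : MAgree P₂ X 2) (hP₂2 : P₂ 2 = ceilingUnit h χ') :
    False := by
  have u1 : UPartner X P₁ 2 (χ + 2) := by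
    refine ⟨h1, by rw [hP₁2, hX2, ceilingUnit_fst]; omega, ?_⟩
    rw [hX2, hP₁2, ceilingUnit_fst, show h - (h - 1) = 1 by ring]
    exact ceilingApex_eq_ray_ceilingUnit h χ
  have u2 : UPartner X P₂ 2 (χ' + 2) := by
    refine ⟨h2, by rw [hP₂2, hX2, ceilingUnit_fst]; omega, ?_⟩
    rw [hX2, hP₂2, ceilingUnit_fst, show h - (h - 1) = 1 by ring]
    exact ceilingApex_eq_ray_ceilingUnit h χ'
  have hr : χ' + 2 ≠ χ + 2 := fun e => hχ (add_right_cancel e)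
  exact xplus_unit_fork hU hX hXl (g := 2) (f := 3) (by decide) hX2 hX3 hP₁ hP₂ hr u1 u2
    (by rw [hP₁2, ceilingUnit_fst]) (by rw [hP₂2, ceilingUnit_fst])

/-- the unit ceiling letter lies on the ceiling: causal top `h`. -/
theorem onCeiling_ceilingUnit (h : ℤ) (χ : Fin 4) : OnCeiling h (ceilingUnit h χ) := by
  show (ray ((h - 2, 0, 0) : BPoint) χ 1).1 + absCharge (ray ((h - 2, 0, 0) : BPoint) χ 1) = h
  rw [top_ray_apex (h - 2) χ (by decide)]; ring

/-- **DESCENT NEXT TO A FLOOR NODE** (KERNEL, every `h`; RULE D at the `N`-cell): an `N`-cell `Z` with a floor-node letter `Z b = c₀·ℓ_φ` (`c₀ ≥ 0`; `c₀ = 0` is … (memo §1) -/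
theorem descent_of_floorNode_floorUnit {h c₀ : ℤ} {C : MConfig} (hU : C.InDiamond h) {Z : MCell} (hD : RuleDMu4N C Z)
    {b c : Fin 4} (hbc : b ≠ c) {φ ψ : Fin 4} (hc₀ : 0 ≤ c₀) (hb : Z b = floorLetter φ c₀) (hc : Z c = floorUnit ψ) :
    ∃ P ∈ C.upper, MAgree P Z c ∧ P c = (0, 0, 0) := by
  have hk : Adapted (Z b) (φ + 2) := by rw [hb]; exact (floorLetter_node φ c₀).1
  have hk0 : coord (Z b) (φ + 2) = 0 := by rw [hb]; exact (floorLetter_node φ c₀).2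
  have hk' : Adapted (Z c) ψ := by rw [hc]; exact (floorUnit_top ψ).1
  have hk'2 : coord (Z c) ψ = 2 := by rw [hc]; exact (floorUnit_top ψ).2
  have hne : coord (Z b) (φ + 2) ≠ coord (Z c) ψ := by rw [hk0, hk'2]; decide
  -- below the floor-node letter only its own ray
  have nob : ∀ P ∈ C.upper, ∀ r : Fin 4, (P b).1 < (Z b).1 → Z b = ray (P b) r ((Z b).1 - (P b).1) → r = φ :=
    fun P hP r hlt hray => by
      have e : floorLetter φ c₀ = ray (P b) r ((Z b).1 - (P b).1) := by rw [← hb]; exact hray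
      exact below_floorLetter (hU.2 P hP b) hc₀ (by omega) e
  rcases hD b c hbc (φ + 2) ψ hk hk' hne with ⟨r, hr, P, hP, hZP⟩ | ⟨r, hr, P, hP, hZP⟩ | ⟨a, a', ha, -, P, hP, -, hb1, hb2, -, -⟩
  · -- `(b, φ+2)` settled below in a direction `r ≠ φ` — impossible
    exact absurd ((nob P hP r hZP.2.1 hZP.2.2).trans (fin4_add_two_add_two φ).symm) hr
  · -- `(c, ψ)` settled below: the server is `Z(c ↦ O)`
    have hd : 0 < (Z c).1 - (P c).1 := by have := hZP.2.1; omega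
    have e : floorUnit ψ = ray (P c) r ((Z c).1 - (P c).1) := by rw [← hc]; exact hZP.2.2
    exact ⟨P, hP, hZP.1, (below_floorUnit (hU.2 P hP c) hd e).2⟩
  · -- covered below: the cover moves the floor-node letter down in a direction `a` with `DirOK (Z b) (φ+2) a`, i.e. `a ≠ φ` — impossible
    have hφ := nob P hP a hb1 hb2
    rcases ha with e | ⟨-, hne2⟩
    · exact absurd (e.symm.trans hφ) (fin4_ne_add_two φ).symm
    · exact (hne2 (hφ.trans (fin4_add_two_add_two φ).symm)).elim

/-- **BELOW `2I + n·ℓ_u` OFF ITS OWN RAY THERE IS ONLY `(n+1)·ℓ_u`, ONE STEP DOWN THE NODE DIRECTION** (every `h`, `n ≥ 1`): a point `z` of ◇_h with `2I + n ℓ_u = …` (memo §1) -/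
theorem below_nodeTwo_offRay {h n d : ℤ} {z : BPoint} {u r : Fin 4} (hn : 1 ≤ n) (hz : InDiamond h z) (hd : 0 < d) (hr : r ≠ u)
    (he : nodeTwoLetter u n = ray z r d) : r = u + 2 ∧ d = 1 ∧ z = floorLetter u (n + 1) := by
  obtain ⟨α, a, b⟩ := z
  obtain ⟨hax, h1, -, -⟩ := hz
  simp only [AxisPt, absCharge, chargeOf, ray, Prod.mk.injEq] at hax h1 he ⊢
  fin_cases u <;> fin_cases r <;> simp at hax h1 he hr ⊢ <;>
    (simp only [abs_eq_max_neg, max_def] at h1; split_ifs at h1 <;> omega)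

/-- **DESCENT OF `2I + n·ℓ_u` NEXT TO A FLOOR NODE** (KERNEL, every `h`; RULE D at the `N`-cell): an `N`-cell `N` with a floor-node letter `N b = c₀·ℓ_φ` (`c₀ ≥ …` (memo §1) -/
theorem descent_of_floorNode_nodeTwo {h c₀ n : ℤ} {C : MConfig} (hU : C.InDiamond h) (hc₀ : 0 ≤ c₀) (hn : 1 ≤ n) {N : MCell}
    (hD : RuleDMu4N C N) {b c : Fin 4} (hbc : b ≠ c) {φ u : Fin 4} (hb : N b = floorLetter φ c₀) (hc : N c = nodeTwoLetter u n) :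
    ∃ P' ∈ C.upper, UPartner N P' c (u + 2) ∧ P' c = floorLetter u (n + 1) := by
  have hk : Adapted (N b) (φ + 2) := by rw [hb]; exact (floorLetter_node φ c₀).1
  have hk0 : coord (N b) (φ + 2) = 0 := by rw [hb]; exact (floorLetter_node φ c₀).2
  have hk' : Adapted (N c) (u + 2) := by rw [hc]; exact (nodeTwoLetter_node u n).1
  have hk'2 : coord (N c) (u + 2) = 2 := by rw [hc]; exact (nodeTwoLetter_node u n).2
  have hne : coord (N b) (φ + 2) ≠ coord (N c) (u + 2) := by rw [hk0, hk'2]; decide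
  have nob : ∀ P ∈ C.upper, ∀ r : Fin 4, (P b).1 < (N b).1 → N b = ray (P b) r ((N b).1 - (P b).1) → r = φ :=
    fun P hP r hlt hray => by
      have e : floorLetter φ c₀ = ray (P b) r ((N b).1 - (P b).1) := by rw [← hb]; exact hray
      exact below_floorLetter (hU.2 P hP b) hc₀ (by omega) e
  rcases hD b c hbc (φ + 2) (u + 2) hk hk' hne with ⟨r, hr, P, hP, hZP⟩ | ⟨r, hr, P, hP, hZP⟩ | ⟨a, a', ha, -, P, hP, -, hb1, hb2, -, -⟩
  · exact absurd ((nob P hP r hZP.2.1 hZP.2.2).trans (fin4_add_two_add_two φ).symm) hr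
  · have hd : 0 < (N c).1 - (P c).1 := by have := hZP.2.1; omega
    have e : nodeTwoLetter u n = ray (P c) r ((N c).1 - (P c).1) := by rw [← hc]; exact hZP.2.2
    have hr' : r ≠ u := fun e' => hr (by rw [e', fin4_add_two_add_two])
    obtain ⟨hr2, -, hz⟩ := below_nodeTwo_offRay hn (hU.2 P hP c) hd hr' e
    subst hr2
    exact ⟨P, hP, hZP, hz⟩
  · have hφ := nob P hP a hb1 hb2
    rcases ha with e | ⟨-, hne2⟩
    · exact absurd (e.symm.trans hφ) (fin4_ne_add_two φ).symm
    · exact (hne2 (hφ.trans (fin4_add_two_add_two φ).symm)).elim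

/-- **THE PAIR CORE** (KERNEL, every `h`). Let `P = P{x, y, cu_χ, cu_χ'}` (`χ ≠ χ'`) be present and suppose a DESCENT RULE: every present `N`-cell `N{x, y, z, w}` … (memo §1) -/
theorem ceilingPair_core {h : ℤ} {C : MConfig} (hU : C.InDiamond h) (hDP : ∀ P ∈ C.upper, RuleDMu4P C P) (hX : XPlusClosed C)
    (hGu : PermClosed C.upper) {P : MCell} (hP : P ∈ C.upper) {χ χ' : Fin 4} (hχ : χ' ≠ χ)
    (h2 : P 2 = ceilingUnit h χ) (h3 : P 3 = ceilingUnit h χ') {x' y' : BPoint}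
    (hdesc : ∀ N ∈ C.lower, N 0 = P 0 → N 1 = P 1 →
      (N 2 = ceilingUnit h χ ∧ N 3 = (h, 0, 0)) ∨ (N 2 = (h, 0, 0) ∧ N 3 = ceilingUnit h χ') →
      ∃ P' ∈ C.upper, P' 0 = x' ∧ P' 1 = y' ∧ P' 2 = N 2 ∧ P' 3 = N 3) : False := by
  -- the two lifts `N₁ = P(3 ↦ hI)`, `N₂ = P(2 ↦ hI)`
  obtain ⟨N₁, hN₁, hN₁P, hN₁3⟩ := lift_of_ceilingUnit hU hP (hDP P hP) (a := 2) (d := 3) (by decide)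
    (by rw [h2]; exact onCeiling_ceilingUnit h χ) h3
  obtain ⟨N₂, hN₂, hN₂P, hN₂2⟩ := lift_of_ceilingUnit hU hP (hDP P hP) (a := 3) (d := 2) (by decide)
    (by rw [h3]; exact onCeiling_ceilingUnit h χ') h2
  have e12 : N₁ 2 = ceilingUnit h χ := (hN₁P.1 2 (by decide)).symm.trans h2
  have e23 : N₂ 3 = ceilingUnit h χ' := (hN₂P.1 3 (by decide)).symm.trans h3
  -- the two descents
  obtain ⟨P₁, hP₁, h10, h11, h12, h13⟩ :=
    hdesc N₁ hN₁ (hN₁P.1 0 (by decide)).symm (hN₁P.1 1 (by decide)).symm (Or.inl ⟨e12, hN₁3⟩)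
  obtain ⟨P₂, hP₂, h20, h21, h22, h23⟩ :=
    hdesc N₂ hN₂ (hN₂P.1 0 (by decide)).symm (hN₂P.1 1 (by decide)).symm (Or.inr ⟨hN₂2, e23⟩)
  rw [e12] at h12; rw [hN₁3] at h13; rw [hN₂2] at h22; rw [e23] at h23
  -- the lift `X = P₁(2 ↦ hI) = N{x', y', hI, hI}`
  obtain ⟨X, hXl, hXP, hX2⟩ := lift_of_ceilingUnit hU hP₁ (hDP P₁ hP₁) (a := 3) (d := 2) (by decide)
    (by rw [h13]; exact onCeiling_apex h) h12
  have hX0 : X 0 = x' := (hXP.1 0 (by decide)).symm.trans h10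
  have hX1 : X 1 = y' := (hXP.1 1 (by decide)).symm.trans h11
  have hX3 : X 3 = (h, 0, 0) := (hXP.1 3 (by decide)).symm.trans h13
  -- the second child `(2 3)·P₂`
  have hQ := hGu (Equiv.swap 2 3) P₂ hP₂
  refine fork_core hU hX hXl hX2 hX3 hP₁ hQ hχ hXP.1 h12 (fun g hg => ?_) ?_
  · show P₂ (Equiv.swap (2 : Fin 4) 3 g) = X g
    fin_cases g
    · simpa [Equiv.swap_apply_of_ne_of_ne] using h20.trans hX0.symm
    · simpa [Equiv.swap_apply_of_ne_of_ne] using h21.trans hX1.symm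
    · exact absurd rfl hg
    · simpa using h22.trans hX3.symm
  · show P₂ (Equiv.swap (2 : Fin 4) 3 2) = ceilingUnit h χ'
    simpa using h23

/-- **PAIR FORK A2** `P{ℓ_φ, c₀·ℓ_ψ, cu_χ, cu_χ'}` (`c₀ ≥ 0`, `χ ≠ χ'`; slots 0,1,2,3; `φ = ψ` allowed, `c₀ = 0` = the origin) **IS ABSENT** from every two-level … (memo §1) -/
theorem pairFork_floorUnit_absent {h c₀ : ℤ} {C : MConfig} (hU : C.InDiamond h) (hDN : ∀ Z ∈ C.lower, RuleDMu4N C Z)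
    (hDP : ∀ P ∈ C.upper, RuleDMu4P C P) (hX : XPlusClosed C) (hGu : PermClosed C.upper) (hc₀ : 0 ≤ c₀) {P : MCell}
    {φ ψ χ χ' : Fin 4} (hχ : χ' ≠ χ) (h0 : P 0 = floorUnit φ) (h1 : P 1 = floorLetter ψ c₀) (h2 : P 2 = ceilingUnit h χ)
    (h3 : P 3 = ceilingUnit h χ') : P ∉ C.upper := fun hP =>
  ceilingPair_core hU hDP hX hGu hP hχ h2 h3 (x' := (0, 0, 0)) (y' := floorLetter ψ c₀) fun N hN hN0 hN1 _ => by
    obtain ⟨P', hP', hagree, hP'0⟩ := descent_of_floorNode_floorUnit hU (hDN N hN) (b := 1) (c := 0) (by decide) hc₀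
      (hN1.trans h1) (hN0.trans h0)
    exact ⟨P', hP', hP'0, (hagree 1 (by decide)).trans (hN1.trans h1), hagree 2 (by decide), hagree 3 (by decide)⟩

/-- **PAIR FORK A1** `P{c₀·ℓ_φ, 2I + n·ℓ_u, cu_χ, cu_χ'}` (`c₀ ≥ 0`, `n ≥ 1`, `χ ≠ χ'`; slots 0,1,2,3) **IS ABSENT** (KERNEL, every `h`, law-free, no `Δ`; same … (memo §1) -/
theorem pairFork_nodeTwo_absent {h c₀ n : ℤ} {C : MConfig} (hU : C.InDiamond h) (hDN : ∀ Z ∈ C.lower, RuleDMu4N C Z)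
    (hDP : ∀ P ∈ C.upper, RuleDMu4P C P) (hX : XPlusClosed C) (hGu : PermClosed C.upper) (hc₀ : 0 ≤ c₀) (hn : 1 ≤ n)
    {P : MCell} {φ u χ χ' : Fin 4} (hχ : χ' ≠ χ) (h0 : P 0 = floorLetter φ c₀) (h1 : P 1 = nodeTwoLetter u n)
    (h2 : P 2 = ceilingUnit h χ) (h3 : P 3 = ceilingUnit h χ') : P ∉ C.upper := fun hP =>
  ceilingPair_core hU hDP hX hGu hP hχ h2 h3 (x' := floorLetter φ c₀) (y' := floorLetter u (n + 1)) fun N hN hN0 hN1 _ => by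
    obtain ⟨P', hP', hNP', hP'1⟩ := descent_of_floorNode_nodeTwo hU hc₀ hn (hDN N hN) (b := 0) (c := 1) (by decide)
      (hN0.trans h0) (hN1.trans h1)
    exact ⟨P', hP', (hNP'.1 0 (by decide)).trans (hN0.trans h0), hP'1, hNP'.1 2 (by decide), hNP'.1 3 (by decide)⟩

theorem nodeTwoLetter_top (u : Fin 4) (n : ℤ) : Adapted (nodeTwoLetter u n) u ∧ coord (nodeTwoLetter u n) u = 2 + 2 * n := by
  refine ⟨(adapted_ray_apex 2 u n).1, ?_⟩
  rw [coord_ray_self, coord_of_isApex ⟨rfl, rfl⟩]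

theorem nodeTwoLetter_flip (u : Fin 4) (n : ℤ) : nodeTwoLetter u n = ray ((2 + 2 * n, 0, 0) : BPoint) (u + 2) (-n) :=
  ray_apex_flip 2 n u

theorem floorLetter_flip (φ : Fin 4) (c : ℤ) : floorLetter φ c = ray ((2 * c, 0, 0) : BPoint) (φ + 2) (-c) := by
  have := ray_apex_flip 0 c φ; simpa using this

/-- [g18] above `2I + m·ℓ_u` along `u` there is one step in ◇_{2m+4}. -/
theorem above_nodeTwoLetter {h m e : ℤ} {z : BPoint} {u : Fin 4} (hh : h = 2 * m + 4) (hm : 0 ≤ m) (he : 0 < e)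
    (hz : InDiamond h z) (hze : z = ray (nodeTwoLetter u m) u e) : e = 1 := by
  have htop := hz.2.2.2
  rw [hze, show ray (nodeTwoLetter u m) u e = ray ((2, 0, 0) : BPoint) u (m + e) from (ray_add _ u m e).symm,
    top_ray_apex 2 u (by omega)] at htop
  omega

/-- [g18] below the ceiling letter `2I + (m+1)ℓ_u` off its own ray there is only the full letter `(m+2)ℓ_u` (in ◇_{2m+4}). -/
theorem below_nodeTwoTop {h m d : ℤ} {z : BPoint} {u r : Fin 4} (hh : h = 2 * m + 4) (hm : 0 ≤ m) (hz : InDiamond h z) (hd : 0 < d)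
    (hr : r ≠ u) (he : nodeTwoLetter u (m + 1) = ray z r d) : r = u + 2 ∧ d = 1 ∧ z = floorLetter u (m + 2) := by
  obtain ⟨α, a, b⟩ := z
  obtain ⟨hax, h1, -, h3⟩ := hz
  simp only [AxisPt, absCharge, chargeOf, ray, Prod.mk.injEq] at hax h1 h3 he ⊢
  fin_cases u <;> fin_cases r <;> simp at hax h1 h3 he hr ⊢ <;>
    (simp only [abs_eq_max_neg, max_def] at h1 h3; split_ifs at h1 h3 <;> omega)

theorem onCeiling_fullLetter {h m : ℤ} (hh : h = 2 * m + 4) (hm : 0 ≤ m) (u : Fin 4) : OnCeiling h (floorLetter u (m + 2)) := by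
  show (ray ((0, 0, 0) : BPoint) u (m + 2)).1 + absCharge (ray ((0, 0, 0) : BPoint) u (m + 2)) = h
  rw [top_ray_apex 0 u (by omega)]; omega

/-- [g18 `twin_lift`] `P{x, 2I + m ℓ_u, hI, …}` (slots 0,1,2) has the `N`-parent `P(1 ↦ 2I + (m+1)ℓ_u)`, as a `u`-partner. -/
theorem twin_lift {h m : ℤ} {C : MConfig} (hU : C.InDiamond h) (hh : h = 2 * m + 4) (hm : 1 ≤ m) {P : MCell} (hP : P ∈ C.upper)
    (hD : RuleDMu4P C P) {u : Fin 4} (h1 : P 1 = nodeTwoLetter u m) (h2 : P 2 = (h, 0, 0)) :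
    ∃ N ∈ C.lower, UPartner N P 1 u ∧ N 1 = nodeTwoLetter u (m + 1) := by
  have hna : ¬ isApex (P 1) := by rw [h1]; exact nodeTwoLetter_not_isApex u (by omega)
  have hk : Adapted (P 1) u := by rw [h1]; exact (nodeTwoLetter_top u m).1
  have hkh : coord (P 1) u ≠ h := by rw [h1, (nodeTwoLetter_top u m).2]; omega
  obtain ⟨N, hN, hNP⟩ := upLine_of_ruleDMu4P hU hP hD (g := 2) (j := 1) (by decide) (by rw [h2]; exact onCeiling_apex h) hna hk hkh
  have he0 : 0 < (N 1).1 - (P 1).1 := by have := hNP.2.1; omega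
  have e : N 1 = ray (nodeTwoLetter u m) u ((N 1).1 - (P 1).1) := by rw [← h1]; exact hNP.2.2
  have he1 := above_nodeTwoLetter hh (by omega) he0 (hU.1 N hN 1) e
  refine ⟨N, hN, hNP, ?_⟩
  rw [e, he1]; exact (ray_add _ u m 1).symm

/-- [g18 `twin_descent`] `N{c·ℓ_φ, 2I + (m+1)ℓ_u, …}` (slots 0,1) has the `P`-child `N(1 ↦ (m+2)ℓ_u)`, as a `(u+2)`-partner. -/
theorem twin_descent {h m c : ℤ} {C : MConfig} (hU : C.InDiamond h) (hh : h = 2 * m + 4) (hm : 0 ≤ m) (hc : 0 ≤ c) {N : MCell}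
    (hD : RuleDMu4N C N) {φ u : Fin 4} (h0 : N 0 = floorLetter φ c) (h1 : N 1 = nodeTwoLetter u (m + 1)) :
    ∃ P' ∈ C.upper, UPartner N P' 1 (u + 2) ∧ P' 1 = floorLetter u (m + 2) := by
  have hk : Adapted (N 0) (φ + 2) := by rw [h0]; exact (floorLetter_node φ c).1
  have hk0 : coord (N 0) (φ + 2) = 0 := by rw [h0]; exact (floorLetter_node φ c).2
  have hk' : Adapted (N 1) (u + 2) := by rw [h1]; exact (nodeTwoLetter_node u (m + 1)).1
  have hk'2 : coord (N 1) (u + 2) = 2 := by rw [h1]; exact (nodeTwoLetter_node u (m + 1)).2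
  have hne : coord (N 0) (φ + 2) ≠ coord (N 1) (u + 2) := by rw [hk0, hk'2]; decide
  have nob : ∀ P ∈ C.upper, ∀ r : Fin 4, (P 0).1 < (N 0).1 → N 0 = ray (P 0) r ((N 0).1 - (P 0).1) → r = φ := fun P hP r hlt hray => by
    have e : floorLetter φ c = ray (P 0) r ((N 0).1 - (P 0).1) := by rw [← h0]; exact hray
    exact below_floorLetter (hU.2 P hP 0) hc (by omega) e
  rcases hD 0 1 (by decide) (φ + 2) (u + 2) hk hk' hne with ⟨r, hr, P, hP, hZP⟩ | ⟨r, hr, P, hP, hZP⟩ | ⟨a, a', ha, -, P, hP, -, hb1, hb2, -, -⟩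
  · exact absurd ((nob P hP r hZP.2.1 hZP.2.2).trans (fin4_add_two_add_two φ).symm) hr
  · have hd : 0 < (N 1).1 - (P 1).1 := by have := hZP.2.1; omega
    have e : nodeTwoLetter u (m + 1) = ray (P 1) r ((N 1).1 - (P 1).1) := by rw [← h1]; exact hZP.2.2
    have hr' : r ≠ u := fun e' => hr (by rw [e', fin4_add_two_add_two])
    obtain ⟨hr2, -, hz⟩ := below_nodeTwoTop hh hm (hU.2 P hP 1) hd hr' e
    subst hr2
    exact ⟨P, hP, hZP, hz⟩
  · have hφ := nob P hP a hb1 hb2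
    rcases ha with e | ⟨-, hne2⟩
    · exact absurd (e.symm.trans hφ) (fin4_ne_add_two φ).symm
    · exact (hne2 (hφ.trans (fin4_add_two_add_two φ).symm)).elim

/-- [g18 `twinForkFamily_absent`] THE TWIN FORK `P{c·ℓ_φ, 2I + m·ℓ_u, hI, w}` (slots 0,1,2; slot 3 arbitrary; `c ≥ 0`, `h = 2m+4`, `m ≥ 1`) is absent from every … (memo §1) -/
theorem twinForkFamily_absent {h m c : ℤ} {C : MConfig} (hU : C.InDiamond h) (hDN : ∀ Z ∈ C.lower, RuleDMu4N C Z)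
    (hDP : ∀ P ∈ C.upper, RuleDMu4P C P) (hX : XPlusClosed C) (hh : h = 2 * m + 4) (hm : 1 ≤ m) (hc : 0 ≤ c)
    {P : MCell} {φ u : Fin 4} (h0 : P 0 = floorLetter φ c) (h1 : P 1 = nodeTwoLetter u m) (h2 : P 2 = (h, 0, 0)) :
    P ∉ C.upper := fun hP => by
  obtain ⟨N, hN, hNP, hN1⟩ := twin_lift hU hh hm hP (hDP P hP) h1 h2
  have hN0 : N 0 = floorLetter φ c := (hNP.1 0 (by decide)).symm.trans h0
  have hN2 : N 2 = (h, 0, 0) := (hNP.1 2 (by decide)).symm.trans h2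
  obtain ⟨P', hP', hNP', hP'1⟩ := twin_descent hU hh (by omega) hc (hDN N hN) hN0 hN1
  have hz : N 1 = ray ((h, 0, 0) : BPoint) (u + 2) (-(m + 1)) := by
    rw [hN1, nodeTwoLetter_flip]; congr 2; omega
  have hw : P' 1 = ray ((h, 0, 0) : BPoint) (u + 2) (-(m + 2)) := by
    rw [hP'1, floorLetter_flip]; congr 2; omega
  have hy : P 1 = ray (N 1) (u + 2 + 2) (-1) := by
    rw [fin4_add_two_add_two, hN1, h1, ← ray_add]; congr 1; omega
  refine xplus_fork hU hX hN (g := 1) (f := 2) (by decide) hN2 hP hP' (r₁ := u) (r₂ := u + 2) (fin4_ne_add_two u).symm hNP hNP'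
    (by rw [h1]; exact nodeTwoLetter_not_isApex u (by omega)) ?_ ?_ ?_
  · intro X hX' hXP
    have he0 : 0 < (X 1).1 - (P 1).1 := by have := hXP.2.1; omega
    have e : X 1 = ray (nodeTwoLetter u m) u ((X 1).1 - (P 1).1) := by rw [← h1]; exact hXP.2.2
    have := above_nodeTwoLetter hh (by omega) he0 (hU.1 X hX' 1) e
    have hP1 : (P 1).1 = 2 + m := by rw [h1, nodeTwoLetter_fst]
    have hN1' : (N 1).1 = 2 + (m + 1) := by rw [hN1, nodeTwoLetter_fst]
    omega
  · intro X _ _ hlt1 hlt2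
    exfalso
    have hN1' : (N 1).1 = 2 + (m + 1) := by rw [hN1, nodeTwoLetter_fst]
    have hP'1' : (P' 1).1 = m + 2 := by rw [hP'1, floorLetter_fst]
    omega
  · intro X hX' _ _ hE hnT
    have hXc : OnCeiling h (X 1) :=
      onCeiling_of_effective_above (by rw [hP'1]; exact onCeiling_fullLetter hh (by omega) u) (hU.2 P' hP' 1).1 (hU.1 X hX' 1) hE
    obtain ⟨d₂, -, -, hx⟩ := ceiling_effective_sameRay (by omega : (0 : ℤ) < m + 2) hw hXc (hU.1 X hX' 1).1 hE
    exact fork_effective one_pos hz hy hx hnT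

/-- the top direction `φ` of the floor letter `c·ℓ_φ` carries the coordinate `2c`. -/
theorem floorLetter_top (φ : Fin 4) (c : ℤ) : Adapted (floorLetter φ c) φ ∧ coord (floorLetter φ c) φ = 2 * c := by
  refine ⟨(adapted_ray_apex 0 φ c).1, ?_⟩
  rw [coord_ray_self, coord_of_isApex ⟨rfl, rfl⟩]; show (0 : ℤ) + 2 * c = 2 * c; ring

/-- **THE TOWER SERVER** (KERNEL, every `h`; RULE D at the `N`-cell): an `N`-cell with a floor TOWER `N t = c·ℓ_φ`, `c ≥ 1`, and a floor-node letter `N s = c'·ℓ_ψ` … (memo §1) -/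
theorem towerServer {h c c' : ℤ} {C : MConfig} (hU : C.InDiamond h) {N : MCell} (hD : RuleDMu4N C N) {t s : Fin 4} (hts : t ≠ s)
    {φ ψ : Fin 4} (hc : 1 ≤ c) (hc' : 0 ≤ c') (ht : N t = floorLetter φ c) (hs : N s = floorLetter ψ c') :
    ∃ P ∈ C.upper, MAgree P N t ∧ ∃ d, 0 < d ∧ 0 ≤ c - d ∧ P t = floorLetter φ (c - d) := by
  have hk : Adapted (N s) (ψ + 2) := by rw [hs]; exact (floorLetter_node ψ c').1
  have hk0 : coord (N s) (ψ + 2) = 0 := by rw [hs]; exact (floorLetter_node ψ c').2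
  have hk' : Adapted (N t) φ := by rw [ht]; exact (floorLetter_top φ c).1
  have hk'2 : coord (N t) φ = 2 * c := by rw [ht]; exact (floorLetter_top φ c).2
  have hne : coord (N s) (ψ + 2) ≠ coord (N t) φ := by rw [hk0, hk'2]; omega
  have nob : ∀ P ∈ C.upper, ∀ r : Fin 4, (P s).1 < (N s).1 → N s = ray (P s) r ((N s).1 - (P s).1) → r = ψ :=
    fun P hP r hlt hray => by
      have e : floorLetter ψ c' = ray (P s) r ((N s).1 - (P s).1) := by rw [← hs]; exact hray
      exact below_floorLetter (hU.2 P hP s) hc' (by omega) e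
  rcases hD s t hts.symm (ψ + 2) φ hk hk' hne with ⟨r, hr, P, hP, hZP⟩ | ⟨r, -, P, hP, hZP⟩ | ⟨a, a', ha, -, P, hP, -, hb1, hb2, -, -⟩
  · exact absurd ((nob P hP r hZP.2.1 hZP.2.2).trans (fin4_add_two_add_two ψ).symm) hr
  · -- the tower is settled below: along its own ray, by `(c−d)ℓ_φ`
    have hd : 0 < (N t).1 - (P t).1 := by have := hZP.2.1; omega
    have e : floorLetter φ c = ray (P t) r ((N t).1 - (P t).1) := by rw [← ht]; exact hZP.2.2
    have hr := below_floorLetter (hU.2 P hP t) (by omega) hd e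
    rw [hr] at e
    have hNt : (N t).1 = c := by rw [ht, floorLetter_fst]
    have h0 : 0 ≤ (P t).1 := (inDiamond_bounds (hU.2 P hP t)).1
    have hPt : P t = floorLetter φ (c - ((N t).1 - (P t).1)) := by
      have h' := (eq_ray_neg e).trans (ray_add _ φ c _).symm
      rwa [← sub_eq_add_neg] at h'
    exact ⟨P, hP, hZP.1, (N t).1 - (P t).1, hd, by omega, hPt⟩
  · have hψ := nob P hP a hb1 hb2
    rcases ha with e | ⟨-, hne2⟩
    · exact absurd (e.symm.trans hψ) (fin4_ne_add_two ψ).symm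
    · exact (hne2 (hψ.trans (fin4_add_two_add_two ψ).symm)).elim

/-- **TN0 — A FLOOR TOWER OVER THE TWIN FORK** `N{c·ℓ_φ, 2I + m·ℓ_u, hI, c'·ℓ_ψ}` (slots 0,1,2,3; `c, c' ≥ 0`, not both `0`; `h = 2m+4`, `m ≥ 1`) **IS ABSENT** … (memo §1) -/
theorem twinTower_N_absent {h m c c' : ℤ} {C : MConfig} (hU : C.InDiamond h) (hDN : ∀ Z ∈ C.lower, RuleDMu4N C Z)
    (hDP : ∀ P ∈ C.upper, RuleDMu4P C P) (hX : XPlusClosed C) (hh : h = 2 * m + 4) (hm : 1 ≤ m) (hc : 0 ≤ c) (hc' : 0 ≤ c')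
    (hcc : 1 ≤ c ∨ 1 ≤ c') {N : MCell} {φ u ψ : Fin 4} (h0 : N 0 = floorLetter φ c) (h1 : N 1 = nodeTwoLetter u m)
    (h2 : N 2 = (h, 0, 0)) (h3 : N 3 = floorLetter ψ c') : N ∉ C.lower := fun hN => by
  rcases hcc with hc1 | hc1
  · obtain ⟨P, hP, hagree, d, -, hcd, hPt⟩ := towerServer hU (hDN N hN) (t := 0) (s := 3) (by decide) hc1 hc' h0 h3
    exact twinForkFamily_absent hU hDN hDP hX hh hm hcd hPt ((hagree 1 (by decide)).trans h1) ((hagree 2 (by decide)).trans h2) hP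
  · obtain ⟨P, hP, hagree, d, -, -, -⟩ := towerServer hU (hDN N hN) (t := 3) (s := 0) (by decide) hc1 hc h3 h0
    exact twinForkFamily_absent hU hDN hDP hX hh hm hc ((hagree 0 (by decide)).trans h0) ((hagree 1 (by decide)).trans h1)
      ((hagree 2 (by decide)).trans h2) hP

/-- **TP1 — A UNIT CEILING LETTER OVER THE TWIN FORK, lifted through a FULL FLOOR LETTER** `P{c·ℓ_φ, 2I + m·ℓ_u, cu_χ, (m+2)·ℓ_ψ}` (slots 0,1,2,3; `c ≥ 0`) **IS … (memo §1) -/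
theorem twinTower_full_absent {h m c : ℤ} {C : MConfig} (hU : C.InDiamond h) (hDN : ∀ Z ∈ C.lower, RuleDMu4N C Z)
    (hDP : ∀ P ∈ C.upper, RuleDMu4P C P) (hX : XPlusClosed C) (hh : h = 2 * m + 4) (hm : 1 ≤ m) (hc : 0 ≤ c) {P : MCell}
    {φ u χ ψ : Fin 4} (h0 : P 0 = floorLetter φ c) (h1 : P 1 = nodeTwoLetter u m) (h2 : P 2 = ceilingUnit h χ)
    (h3 : P 3 = floorLetter ψ (m + 2)) : P ∉ C.upper := fun hP => by
  obtain ⟨N, hN, hNP, hN2⟩ := lift_of_ceilingUnit hU hP (hDP P hP) (a := 3) (d := 2) (by decide)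
    (by rw [h3]; exact onCeiling_fullLetter hh (by omega) ψ) h2
  exact twinTower_N_absent hU hDN hDP hX hh hm hc (by omega : (0 : ℤ) ≤ m + 2) (Or.inr (by omega))
    ((hNP.1 0 (by decide)).symm.trans h0) ((hNP.1 1 (by decide)).symm.trans h1) hN2 ((hNP.1 3 (by decide)).symm.trans h3) hN

/-- **TN2** `N{ℓ_φ, 2I + n·ℓ_u, cu_χ, cu_χ'}` (slots 0,1,2,3; `n ≥ 1`, `χ ≠ χ'`) **IS ABSENT** (KERNEL, every `h`; ◇_h, RULE D, X⁺, `S₄` on the `P`-level): the §1 … (memo §1) -/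
theorem unitNodeTwo_pair_N_absent {h n : ℤ} {C : MConfig} (hU : C.InDiamond h) (hDN : ∀ Z ∈ C.lower, RuleDMu4N C Z)
    (hDP : ∀ P ∈ C.upper, RuleDMu4P C P) (hX : XPlusClosed C) (hGu : PermClosed C.upper) (hn : 1 ≤ n) {N : MCell}
    {φ u χ χ' : Fin 4} (hχ : χ' ≠ χ) (h0 : N 0 = floorUnit φ) (h1 : N 1 = nodeTwoLetter u n) (h2 : N 2 = ceilingUnit h χ)
    (h3 : N 3 = ceilingUnit h χ') : N ∉ C.lower := fun hN => by
  have h0' : N 0 = floorLetter φ 1 := h0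
  obtain ⟨P, hP, hNP, hP1⟩ := descent_of_floorNode_nodeTwo hU zero_le_one hn (hDN N hN) (b := 0) (c := 1) (by decide) h0' h1
  exact pairFork_floorUnit_absent hU hDN hDP hX hGu (by omega : (0 : ℤ) ≤ n + 1) hχ ((hNP.1 0 (by decide)).trans h0) hP1
    ((hNP.1 2 (by decide)).trans h2) ((hNP.1 3 (by decide)).trans h3) hP

/-- a letter of ◇_h other than the origin has an adapted frame direction with NON-ZERO coordinate (a floor letter: its top direction; any other
letter: every adapted direction). -/
theorem exists_coord_ne_zero {h : ℤ} {x : BPoint} (hx : InDiamond h x) (hO : x ≠ (0, 0, 0)) :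
    ∃ k : Fin 4, Adapted x k ∧ coord x k ≠ 0 := by
  obtain ⟨α, a, b⟩ := x
  have hax := hx.1
  simp only [AxisPt, Prod.mk.injEq] at hax
  have hO' : ¬ (α = 0 ∧ a = 0 ∧ b = 0) := fun ⟨e1, e2, e3⟩ => hO (by rw [e1, e2, e3])
  rcases hax with ⟨ha, hb⟩ | ⟨ha, hb⟩ | ⟨ha, hb⟩
  · subst ha; subst hb
    refine ⟨0, by simp [Adapted], ?_⟩
    simp only [coord, Matrix.cons_val_zero]; omega
  · subst hb
    by_cases hc : α + a = 0
    · refine ⟨2, by simp [Adapted], ?_⟩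
      have e : coord ((α, a, (0 : ℤ)) : BPoint) 2 = α + -a := by simp [coord]
      rw [e]; omega
    · refine ⟨0, by simp [Adapted], ?_⟩
      simp only [coord, Matrix.cons_val_zero]; exact hc
  · subst ha
    by_cases hc : α + b = 0
    · refine ⟨1, by simp [Adapted], ?_⟩
      have e : coord ((α, (0 : ℤ), b) : BPoint) 1 = α + -b := by simp [coord]
      rw [e]; omega
    · refine ⟨3, by simp [Adapted], ?_⟩
      have e : coord ((α, (0 : ℤ), b) : BPoint) 3 = α + b := by simp [coord]
      rw [e]; exact hc

/-- a ceiling letter of ◇_h, `h > 0`, is not the origin. -/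
theorem ne_origin_of_onCeiling {h : ℤ} {x : BPoint} (hh : 0 < h) (hx : OnCeiling h x) : x ≠ (0, 0, 0) := fun e => by
  subst e
  have : (0 : ℤ) + |(0 : ℤ) - 0| = h := hx
  simp at this; omega

/-- the twin fork with the floor letter on SLOT 3 and slot 0 free (from §6 by the slot swap `(0 3)`, `PermClosed C.upper`). -/
theorem twinFork_slot3_absent {h m c : ℤ} {C : MConfig} (hU : C.InDiamond h) (hDN : ∀ Z ∈ C.lower, RuleDMu4N C Z)
    (hDP : ∀ P ∈ C.upper, RuleDMu4P C P) (hX : XPlusClosed C) (hGu : PermClosed C.upper) (hh : h = 2 * m + 4) (hm : 1 ≤ m)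
    (hc : 0 ≤ c) {P : MCell} {u ψ : Fin 4} (h1 : P 1 = nodeTwoLetter u m) (h2 : P 2 = (h, 0, 0)) (h3 : P 3 = floorLetter ψ c) :
    P ∉ C.upper := fun hP =>
  twinForkFamily_absent hU hDN hDP hX hh hm hc (P := P.perm (Equiv.swap 0 3)) (φ := ψ) (u := u)
    (by show P (Equiv.swap (0 : Fin 4) 3 0) = _; simpa using h3)
    (by show P (Equiv.swap (0 : Fin 4) 3 1) = _; simpa [Equiv.swap_apply_of_ne_of_ne] using h1)
    (by show P (Equiv.swap (0 : Fin 4) 3 2) = _; simpa [Equiv.swap_apply_of_ne_of_ne] using h2)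
    (hGu _ P hP)

/-- **TN3 — ANY LETTER OVER THE TWIN FORK** (KERNEL; ◇_h, RULE D on both levels, X⁺, `S₄` on the `P`-level; `h = 2m+4`, `m ≥ 1`, `c ≥ 0`): `N{x, 2I + m·ℓ_u, hI, …` (memo §1) -/
theorem twinFloor_N_absent {h m c : ℤ} {C : MConfig} (hU : C.InDiamond h) (hDN : ∀ Z ∈ C.lower, RuleDMu4N C Z)
    (hDP : ∀ P ∈ C.upper, RuleDMu4P C P) (hX : XPlusClosed C) (hGu : PermClosed C.upper) (hh : h = 2 * m + 4) (hm : 1 ≤ m)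
    (hc : 0 ≤ c) {N : MCell} {u ψ k : Fin 4} (hk : Adapted (N 0) k) (hk0 : coord (N 0) k ≠ 0) (h1 : N 1 = nodeTwoLetter u m)
    (h2 : N 2 = (h, 0, 0)) (h3 : N 3 = floorLetter ψ c) : N ∉ C.lower := fun hN => by
  have hk' : Adapted (N 3) (ψ + 2) := by rw [h3]; exact (floorLetter_node ψ c).1
  have hk'0 : coord (N 3) (ψ + 2) = 0 := by rw [h3]; exact (floorLetter_node ψ c).2
  have hne : coord (N 0) k ≠ coord (N 3) (ψ + 2) := by rw [hk'0]; exact hk0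
  have nob : ∀ P ∈ C.upper, ∀ r : Fin 4, (P 3).1 < (N 3).1 → N 3 = ray (P 3) r ((N 3).1 - (P 3).1) → r = ψ :=
    fun P hP r hlt hray => by
      have e : floorLetter ψ c = ray (P 3) r ((N 3).1 - (P 3).1) := by rw [← h3]; exact hray
      exact below_floorLetter (hU.2 P hP 3) hc (by omega) e
  rcases hDN N hN 0 3 (by decide) k (ψ + 2) hk hk' hne with ⟨r, -, P, hP, hZP⟩ | ⟨r, hr, P, hP, hZP⟩ | ⟨a, a', -, ha', P, hP, -, -, -, hc1, hc2⟩
  · -- `x` served below by anything: the child is a twin-fork cell (floor letter on slot 3)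
    exact twinFork_slot3_absent hU hDN hDP hX hGu hh hm hc ((hZP.1 1 (by decide)).trans h1) ((hZP.1 2 (by decide)).trans h2)
      ((hZP.1 3 (by decide)).trans h3) hP
  · exact absurd ((nob P hP r hZP.2.1 hZP.2.2).trans (fin4_add_two_add_two ψ).symm) hr
  · have hψ := nob P hP a' hc1 hc2
    rcases ha' with e | ⟨-, hne2⟩
    · exact absurd (e.symm.trans hψ) (fin4_ne_add_two ψ).symm
    · exact (hne2 (hψ.trans (fin4_add_two_add_two ψ).symm)).elim

/-- TN3 with the hypothesis `x ≠ O` (the letter lies in ◇_h because the design does). -/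
theorem twinFloor_N_absent' {h m c : ℤ} {C : MConfig} (hU : C.InDiamond h) (hDN : ∀ Z ∈ C.lower, RuleDMu4N C Z)
    (hDP : ∀ P ∈ C.upper, RuleDMu4P C P) (hX : XPlusClosed C) (hGu : PermClosed C.upper) (hh : h = 2 * m + 4) (hm : 1 ≤ m)
    (hc : 0 ≤ c) {N : MCell} {u ψ : Fin 4} (hx : N 0 ≠ (0, 0, 0)) (h1 : N 1 = nodeTwoLetter u m) (h2 : N 2 = (h, 0, 0))
    (h3 : N 3 = floorLetter ψ c) : N ∉ C.lower := fun hN => by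
  obtain ⟨k, hk, hk0⟩ := exists_coord_ne_zero (hU.1 N hN 0) hx
  exact twinFloor_N_absent hU hDN hDP hX hGu hh hm hc hk hk0 h1 h2 h3 hN

/-- **TP3** `P{x, 2I + m·ℓ_u, cu_χ, (m+2)·ℓ_ψ}` (slots 0,1,2,3; any `x ≠ O`) **IS ABSENT** (KERNEL): the lift `P(2 ↦ hI)` through the full letter is TN3. -/
theorem twinFloor_full_absent {h m : ℤ} {C : MConfig} (hU : C.InDiamond h) (hDN : ∀ Z ∈ C.lower, RuleDMu4N C Z)
    (hDP : ∀ P ∈ C.upper, RuleDMu4P C P) (hX : XPlusClosed C) (hGu : PermClosed C.upper) (hh : h = 2 * m + 4) (hm : 1 ≤ m)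
    {P : MCell} {u χ ψ : Fin 4} (hx : P 0 ≠ (0, 0, 0)) (h1 : P 1 = nodeTwoLetter u m) (h2 : P 2 = ceilingUnit h χ)
    (h3 : P 3 = floorLetter ψ (m + 2)) : P ∉ C.upper := fun hP => by
  obtain ⟨N, hN, hNP, hN2⟩ := lift_of_ceilingUnit hU hP (hDP P hP) (a := 3) (d := 2) (by decide)
    (by rw [h3]; exact onCeiling_fullLetter hh (by omega) ψ) h2
  have hN0 : N 0 = P 0 := (hNP.1 0 (by decide)).symm
  exact twinFloor_N_absent' hU hDN hDP hX hGu hh hm (by omega : (0 : ℤ) ≤ m + 2) (by rw [hN0]; exact hx)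
    ((hNP.1 1 (by decide)).symm.trans h1) hN2 ((hNP.1 3 (by decide)).symm.trans h3) hN

/-- **TP5** `P{x, 2I + m·ℓ_u, cu_χ, c·ℓ_ψ}` (slots 0,1,2,3; `x` ON THE CEILING, `c ≥ 0`) **IS ABSENT** (KERNEL): the lift `P(2 ↦ hI)` through `x` is TN3. (memo §1) -/
theorem twinCeiling_floor_absent {h m c : ℤ} {C : MConfig} (hU : C.InDiamond h) (hDN : ∀ Z ∈ C.lower, RuleDMu4N C Z)
    (hDP : ∀ P ∈ C.upper, RuleDMu4P C P) (hX : XPlusClosed C) (hGu : PermClosed C.upper) (hh : h = 2 * m + 4) (hm : 1 ≤ m)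
    (hc : 0 ≤ c) {P : MCell} {u χ ψ : Fin 4} (h0 : OnCeiling h (P 0)) (h1 : P 1 = nodeTwoLetter u m) (h2 : P 2 = ceilingUnit h χ)
    (h3 : P 3 = floorLetter ψ c) : P ∉ C.upper := fun hP => by
  obtain ⟨N, hN, hNP, hN2⟩ := lift_of_ceilingUnit hU hP (hDP P hP) (a := 0) (d := 2) (by decide) h0 h2
  have hN0 : N 0 = P 0 := (hNP.1 0 (by decide)).symm
  exact twinFloor_N_absent' hU hDN hDP hX hGu hh hm hc (by rw [hN0]; exact ne_origin_of_onCeiling (by omega) h0)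
    ((hNP.1 1 (by decide)).symm.trans h1) hN2 ((hNP.1 3 (by decide)).symm.trans h3) hN

/-- the slot-swapped TP5: `P{c·ℓ_φ, 2I + m·ℓ_u, cu_χ, y}` with `y` on the ceiling (slots 0,1,2,3). -/
theorem twinCeiling_floor_absent_swap {h m c : ℤ} {C : MConfig} (hU : C.InDiamond h) (hDN : ∀ Z ∈ C.lower, RuleDMu4N C Z)
    (hDP : ∀ P ∈ C.upper, RuleDMu4P C P) (hX : XPlusClosed C) (hGu : PermClosed C.upper) (hh : h = 2 * m + 4) (hm : 1 ≤ m)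
    (hc : 0 ≤ c) {P : MCell} {φ u χ : Fin 4} (h0 : P 0 = floorLetter φ c) (h1 : P 1 = nodeTwoLetter u m) (h2 : P 2 = ceilingUnit h χ)
    (h3 : OnCeiling h (P 3)) : P ∉ C.upper := fun hP =>
  twinCeiling_floor_absent hU hDN hDP hX hGu hh hm hc (P := P.perm (Equiv.swap 0 3)) (u := u) (χ := χ) (ψ := φ)
    (by show OnCeiling h (P (Equiv.swap (0 : Fin 4) 3 0)); simpa using h3)
    (by show P (Equiv.swap (0 : Fin 4) 3 1) = _; simpa [Equiv.swap_apply_of_ne_of_ne] using h1)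
    (by show P (Equiv.swap (0 : Fin 4) 3 2) = _; simpa [Equiv.swap_apply_of_ne_of_ne] using h2)
    (by show P (Equiv.swap (0 : Fin 4) 3 3) = _; simpa using h0)
    (hGu _ P hP)

/-- the CEILING-LINE letter `y_d = (h − 2 − 2d)·I + (1 + d)·ℓ_χ` (`d = 0`: `cu_χ`; top coordinate `h`). -/
abbrev ceilLetter (h : ℤ) (χ : Fin 4) (d : ℤ) : BPoint := ray ((h - 2 - 2 * d, 0, 0) : BPoint) χ (1 + d)

/-- the SUB-CEILING-LINE letter `s_k = 2k·I + (m + 1 − k)·ℓ_v` of ◇_{2m+4} (`k = 1`: `2I + m·ℓ_v`; top coordinate `h − 2`). -/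
abbrev subCeilLetter (m : ℤ) (v : Fin 4) (k : ℤ) : BPoint := ray ((2 * k, 0, 0) : BPoint) v (m + 1 - k)

theorem ceilLetter_node (h : ℤ) (χ : Fin 4) (d : ℤ) :
    Adapted (ceilLetter h χ d) (χ + 2) ∧ coord (ceilLetter h χ d) (χ + 2) = h - 2 - 2 * d :=
  ⟨(adapted_ray_apex _ χ _).2, coord_ray_apex_antip _ χ _⟩

theorem onCeiling_ceilLetter {h d : ℤ} (hd : 0 ≤ 1 + d) (χ : Fin 4) : OnCeiling h (ceilLetter h χ d) := by
  show (ray ((h - 2 - 2 * d, 0, 0) : BPoint) χ (1 + d)).1 + absCharge (ray ((h - 2 - 2 * d, 0, 0) : BPoint) χ (1 + d)) = h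
  rw [top_ray_apex (h - 2 - 2 * d) χ hd]; ring

theorem subCeilLetter_node (m : ℤ) (v : Fin 4) (k : ℤ) :
    Adapted (subCeilLetter m v k) (v + 2) ∧ coord (subCeilLetter m v k) (v + 2) = 2 * k :=
  ⟨(adapted_ray_apex _ v _).2, coord_ray_apex_antip _ v _⟩

theorem subCeilLetter_top (m : ℤ) (v : Fin 4) (k : ℤ) :
    Adapted (subCeilLetter m v k) v ∧ coord (subCeilLetter m v k) v = 2 * k + 2 * (m + 1 - k) := by
  refine ⟨(adapted_ray_apex _ v _).1, ?_⟩
  rw [coord_ray_self, coord_of_isApex ⟨rfl, rfl⟩]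

theorem subCeilLetter_not_isApex {m k : ℤ} (v : Fin 4) (hk : m + 1 - k ≠ 0) : ¬ isApex (subCeilLetter m v k) := by
  fin_cases v <;> simp [ray, isApex, hk] <;> omega

/-- the up-step along the ray: `s_k + ℓ_v = y_{m+1−k}` (`h = 2m+4`). -/
theorem subCeilLetter_up {h m : ℤ} (hh : h = 2 * m + 4) (v : Fin 4) (k : ℤ) :
    ray (subCeilLetter m v k) v 1 = ceilLetter h v (m + 1 - k) := by
  have e1 : (h - 2 - 2 * (m + 1 - k) : ℤ) = 2 * k := by rw [hh]; ring
  have e2 : (1 + (m + 1 - k) : ℤ) = m + 1 - k + 1 := by ring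
  show ray (subCeilLetter m v k) v 1 = ray ((h - 2 - 2 * (m + 1 - k), 0, 0) : BPoint) v (1 + (m + 1 - k))
  rw [e1, e2]; exact (ray_add _ v _ 1).symm

/-- one diamond step above a sub-ceiling letter along its ray. -/
theorem above_subCeilLetter {h m k e : ℤ} {z : BPoint} {v : Fin 4} (hh : h = 2 * m + 4) (hk : k ≤ m + 1) (he : 0 < e)
    (hz : InDiamond h z) (hze : z = ray (subCeilLetter m v k) v e) : e = 1 := by
  have htop := hz.2.2.2
  rw [hze, show ray (subCeilLetter m v k) v e = ray ((2 * k, 0, 0) : BPoint) v (m + 1 - k + e) from (ray_add _ v _ e).symm,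
    top_ray_apex (2 * k) v (by omega)] at htop
  omega

/-- one diamond step above `(m+1)·ℓ_ψ` along its ray. -/
theorem above_subFullLetter {h m e : ℤ} {z : BPoint} {ψ : Fin 4} (hh : h = 2 * m + 4) (hm : 0 ≤ m) (he : 0 < e)
    (hz : InDiamond h z) (hze : z = ray (floorLetter ψ (m + 1)) ψ e) : e = 1 := by
  have htop := hz.2.2.2
  rw [hze, show ray (floorLetter ψ (m + 1)) ψ e = ray ((0, 0, 0) : BPoint) ψ (m + 1 + e) from (ray_add _ ψ _ e).symm,
    top_ray_apex 0 ψ (by omega)] at htop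
  omega

/-- one diamond step above the sub-ceiling apex `(h−2)·I`. -/
theorem above_subApex {h e : ℤ} {z : BPoint} {r : Fin 4} (he : 0 < e) (hz : InDiamond h z)
    (hze : z = ray ((h - 2, 0, 0) : BPoint) r e) : e = 1 := by
  have htop := hz.2.2.2
  rw [hze, top_ray_apex (h - 2) r (by omega)] at htop
  omega

/-- THE OFF-RAY STEP PRESERVES THE TOP: a diamond server below a ceiling-line letter `y_d` (`d ≥ 0`) off its ray is ON THE CEILING. -/
theorem onCeiling_below_ceilLetter {h d e : ℤ} {z : BPoint} {χ r : Fin 4} (hd : 0 ≤ d) (hz : InDiamond h z) (he : 0 < e)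
    (hr : r ≠ χ) (heq : ceilLetter h χ d = ray z r e) : OnCeiling h z := by
  obtain ⟨α, a, b⟩ := z
  obtain ⟨hax, h1, -, -⟩ := hz
  simp only [AxisPt, absCharge, chargeOf, ray, Prod.mk.injEq, OnCeiling] at hax h1 heq ⊢
  fin_cases χ <;> fin_cases r <;> simp at hax h1 heq hr ⊢ <;>
    (simp only [abs_eq_max_neg, max_def] at h1 ⊢; split_ifs at h1 ⊢ <;> omega)

/-- below a sub-ceiling letter `s_k` (`k ≤ m`, so charged) off its ray: exactly the `s_{k'}`, `0 ≤ k' < k`. -/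
theorem below_subCeilLetter_offRay {h m k e : ℤ} {z : BPoint} {v r : Fin 4} (hk : k ≤ m) (hz : InDiamond h z) (he : 0 < e)
    (hr : r ≠ v) (heq : subCeilLetter m v k = ray z r e) : ∃ k', 0 ≤ k' ∧ k' < k ∧ z = subCeilLetter m v k' := by
  refine ⟨k - e, ?_, by omega, ?_⟩ <;> obtain ⟨α, a, b⟩ := z <;> obtain ⟨hax, h1, -, -⟩ := hz <;>
    simp only [AxisPt, absCharge, chargeOf, ray, Prod.mk.injEq] at hax h1 heq ⊢ <;>
    fin_cases v <;> fin_cases r <;> simp at hax h1 heq hr ⊢ <;>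
    (simp only [abs_eq_max_neg, max_def] at h1; split_ifs at h1 <;> omega)

/-- **TN8.** `N{c·ℓ_φ, 2I + m·ℓ_u, cu_χ, y_d} ∉ C.lower` for the ceiling-line letter `y_d = (h−2−2d)I + (1+d)ℓ_{χ'}`, `0 ≤ d ≤ m` (`h = 2m+4`, `m ≥ 1`, `c ≥ 0`; `d …` (memo §1) -/
theorem ceilLetter_N_absent {h m c d : ℤ} {C : MConfig} (hU : C.InDiamond h) (hDN : ∀ Z ∈ C.lower, RuleDMu4N C Z)
    (hDP : ∀ P ∈ C.upper, RuleDMu4P C P) (hX : XPlusClosed C) (hGu : PermClosed C.upper) (hh : h = 2 * m + 4) (hm : 1 ≤ m) (hc : 0 ≤ c)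
    (hd : 0 ≤ d) (hdm : d ≤ m) {N : MCell} {φ u χ χ' : Fin 4} (h0 : N 0 = floorLetter φ c) (h1 : N 1 = nodeTwoLetter u m)
    (h2 : N 2 = ceilingUnit h χ) (h3 : N 3 = ceilLetter h χ' d) : N ∉ C.lower := fun hN => by
  have hk : Adapted (N 0) (φ + 2) := by rw [h0]; exact (floorLetter_node φ c).1
  have hk0 : coord (N 0) (φ + 2) = 0 := by rw [h0]; exact (floorLetter_node φ c).2
  have hk' : Adapted (N 3) (χ' + 2) := by rw [h3]; exact (ceilLetter_node h χ' d).1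
  have hk'c : coord (N 3) (χ' + 2) = h - 2 - 2 * d := by rw [h3]; exact (ceilLetter_node h χ' d).2
  have hne : coord (N 0) (φ + 2) ≠ coord (N 3) (χ' + 2) := by rw [hk0, hk'c]; omega
  have nob : ∀ P ∈ C.upper, ∀ r : Fin 4, (P 0).1 < (N 0).1 → N 0 = ray (P 0) r ((N 0).1 - (P 0).1) → r = φ :=
    fun P hP r hlt e => below_floorLetter (hU.2 P hP 0) hc (by omega) (h0.symm.trans e)
  rcases hDN N hN 0 3 (by decide) (φ + 2) (χ' + 2) hk hk' hne with
    ⟨r, hr, P, hP, hZP⟩ | ⟨r, hr, P, hP, hZP⟩ | ⟨a, a', ha, -, P, hP, -, hb1, hb2, -, -⟩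
  · exact absurd ((nob P hP r hZP.2.1 hZP.2.2).trans (fin4_add_two_add_two φ).symm) hr
  · have hd0 : 0 < (N 3).1 - (P 3).1 := by have := hZP.2.1; omega
    have e : ceilLetter h χ' d = ray (P 3) r ((N 3).1 - (P 3).1) := by rw [← h3]; exact hZP.2.2
    have hr' : r ≠ χ' := fun e' => hr (by rw [e', fin4_add_two_add_two])
    have hP3 : OnCeiling h (P 3) := onCeiling_below_ceilLetter hd (hU.2 P hP 3) hd0 hr' e
    exact twinCeiling_floor_absent_swap hU hDN hDP hX hGu hh hm hc ((hZP.1 0 (by decide)).trans h0)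
      ((hZP.1 1 (by decide)).trans h1) ((hZP.1 2 (by decide)).trans h2) hP3 hP
  · have hφ := nob P hP a hb1 hb2
    rcases ha with e | ⟨-, hne2⟩
    · exact absurd (e.symm.trans hφ) (fin4_ne_add_two φ).symm
    · exact (hne2 (hφ.trans (fin4_add_two_add_two φ).symm)).elim

/-- **TN6.** `N{c·ℓ_φ, 2I + m·ℓ_u, cu_χ, (m+2)·ℓ_ψ} ∉ C.lower` (`h = 2m+4`, `m ≥ 1`, `c ≥ 1`) [◇_h, RULE D, X⁺]: the tower server (floor node of the full letter … (memo §1) -/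
theorem fullFloor_N_absent {h m c : ℤ} {C : MConfig} (hU : C.InDiamond h) (hDN : ∀ Z ∈ C.lower, RuleDMu4N C Z)
    (hDP : ∀ P ∈ C.upper, RuleDMu4P C P) (hX : XPlusClosed C) (hh : h = 2 * m + 4) (hm : 1 ≤ m) (hc : 1 ≤ c)
    {N : MCell} {φ u χ ψ : Fin 4} (h0 : N 0 = floorLetter φ c) (h1 : N 1 = nodeTwoLetter u m) (h2 : N 2 = ceilingUnit h χ)
    (h3 : N 3 = floorLetter ψ (m + 2)) : N ∉ C.lower := fun hN => by
  obtain ⟨P, hP, hPN, d, -, hcd, hP0⟩ := towerServer hU (hDN N hN) (t := 0) (s := 3) (by decide) hc (by omega : (0 : ℤ) ≤ m + 2) h0 h3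
  exact twinTower_full_absent hU hDN hDP hX hh hm hcd hP0 ((hPN 1 (by decide)).trans h1) ((hPN 2 (by decide)).trans h2)
    ((hPN 3 (by decide)).trans h3) hP

/-- **TP8.** `P{c·ℓ_φ, 2I + m·ℓ_u, cu_χ, (m+1)·ℓ_ψ} ∉ C.upper` (`h = 2m+4`, `m ≥ 1`, `c ≥ 1`) [◇_h, RULE D, X⁺]: RULE D at `P` (top `h` of `cu_χ` against the top … (memo §1) -/
theorem subFull_P_absent {h m c : ℤ} {C : MConfig} (hU : C.InDiamond h) (hDN : ∀ Z ∈ C.lower, RuleDMu4N C Z)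
    (hDP : ∀ P ∈ C.upper, RuleDMu4P C P) (hX : XPlusClosed C) (hh : h = 2 * m + 4) (hm : 1 ≤ m) (hc : 1 ≤ c)
    {P : MCell} {φ u χ ψ : Fin 4} (h0 : P 0 = floorLetter φ c) (h1 : P 1 = nodeTwoLetter u m) (h2 : P 2 = ceilingUnit h χ)
    (h3 : P 3 = floorLetter ψ (m + 1)) : P ∉ C.upper := fun hP => by
  have hna : ¬ isApex (P 3) := by rw [h3]; exact floorLetter_not_isApex ψ (by omega)
  have hk : Adapted (P 3) ψ := by rw [h3]; exact (floorLetter_top ψ (m + 1)).1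
  have hkh : coord (P 3) ψ ≠ h := by rw [h3, (floorLetter_top ψ (m + 1)).2]; omega
  obtain ⟨N, hN, hNP⟩ := upLine_of_ruleDMu4P hU hP (hDP P hP) (g := 2) (j := 3) (by decide)
    (by rw [h2]; exact onCeiling_ceilingUnit h χ) hna hk hkh
  have he0 : 0 < (N 3).1 - (P 3).1 := by have := hNP.2.1; omega
  have e : N 3 = ray (floorLetter ψ (m + 1)) ψ ((N 3).1 - (P 3).1) := by rw [← h3]; exact hNP.2.2
  have he1 := above_subFullLetter hh (by omega) he0 (hU.1 N hN 3) e
  have hN3 : N 3 = floorLetter ψ (m + 1 + 1) := by rw [e, he1]; exact (ray_add _ ψ (m + 1) 1).symm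
  rw [show m + 1 + 1 = m + 2 by ring] at hN3
  exact fullFloor_N_absent hU hDN hDP hX hh hm hc ((hNP.1 0 (by decide)).symm.trans h0)
    ((hNP.1 1 (by decide)).symm.trans h1) ((hNP.1 2 (by decide)).symm.trans h2) hN3 hN

/-- **TP9.** `P{c·ℓ_φ, 2I + m·ℓ_u, cu_χ, s_k} ∉ C.upper` for the sub-ceiling letter `s_k = 2kI + (m+1−k)ℓ_v`, `1 ≤ k ≤ m` (`h = 2m+4`, `c ≥ 0`) [◇_h, RULE D, X⁺, … (memo §1) -/
theorem subCeil_P_absent {h m c k : ℤ} {C : MConfig} (hU : C.InDiamond h) (hDN : ∀ Z ∈ C.lower, RuleDMu4N C Z)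
    (hDP : ∀ P ∈ C.upper, RuleDMu4P C P) (hX : XPlusClosed C) (hGu : PermClosed C.upper) (hh : h = 2 * m + 4) (hm : 1 ≤ m) (hc : 0 ≤ c)
    (hk1 : 1 ≤ k) (hkm : k ≤ m) {P : MCell} {φ u χ v : Fin 4} (h0 : P 0 = floorLetter φ c) (h1 : P 1 = nodeTwoLetter u m)
    (h2 : P 2 = ceilingUnit h χ) (h3 : P 3 = subCeilLetter m v k) : P ∉ C.upper := fun hP => by
  have hna : ¬ isApex (P 3) := by rw [h3]; exact subCeilLetter_not_isApex v (by omega)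
  have hk : Adapted (P 3) v := by rw [h3]; exact (subCeilLetter_top m v k).1
  have hkh : coord (P 3) v ≠ h := by rw [h3, (subCeilLetter_top m v k).2]; omega
  obtain ⟨N, hN, hNP⟩ := upLine_of_ruleDMu4P hU hP (hDP P hP) (g := 2) (j := 3) (by decide)
    (by rw [h2]; exact onCeiling_ceilingUnit h χ) hna hk hkh
  have he0 : 0 < (N 3).1 - (P 3).1 := by have := hNP.2.1; omega
  have e : N 3 = ray (subCeilLetter m v k) v ((N 3).1 - (P 3).1) := by rw [← h3]; exact hNP.2.2
  have he1 := above_subCeilLetter hh (by omega) he0 (hU.1 N hN 3) e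
  have hN3 : N 3 = ceilLetter h v (m + 1 - k) := by rw [e, he1]; exact subCeilLetter_up hh v k
  exact ceilLetter_N_absent hU hDN hDP hX hGu hh hm hc (d := m + 1 - k) (by omega) (by omega) ((hNP.1 0 (by decide)).symm.trans h0)
    ((hNP.1 1 (by decide)).symm.trans h1) ((hNP.1 2 (by decide)).symm.trans h2) hN3 hN

theorem subCeilLetter_zero (m : ℤ) (v : Fin 4) : subCeilLetter m v 0 = floorLetter v (m + 1) := by
  show ray ((2 * 0, 0, 0) : BPoint) v (m + 1 - 0) = ray ((0, 0, 0) : BPoint) v (m + 1)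
  rw [mul_zero, sub_zero]

theorem ceilLetter_zero (h : ℤ) (χ : Fin 4) : ceilLetter h χ 0 = ceilingUnit h χ := by
  show ray ((h - 2 - 2 * 0, 0, 0) : BPoint) χ (1 + 0) = ray ((h - 2, 0, 0) : BPoint) χ 1
  rw [mul_zero, sub_zero, add_zero]

/-- **TN10.** `N{c·ℓ_φ, 2I + m·ℓ_u, cu_χ, s_k} ∉ C.lower`, `1 ≤ k ≤ m` (`h = 2m+4`, `c ≥ 1`) [◇_h, RULE D, X⁺, `PermClosed C.upper`]: RULE D pairs the floor node … (memo §1) -/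
theorem subCeil_N_absent {h m c k : ℤ} {C : MConfig} (hU : C.InDiamond h) (hDN : ∀ Z ∈ C.lower, RuleDMu4N C Z)
    (hDP : ∀ P ∈ C.upper, RuleDMu4P C P) (hX : XPlusClosed C) (hGu : PermClosed C.upper) (hh : h = 2 * m + 4) (hm : 1 ≤ m) (hc : 1 ≤ c)
    (hk1 : 1 ≤ k) (hkm : k ≤ m) {N : MCell} {φ u χ v : Fin 4} (h0 : N 0 = floorLetter φ c) (h1 : N 1 = nodeTwoLetter u m)
    (h2 : N 2 = ceilingUnit h χ) (h3 : N 3 = subCeilLetter m v k) : N ∉ C.lower := fun hN => by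
  have hk : Adapted (N 0) (φ + 2) := by rw [h0]; exact (floorLetter_node φ c).1
  have hk0 : coord (N 0) (φ + 2) = 0 := by rw [h0]; exact (floorLetter_node φ c).2
  have hk' : Adapted (N 3) (v + 2) := by rw [h3]; exact (subCeilLetter_node m v k).1
  have hk'c : coord (N 3) (v + 2) = 2 * k := by rw [h3]; exact (subCeilLetter_node m v k).2
  have hne : coord (N 0) (φ + 2) ≠ coord (N 3) (v + 2) := by rw [hk0, hk'c]; omega
  have nob : ∀ P ∈ C.upper, ∀ r : Fin 4, (P 0).1 < (N 0).1 → N 0 = ray (P 0) r ((N 0).1 - (P 0).1) → r = φ :=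
    fun P hP r hlt e => below_floorLetter (hU.2 P hP 0) (by omega) (by omega) (h0.symm.trans e)
  rcases hDN N hN 0 3 (by decide) (φ + 2) (v + 2) hk hk' hne with
    ⟨r, hr, P, hP, hZP⟩ | ⟨r, hr, P, hP, hZP⟩ | ⟨a, a', ha, -, P, hP, -, hb1, hb2, -, -⟩
  · exact absurd ((nob P hP r hZP.2.1 hZP.2.2).trans (fin4_add_two_add_two φ).symm) hr
  · have hd0 : 0 < (N 3).1 - (P 3).1 := by have := hZP.2.1; omega
    have e : subCeilLetter m v k = ray (P 3) r ((N 3).1 - (P 3).1) := by rw [← h3]; exact hZP.2.2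
    have hr' : r ≠ v := fun e' => hr (by rw [e', fin4_add_two_add_two])
    have hP0 : P 0 = floorLetter φ c := (hZP.1 0 (by decide)).trans h0
    have hP1 : P 1 = nodeTwoLetter u m := (hZP.1 1 (by decide)).trans h1
    have hP2 : P 2 = ceilingUnit h χ := (hZP.1 2 (by decide)).trans h2
    obtain ⟨k', hk'0, hk'k, hz⟩ := below_subCeilLetter_offRay hkm (hU.2 P hP 3) hd0 hr' e
    rcases (show k' = 0 ∨ 1 ≤ k' by omega) with hz0 | hz1
    · subst hz0
      rw [subCeilLetter_zero] at hz
      exact subFull_P_absent hU hDN hDP hX hh hm hc hP0 hP1 hP2 hz hP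
    · exact subCeil_P_absent hU hDN hDP hX hGu hh hm (by omega) hz1 (by omega) hP0 hP1 hP2 hz hP
  · have hφ := nob P hP a hb1 hb2
    rcases ha with e | ⟨-, hne2⟩
    · exact absurd (e.symm.trans hφ) (fin4_ne_add_two φ).symm
    · exact (hne2 (hφ.trans (fin4_add_two_add_two φ).symm)).elim

/-- the letter TWO nodes below the ceiling on its ray: `t_k = 2k·I + (m − k)·ℓ_v` of ◇_{2m+4} (top coordinate `h − 4`). -/
abbrev subSubLetter (m : ℤ) (v : Fin 4) (k : ℤ) : BPoint := ray ((2 * k, 0, 0) : BPoint) v (m - k)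

theorem subSubLetter_top (m : ℤ) (v : Fin 4) (k : ℤ) :
    Adapted (subSubLetter m v k) v ∧ coord (subSubLetter m v k) v = 2 * k + 2 * (m - k) := by
  refine ⟨(adapted_ray_apex _ v _).1, ?_⟩
  rw [coord_ray_self, coord_of_isApex ⟨rfl, rfl⟩]

theorem subSubLetter_not_isApex {m k : ℤ} (v : Fin 4) (hk : m - k ≠ 0) : ¬ isApex (subSubLetter m v k) := by
  fin_cases v <;> simp [ray, isApex, hk] <;> omega

/-- above `t_k` along its ray there are at most two diamond steps (`h = 2m+4`). -/
theorem above_subSubLetter {h m k e : ℤ} {z : BPoint} {v : Fin 4} (hh : h = 2 * m + 4) (hk : k ≤ m) (he : 0 < e)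
    (hz : InDiamond h z) (hze : z = ray (subSubLetter m v k) v e) : e = 1 ∨ e = 2 := by
  have htop := hz.2.2.2
  rw [hze, show ray (subSubLetter m v k) v e = ray ((2 * k, 0, 0) : BPoint) v (m - k + e) from (ray_add _ v _ e).symm,
    top_ray_apex (2 * k) v (by omega)] at htop
  omega

theorem subSubLetter_up1 (m : ℤ) (v : Fin 4) (k : ℤ) : ray (subSubLetter m v k) v 1 = subCeilLetter m v k := by
  show ray (subSubLetter m v k) v 1 = ray ((2 * k, 0, 0) : BPoint) v (m + 1 - k)
  rw [show m + 1 - k = m - k + 1 by ring]; exact (ray_add _ v _ 1).symm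

theorem subSubLetter_up2 {h m : ℤ} (hh : h = 2 * m + 4) (v : Fin 4) (k : ℤ) : ray (subSubLetter m v k) v 2 = ceilLetter h v (m + 1 - k) := by
  show ray (subSubLetter m v k) v 2 = ray ((h - 2 - 2 * (m + 1 - k), 0, 0) : BPoint) v (1 + (m + 1 - k))
  rw [show (h - 2 - 2 * (m + 1 - k) : ℤ) = 2 * k by rw [hh]; ring, show (1 + (m + 1 - k) : ℤ) = m - k + 2 by ring]
  exact (ray_add _ v _ 2).symm

/-- **TP11.** `P{c·ℓ_φ, 2I + m·ℓ_u, cu_χ, t_k} ∉ C.upper` for `t_k = 2kI + (m−k)ℓ_v` two nodes below the ceiling, `1 ≤ k ≤ m − 1` (`h = 2m+4`, `c ≥ 1`) [◇_h, RULE … (memo §1) -/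
theorem subSub_P_absent {h m c k : ℤ} {C : MConfig} (hU : C.InDiamond h) (hDN : ∀ Z ∈ C.lower, RuleDMu4N C Z)
    (hDP : ∀ P ∈ C.upper, RuleDMu4P C P) (hX : XPlusClosed C) (hGu : PermClosed C.upper) (hh : h = 2 * m + 4) (hm : 1 ≤ m) (hc : 1 ≤ c)
    (hk1 : 1 ≤ k) (hkm : k ≤ m - 1) {P : MCell} {φ u χ v : Fin 4} (h0 : P 0 = floorLetter φ c) (h1 : P 1 = nodeTwoLetter u m)
    (h2 : P 2 = ceilingUnit h χ) (h3 : P 3 = subSubLetter m v k) : P ∉ C.upper := fun hP => by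
  have hna : ¬ isApex (P 3) := by rw [h3]; exact subSubLetter_not_isApex v (by omega)
  have hk : Adapted (P 3) v := by rw [h3]; exact (subSubLetter_top m v k).1
  have hkh : coord (P 3) v ≠ h := by rw [h3, (subSubLetter_top m v k).2]; omega
  obtain ⟨N, hN, hNP⟩ := upLine_of_ruleDMu4P hU hP (hDP P hP) (g := 2) (j := 3) (by decide)
    (by rw [h2]; exact onCeiling_ceilingUnit h χ) hna hk hkh
  have he0 : 0 < (N 3).1 - (P 3).1 := by have := hNP.2.1; omega
  have e : N 3 = ray (subSubLetter m v k) v ((N 3).1 - (P 3).1) := by rw [← h3]; exact hNP.2.2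
  have hN0 : N 0 = floorLetter φ c := (hNP.1 0 (by decide)).symm.trans h0
  have hN1 : N 1 = nodeTwoLetter u m := (hNP.1 1 (by decide)).symm.trans h1
  have hN2 : N 2 = ceilingUnit h χ := (hNP.1 2 (by decide)).symm.trans h2
  rcases above_subSubLetter hh (by omega) he0 (hU.1 N hN 3) e with he1 | he2
  · have hN3 : N 3 = subCeilLetter m v k := by rw [e, he1]; exact subSubLetter_up1 m v k
    exact subCeil_N_absent hU hDN hDP hX hGu hh hm hc hk1 (by omega) hN0 hN1 hN2 hN3 hN
  · have hN3 : N 3 = ceilLetter h v (m + 1 - k) := by rw [e, he2]; exact subSubLetter_up2 hh v k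
    exact ceilLetter_N_absent hU hDN hDP hX hGu hh hm (by omega) (d := m + 1 - k) (by omega) (by omega) hN0 hN1 hN2 hN3 hN

theorem ceilLetter_not_isApex {h d : ℤ} (v : Fin 4) (hd : 1 + d ≠ 0) : ¬ isApex (ceilLetter h v d) := by
  fin_cases v <;> simp [ray, isApex, hd] <;> omega

theorem ceilLetter_neg_one (h : ℤ) (v : Fin 4) : ceilLetter h v (-1) = (h, 0, 0) := by
  fin_cases v <;> simp [ray]

/-- `y_{m+1} = (m+2)·ℓ` (`h = 2m+4`). -/
theorem ceilLetter_full {h m : ℤ} (hh : h = 2 * m + 4) (v : Fin 4) : ceilLetter h v (m + 1) = floorLetter v (m + 2) := by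
  show ray ((h - 2 - 2 * (m + 1), 0, 0) : BPoint) v (1 + (m + 1)) = ray ((0, 0, 0) : BPoint) v (m + 2)
  rw [show (h - 2 - 2 * (m + 1) : ℤ) = 0 by omega, show (1 + (m + 1) : ℤ) = m + 2 by ring]

/-- ABOVE a ceiling-line letter `y_d` (`d ≥ 0`) in ◇_h: only the off-ray step up the node direction, `y_d + e·ℓ_{v+2} = y_{d−e}`, `e ≤ d + 1`. -/
theorem above_ceilLetter_offRay {h d e : ℤ} {z : BPoint} {v r : Fin 4} (hd : 0 ≤ d) (hz : InDiamond h z) (he : 0 < e)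
    (heq : z = ray (ceilLetter h v d) r e) : r = v + 2 ∧ e ≤ d + 1 ∧ z = ceilLetter h v (d - e) := by
  subst heq
  obtain ⟨hax, h1, -, h3⟩ := hz
  simp only [AxisPt, absCharge, chargeOf, ray, Prod.mk.injEq] at hax h1 h3 ⊢
  fin_cases v <;> fin_cases r <;> simp at hax h1 h3 ⊢ <;>
    (simp only [abs_eq_max_neg, max_def] at h1 h3; split_ifs at h1 h3 <;> omega)

/-- BELOW a ceiling-line letter `y_d` (`d ≥ 0`) OFF its ray in ◇_h: only `y_{d+e}`, and its node `h − 2 − 2(d+e)` is `≥ 0`. -/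
theorem below_ceilLetter_offRay {h d e : ℤ} {z : BPoint} {v r : Fin 4} (hd : 0 ≤ d) (hz : InDiamond h z) (he : 0 < e)
    (hr : r ≠ v) (heq : ceilLetter h v d = ray z r e) : z = ceilLetter h v (d + e) ∧ 2 * (d + e) ≤ h - 2 := by
  obtain ⟨α, a, b⟩ := z
  obtain ⟨hax, h1, -, -⟩ := hz
  simp only [AxisPt, absCharge, chargeOf, ray, Prod.mk.injEq] at hax h1 heq ⊢
  fin_cases v <;> fin_cases r <;> simp at hax h1 heq hr ⊢ <;>
    (simp only [abs_eq_max_neg, max_def] at h1; split_ifs at h1 <;> omega)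

/-- TN3 in the slot arrangement of this section (floor letter on slot 0, `hI` on slot 2, the free letter on slot 3): no symmetry needed, the child
is the twin fork of §6 itself. -/
theorem twinFloor_N_absent_slot3 {h m c : ℤ} {C : MConfig} (hU : C.InDiamond h) (hDN : ∀ Z ∈ C.lower, RuleDMu4N C Z)
    (hDP : ∀ P ∈ C.upper, RuleDMu4P C P) (hX : XPlusClosed C) (hh : h = 2 * m + 4) (hm : 1 ≤ m) (hc : 0 ≤ c)
    {N : MCell} {φ u k : Fin 4} (h0 : N 0 = floorLetter φ c) (h1 : N 1 = nodeTwoLetter u m) (h2 : N 2 = (h, 0, 0))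
    (hk : Adapted (N 3) k) (hk0 : coord (N 3) k ≠ 0) : N ∉ C.lower := fun hN => by
  have hk' : Adapted (N 0) (φ + 2) := by rw [h0]; exact (floorLetter_node φ c).1
  have hk'0 : coord (N 0) (φ + 2) = 0 := by rw [h0]; exact (floorLetter_node φ c).2
  have hne : coord (N 3) k ≠ coord (N 0) (φ + 2) := by rw [hk'0]; exact hk0
  have nob : ∀ P ∈ C.upper, ∀ r : Fin 4, (P 0).1 < (N 0).1 → N 0 = ray (P 0) r ((N 0).1 - (P 0).1) → r = φ :=
    fun P hP r hlt e => below_floorLetter (hU.2 P hP 0) hc (by omega) (h0.symm.trans e)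
  rcases hDN N hN 3 0 (by decide) k (φ + 2) hk hk' hne with
    ⟨r, -, P, hP, hZP⟩ | ⟨r, hr, P, hP, hZP⟩ | ⟨a, a', -, ha', P, hP, -, -, -, hc1, hc2⟩
  · exact twinForkFamily_absent hU hDN hDP hX hh hm hc ((hZP.1 0 (by decide)).trans h0) ((hZP.1 1 (by decide)).trans h1)
      ((hZP.1 2 (by decide)).trans h2) hP
  · exact absurd ((nob P hP r hZP.2.1 hZP.2.2).trans (fin4_add_two_add_two φ).symm) hr
  · have hφ := nob P hP a' hc1 hc2
    rcases ha' with e | ⟨-, hne2⟩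
    · exact absurd (e.symm.trans hφ) (fin4_ne_add_two φ).symm
    · exact (hne2 (hφ.trans (fin4_add_two_add_two φ).symm)).elim

/-- **TP13.** `P{c·ℓ_φ, 2I + m·ℓ_u, y_1, y'_{d'}} ∉ C.upper`, `y_1 = (h−4)I + 2ℓ_v`, `y'_{d'} = (h−2−2d')I + (1+d')ℓ_{v'}`, `1 ≤ d' ≤ m`, `c ≥ 0` (`h = 2m+4`) … (memo §1) -/
theorem ceilPairOne_P_absent {h m c d' : ℤ} {C : MConfig} (hU : C.InDiamond h) (hDN : ∀ Z ∈ C.lower, RuleDMu4N C Z)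
    (hDP : ∀ P ∈ C.upper, RuleDMu4P C P) (hX : XPlusClosed C) (hGu : PermClosed C.upper) (hh : h = 2 * m + 4) (hm : 1 ≤ m) (hc : 0 ≤ c)
    (hd1 : 1 ≤ d') (hdm : d' ≤ m) {P : MCell} {φ u v v' : Fin 4} (h0 : P 0 = floorLetter φ c) (h1 : P 1 = nodeTwoLetter u m)
    (h2 : P 2 = ceilLetter h v 1) (h3 : P 3 = ceilLetter h v' d') : P ∉ C.upper := fun hP => by
  have hna : ¬ isApex (P 2) := by rw [h2]; exact ceilLetter_not_isApex v (by norm_num)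
  have hk : Adapted (P 2) (v + 2) := by rw [h2]; exact (ceilLetter_node h v 1).1
  have hkh : coord (P 2) (v + 2) ≠ h := by rw [h2, (ceilLetter_node h v 1).2]; omega
  obtain ⟨N, hN, hNP⟩ := upLine_of_ruleDMu4P hU hP (hDP P hP) (g := 3) (j := 2) (by decide)
    (by rw [h3]; exact onCeiling_ceilLetter (by omega) v') hna hk hkh
  have he0 : 0 < (N 2).1 - (P 2).1 := by have := hNP.2.1; omega
  have e : N 2 = ray (ceilLetter h v 1) (v + 2) ((N 2).1 - (P 2).1) := by rw [← h2]; exact hNP.2.2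
  obtain ⟨-, hle, hN2⟩ := above_ceilLetter_offRay (by norm_num) (hU.1 N hN 2) he0 e
  have hN0 : N 0 = floorLetter φ c := (hNP.1 0 (by decide)).symm.trans h0
  have hN1 : N 1 = nodeTwoLetter u m := (hNP.1 1 (by decide)).symm.trans h1
  have hN3 : N 3 = ceilLetter h v' d' := (hNP.1 3 (by decide)).symm.trans h3
  rcases (show (N 2).1 - (P 2).1 = 1 ∨ (N 2).1 - (P 2).1 = 2 by omega) with he1 | he2
  · rw [he1, show (1 - 1 : ℤ) = 0 by norm_num, ceilLetter_zero] at hN2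
    exact ceilLetter_N_absent hU hDN hDP hX hGu hh hm hc (d := d') (by omega) hdm hN0 hN1 hN2 hN3 hN
  · rw [he2, show (1 - 2 : ℤ) = -1 by norm_num, ceilLetter_neg_one] at hN2
    exact twinFloor_N_absent_slot3 hU hDN hDP hX hh hm hc hN0 hN1 hN2 (k := v' + 2)
      (by rw [hN3]; exact (ceilLetter_node h v' d').1) (by rw [hN3, (ceilLetter_node h v' d').2]; omega) hN

/-- **TP13F.**  `P{c·ℓ_φ, 2I + m·ℓ_u, y_1, (m+2)·ℓ_ψ} ∉ C.upper` (`c ≥ 1`, `h = 2m+4`) [◇_h, RULE D, X⁺; no symmetry]: above `y_1` sit `cu_v` (TN6) and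
`hI` (TN0). -/
theorem ceilPairOneFull_P_absent {h m c : ℤ} {C : MConfig} (hU : C.InDiamond h) (hDN : ∀ Z ∈ C.lower, RuleDMu4N C Z)
    (hDP : ∀ P ∈ C.upper, RuleDMu4P C P) (hX : XPlusClosed C) (hh : h = 2 * m + 4) (hm : 1 ≤ m) (hc : 1 ≤ c)
    {P : MCell} {φ u v ψ : Fin 4} (h0 : P 0 = floorLetter φ c) (h1 : P 1 = nodeTwoLetter u m) (h2 : P 2 = ceilLetter h v 1)
    (h3 : P 3 = floorLetter ψ (m + 2)) : P ∉ C.upper := fun hP => by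
  have hna : ¬ isApex (P 2) := by rw [h2]; exact ceilLetter_not_isApex v (by norm_num)
  have hk : Adapted (P 2) (v + 2) := by rw [h2]; exact (ceilLetter_node h v 1).1
  have hkh : coord (P 2) (v + 2) ≠ h := by rw [h2, (ceilLetter_node h v 1).2]; omega
  obtain ⟨N, hN, hNP⟩ := upLine_of_ruleDMu4P hU hP (hDP P hP) (g := 3) (j := 2) (by decide)
    (by rw [h3]; exact onCeiling_fullLetter hh (by omega) ψ) hna hk hkh
  have he0 : 0 < (N 2).1 - (P 2).1 := by have := hNP.2.1; omega
  have e : N 2 = ray (ceilLetter h v 1) (v + 2) ((N 2).1 - (P 2).1) := by rw [← h2]; exact hNP.2.2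
  obtain ⟨-, hle, hN2⟩ := above_ceilLetter_offRay (by norm_num) (hU.1 N hN 2) he0 e
  have hN0 : N 0 = floorLetter φ c := (hNP.1 0 (by decide)).symm.trans h0
  have hN1 : N 1 = nodeTwoLetter u m := (hNP.1 1 (by decide)).symm.trans h1
  have hN3 : N 3 = floorLetter ψ (m + 2) := (hNP.1 3 (by decide)).symm.trans h3
  rcases (show (N 2).1 - (P 2).1 = 1 ∨ (N 2).1 - (P 2).1 = 2 by omega) with he1 | he2
  · rw [he1, show (1 - 1 : ℤ) = 0 by norm_num, ceilLetter_zero] at hN2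
    exact fullFloor_N_absent hU hDN hDP hX hh hm hc hN0 hN1 hN2 hN3 hN
  · rw [he2, show (1 - 2 : ℤ) = -1 by norm_num, ceilLetter_neg_one] at hN2
    exact twinTower_N_absent hU hDN hDP hX hh hm (by omega) (by omega : (0 : ℤ) ≤ m + 2) (Or.inl hc) hN0 hN1 hN2 hN3 hN

/-- **TN12.** `N{c·ℓ_φ, 2I + m·ℓ_u, y_1, y'_{d'}} ∉ C.lower`, `1 ≤ d' ≤ m`, `c ≥ 1` (`h = 2m+4`) [◇_h, RULE D, X⁺, `PermClosed C.upper`]: RULE D on the floor node … (memo §1) -/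
theorem ceilPairOne_N_absent {h m c d' : ℤ} {C : MConfig} (hU : C.InDiamond h) (hDN : ∀ Z ∈ C.lower, RuleDMu4N C Z)
    (hDP : ∀ P ∈ C.upper, RuleDMu4P C P) (hX : XPlusClosed C) (hGu : PermClosed C.upper) (hh : h = 2 * m + 4) (hm : 1 ≤ m) (hc : 1 ≤ c)
    (hd1 : 1 ≤ d') (hdm : d' ≤ m) {N : MCell} {φ u v v' : Fin 4} (h0 : N 0 = floorLetter φ c) (h1 : N 1 = nodeTwoLetter u m)
    (h2 : N 2 = ceilLetter h v 1) (h3 : N 3 = ceilLetter h v' d') : N ∉ C.lower := fun hN => by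
  have hk : Adapted (N 0) (φ + 2) := by rw [h0]; exact (floorLetter_node φ c).1
  have hk0 : coord (N 0) (φ + 2) = 0 := by rw [h0]; exact (floorLetter_node φ c).2
  have hk' : Adapted (N 3) (v' + 2) := by rw [h3]; exact (ceilLetter_node h v' d').1
  have hk'c : coord (N 3) (v' + 2) = h - 2 - 2 * d' := by rw [h3]; exact (ceilLetter_node h v' d').2
  have hne : coord (N 0) (φ + 2) ≠ coord (N 3) (v' + 2) := by rw [hk0, hk'c]; omega
  have nob : ∀ P ∈ C.upper, ∀ r : Fin 4, (P 0).1 < (N 0).1 → N 0 = ray (P 0) r ((N 0).1 - (P 0).1) → r = φ :=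
    fun P hP r hlt e => below_floorLetter (hU.2 P hP 0) (by omega) (by omega) (h0.symm.trans e)
  rcases hDN N hN 0 3 (by decide) (φ + 2) (v' + 2) hk hk' hne with
    ⟨r, hr, P, hP, hZP⟩ | ⟨r, hr, P, hP, hZP⟩ | ⟨a, a', ha, -, P, hP, -, hb1, hb2, -, -⟩
  · exact absurd ((nob P hP r hZP.2.1 hZP.2.2).trans (fin4_add_two_add_two φ).symm) hr
  · have hd0 : 0 < (N 3).1 - (P 3).1 := by have := hZP.2.1; omega
    have e : ceilLetter h v' d' = ray (P 3) r ((N 3).1 - (P 3).1) := by rw [← h3]; exact hZP.2.2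
    have hr' : r ≠ v' := fun e' => hr (by rw [e', fin4_add_two_add_two])
    obtain ⟨hP3, hle⟩ := below_ceilLetter_offRay (by omega) (hU.2 P hP 3) hd0 hr' e
    have hP0 : P 0 = floorLetter φ c := (hZP.1 0 (by decide)).trans h0
    have hP1 : P 1 = nodeTwoLetter u m := (hZP.1 1 (by decide)).trans h1
    have hP2 : P 2 = ceilLetter h v 1 := (hZP.1 2 (by decide)).trans h2
    by_cases htop : d' + ((N 3).1 - (P 3).1) ≤ m
    · exact ceilPairOne_P_absent hU hDN hDP hX hGu hh hm (by omega) (d' := d' + ((N 3).1 - (P 3).1)) (by omega) htop hP0 hP1 hP2 hP3 hP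
    · have hdf : d' + ((N 3).1 - (P 3).1) = m + 1 := by omega
      rw [hdf, ceilLetter_full hh] at hP3
      exact ceilPairOneFull_P_absent hU hDN hDP hX hh hm hc hP0 hP1 hP2 hP3 hP
  · have hφ := nob P hP a hb1 hb2
    rcases ha with e | ⟨-, hne2⟩
    · exact absurd (e.symm.trans hφ) (fin4_ne_add_two φ).symm
    · exact (hne2 (hφ.trans (fin4_add_two_add_two φ).symm)).elim

theorem subSubLetter_node (m : ℤ) (v : Fin 4) (k : ℤ) :
    Adapted (subSubLetter m v k) (v + 2) ∧ coord (subSubLetter m v k) (v + 2) = 2 * k :=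
  ⟨(adapted_ray_apex _ v _).2, coord_ray_apex_antip _ v _⟩

theorem subSubLetter_zero (m : ℤ) (v : Fin 4) : subSubLetter m v 0 = floorLetter v m := by
  show ray ((2 * 0, 0, 0) : BPoint) v (m - 0) = ray ((0, 0, 0) : BPoint) v m
  rw [mul_zero, sub_zero]

theorem floorLetter_ne_origin (φ : Fin 4) {c : ℤ} (hc : c ≠ 0) : floorLetter φ c ≠ (0, 0, 0) := fun e => by
  have e1 := congrArg Prod.fst e
  simp [ray] at e1
  exact hc e1

/-- below `t_k` (`k ≤ m − 1`, so charged) off its ray: exactly the `t_{k'}`, `0 ≤ k' < k` (the top `h − 4` is preserved). -/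
theorem below_subSubLetter_offRay {h m k e : ℤ} {z : BPoint} {v r : Fin 4} (hk : k ≤ m - 1) (hz : InDiamond h z) (he : 0 < e)
    (hr : r ≠ v) (heq : subSubLetter m v k = ray z r e) : ∃ k', 0 ≤ k' ∧ k' < k ∧ z = subSubLetter m v k' := by
  refine ⟨k - e, ?_, by omega, ?_⟩ <;> obtain ⟨α, a, b⟩ := z <;> obtain ⟨hax, h1, -, -⟩ := hz <;>
    simp only [AxisPt, absCharge, chargeOf, ray, Prod.mk.injEq] at hax h1 heq ⊢ <;>
    fin_cases v <;> fin_cases r <;> simp at hax h1 heq hr ⊢ <;>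
    (simp only [abs_eq_max_neg, max_def] at h1; split_ifs at h1 <;> omega)

/-- TP13F with the floor letter and the full letter exchanged (slots 0 ↔ 3; `PermClosed C.upper`). -/
theorem ceilPairOneFull_P_absent_swap {h m c : ℤ} {C : MConfig} (hU : C.InDiamond h) (hDN : ∀ Z ∈ C.lower, RuleDMu4N C Z)
    (hDP : ∀ P ∈ C.upper, RuleDMu4P C P) (hX : XPlusClosed C) (hGu : PermClosed C.upper) (hh : h = 2 * m + 4) (hm : 1 ≤ m) (hc : 1 ≤ c)
    {P : MCell} {φ u v ψ : Fin 4} (h0 : P 0 = floorLetter φ (m + 2)) (h1 : P 1 = nodeTwoLetter u m) (h2 : P 2 = ceilLetter h v 1)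
    (h3 : P 3 = floorLetter ψ c) : P ∉ C.upper := fun hP =>
  ceilPairOneFull_P_absent hU hDN hDP hX hh hm hc (P := P.perm (Equiv.swap 0 3)) (φ := ψ) (u := u) (v := v) (ψ := φ)
    (by show P (Equiv.swap (0 : Fin 4) 3 0) = _; simpa using h3)
    (by show P (Equiv.swap (0 : Fin 4) 3 1) = _; simpa [Equiv.swap_apply_of_ne_of_ne] using h1)
    (by show P (Equiv.swap (0 : Fin 4) 3 2) = _; simpa [Equiv.swap_apply_of_ne_of_ne] using h2)
    (by show P (Equiv.swap (0 : Fin 4) 3 3) = _; simpa using h0)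
    (hGu _ P hP)

/-- TP8 with the two floor letters exchanged (slots 0 ↔ 3; `PermClosed C.upper`). -/
theorem subFull_P_absent_swap {h m c : ℤ} {C : MConfig} (hU : C.InDiamond h) (hDN : ∀ Z ∈ C.lower, RuleDMu4N C Z)
    (hDP : ∀ P ∈ C.upper, RuleDMu4P C P) (hX : XPlusClosed C) (hGu : PermClosed C.upper) (hh : h = 2 * m + 4) (hm : 1 ≤ m) (hc : 1 ≤ c)
    {P : MCell} {φ u χ ψ : Fin 4} (h0 : P 0 = floorLetter φ (m + 1)) (h1 : P 1 = nodeTwoLetter u m) (h2 : P 2 = ceilingUnit h χ)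
    (h3 : P 3 = floorLetter ψ c) : P ∉ C.upper := fun hP =>
  subFull_P_absent hU hDN hDP hX hh hm hc (P := P.perm (Equiv.swap 0 3)) (φ := ψ) (u := u) (χ := χ) (ψ := φ)
    (by show P (Equiv.swap (0 : Fin 4) 3 0) = _; simpa using h3)
    (by show P (Equiv.swap (0 : Fin 4) 3 1) = _; simpa [Equiv.swap_apply_of_ne_of_ne] using h1)
    (by show P (Equiv.swap (0 : Fin 4) 3 2) = _; simpa [Equiv.swap_apply_of_ne_of_ne] using h2)
    (by show P (Equiv.swap (0 : Fin 4) 3 3) = _; simpa using h0)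
    (hGu _ P hP)

/-- TP3 with the free letter `x` and the full letter exchanged (slots 0 ↔ 3; `PermClosed C.upper`). -/
theorem twinFloor_full_absent_swap {h m : ℤ} {C : MConfig} (hU : C.InDiamond h) (hDN : ∀ Z ∈ C.lower, RuleDMu4N C Z)
    (hDP : ∀ P ∈ C.upper, RuleDMu4P C P) (hX : XPlusClosed C) (hGu : PermClosed C.upper) (hh : h = 2 * m + 4) (hm : 1 ≤ m)
    {P : MCell} {φ u χ : Fin 4} (h0 : P 0 = floorLetter φ (m + 2)) (h1 : P 1 = nodeTwoLetter u m) (h2 : P 2 = ceilingUnit h χ)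
    (hx : P 3 ≠ (0, 0, 0)) : P ∉ C.upper := fun hP =>
  twinFloor_full_absent hU hDN hDP hX hGu hh hm (P := P.perm (Equiv.swap 0 3)) (u := u) (χ := χ) (ψ := φ)
    (by show P (Equiv.swap (0 : Fin 4) 3 0) ≠ _; simpa using hx)
    (by show P (Equiv.swap (0 : Fin 4) 3 1) = _; simpa [Equiv.swap_apply_of_ne_of_ne] using h1)
    (by show P (Equiv.swap (0 : Fin 4) 3 2) = _; simpa [Equiv.swap_apply_of_ne_of_ne] using h2)
    (by show P (Equiv.swap (0 : Fin 4) 3 3) = _; simpa using h0)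
    (hGu _ P hP)

/-- **TP15.** `P{c·ℓ_φ, 2I + m·ℓ_u, y_1, s_k} ∉ C.upper`, `1 ≤ k ≤ m`, `c ≥ 1` (`h = 2m+4`) [◇_h, RULE D, X⁺, `PermClosed C.upper`]: the up-line of `s_k` pinned by … (memo §1) -/
theorem ceilOneSub_P_absent {h m c k : ℤ} {C : MConfig} (hU : C.InDiamond h) (hDN : ∀ Z ∈ C.lower, RuleDMu4N C Z)
    (hDP : ∀ P ∈ C.upper, RuleDMu4P C P) (hX : XPlusClosed C) (hGu : PermClosed C.upper) (hh : h = 2 * m + 4) (hm : 1 ≤ m) (hc : 1 ≤ c)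
    (hk1 : 1 ≤ k) (hkm : k ≤ m) {P : MCell} {φ u v w : Fin 4} (h0 : P 0 = floorLetter φ c) (h1 : P 1 = nodeTwoLetter u m)
    (h2 : P 2 = ceilLetter h v 1) (h3 : P 3 = subCeilLetter m w k) : P ∉ C.upper := fun hP => by
  have hna : ¬ isApex (P 3) := by rw [h3]; exact subCeilLetter_not_isApex w (by omega)
  have hk : Adapted (P 3) w := by rw [h3]; exact (subCeilLetter_top m w k).1
  have hkh : coord (P 3) w ≠ h := by rw [h3, (subCeilLetter_top m w k).2]; omega
  obtain ⟨N, hN, hNP⟩ := upLine_of_ruleDMu4P hU hP (hDP P hP) (g := 2) (j := 3) (by decide)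
    (by rw [h2]; exact onCeiling_ceilLetter (by norm_num) v) hna hk hkh
  have he0 : 0 < (N 3).1 - (P 3).1 := by have := hNP.2.1; omega
  have e : N 3 = ray (subCeilLetter m w k) w ((N 3).1 - (P 3).1) := by rw [← h3]; exact hNP.2.2
  have he1 := above_subCeilLetter hh (by omega) he0 (hU.1 N hN 3) e
  have hN3 : N 3 = ceilLetter h w (m + 1 - k) := by rw [e, he1]; exact subCeilLetter_up hh w k
  exact ceilPairOne_N_absent hU hDN hDP hX hGu hh hm hc (d' := m + 1 - k) (by omega) (by omega) ((hNP.1 0 (by decide)).symm.trans h0)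
    ((hNP.1 1 (by decide)).symm.trans h1) ((hNP.1 2 (by decide)).symm.trans h2) hN3 hN

/-- **TN13.** `N{(m+2)·ℓ_φ, 2I + m·ℓ_u, y_1, s_k} ∉ C.lower`, `1 ≤ k ≤ m` (`h = 2m+4`) [◇_h, RULE D, X⁺, `PermClosed C.upper`]: the floor node `0` × the node `2k` … (memo §1) -/
theorem fullCeilOneSub_N_absent {h m k : ℤ} {C : MConfig} (hU : C.InDiamond h) (hDN : ∀ Z ∈ C.lower, RuleDMu4N C Z)
    (hDP : ∀ P ∈ C.upper, RuleDMu4P C P) (hX : XPlusClosed C) (hGu : PermClosed C.upper) (hh : h = 2 * m + 4) (hm : 1 ≤ m)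
    (hk1 : 1 ≤ k) (hkm : k ≤ m) {N : MCell} {φ u v w : Fin 4} (h0 : N 0 = floorLetter φ (m + 2)) (h1 : N 1 = nodeTwoLetter u m)
    (h2 : N 2 = ceilLetter h v 1) (h3 : N 3 = subCeilLetter m w k) : N ∉ C.lower := fun hN => by
  have hk : Adapted (N 0) (φ + 2) := by rw [h0]; exact (floorLetter_node φ (m + 2)).1
  have hk0 : coord (N 0) (φ + 2) = 0 := by rw [h0]; exact (floorLetter_node φ (m + 2)).2
  have hk' : Adapted (N 3) (w + 2) := by rw [h3]; exact (subCeilLetter_node m w k).1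
  have hk'c : coord (N 3) (w + 2) = 2 * k := by rw [h3]; exact (subCeilLetter_node m w k).2
  have hne : coord (N 0) (φ + 2) ≠ coord (N 3) (w + 2) := by rw [hk0, hk'c]; omega
  have nob : ∀ P ∈ C.upper, ∀ r : Fin 4, (P 0).1 < (N 0).1 → N 0 = ray (P 0) r ((N 0).1 - (P 0).1) → r = φ :=
    fun P hP r hlt e => below_floorLetter (hU.2 P hP 0) (by omega) (by omega) (h0.symm.trans e)
  rcases hDN N hN 0 3 (by decide) (φ + 2) (w + 2) hk hk' hne with
    ⟨r, hr, P, hP, hZP⟩ | ⟨r, hr, P, hP, hZP⟩ | ⟨a, a', ha, -, P, hP, -, hb1, hb2, -, -⟩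
  · exact absurd ((nob P hP r hZP.2.1 hZP.2.2).trans (fin4_add_two_add_two φ).symm) hr
  · have hd0 : 0 < (N 3).1 - (P 3).1 := by have := hZP.2.1; omega
    have e : subCeilLetter m w k = ray (P 3) r ((N 3).1 - (P 3).1) := by rw [← h3]; exact hZP.2.2
    have hr' : r ≠ w := fun e' => hr (by rw [e', fin4_add_two_add_two])
    have hP0 : P 0 = floorLetter φ (m + 2) := (hZP.1 0 (by decide)).trans h0
    have hP1 : P 1 = nodeTwoLetter u m := (hZP.1 1 (by decide)).trans h1
    have hP2 : P 2 = ceilLetter h v 1 := (hZP.1 2 (by decide)).trans h2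
    obtain ⟨k', hk'0, hk'k, hz⟩ := below_subCeilLetter_offRay hkm (hU.2 P hP 3) hd0 hr' e
    rcases (show k' = 0 ∨ 1 ≤ k' by omega) with hz0 | hz1
    · subst hz0
      rw [subCeilLetter_zero] at hz
      exact ceilPairOneFull_P_absent_swap hU hDN hDP hX hGu hh hm (c := m + 1) (by omega) hP0 hP1 hP2 hz hP
    · exact ceilOneSub_P_absent hU hDN hDP hX hGu hh hm (c := m + 2) (by omega) hz1 (by omega) hP0 hP1 hP2 hz hP
  · have hφ := nob P hP a hb1 hb2
    rcases ha with e | ⟨-, hne2⟩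
    · exact absurd (e.symm.trans hφ) (fin4_ne_add_two φ).symm
    · exact (hne2 (hφ.trans (fin4_add_two_add_two φ).symm)).elim

/-- **TP17a.** `P{(m+2)·ℓ_φ, 2I + m·ℓ_u, y_1, t_k} ∉ C.upper`, `1 ≤ k ≤ m − 1` (`h = 2m+4`) [◇_h, RULE D, X⁺, `PermClosed C.upper`]: the up-line of `t_k` pinned by … (memo §1) -/
theorem fullCeilOneSubSub_P_absent {h m k : ℤ} {C : MConfig} (hU : C.InDiamond h) (hDN : ∀ Z ∈ C.lower, RuleDMu4N C Z)
    (hDP : ∀ P ∈ C.upper, RuleDMu4P C P) (hX : XPlusClosed C) (hGu : PermClosed C.upper) (hh : h = 2 * m + 4) (hm : 1 ≤ m)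
    (hk1 : 1 ≤ k) (hkm : k ≤ m - 1) {P : MCell} {φ u v w : Fin 4} (h0 : P 0 = floorLetter φ (m + 2)) (h1 : P 1 = nodeTwoLetter u m)
    (h2 : P 2 = ceilLetter h v 1) (h3 : P 3 = subSubLetter m w k) : P ∉ C.upper := fun hP => by
  have hna : ¬ isApex (P 3) := by rw [h3]; exact subSubLetter_not_isApex w (by omega)
  have hk : Adapted (P 3) w := by rw [h3]; exact (subSubLetter_top m w k).1
  have hkh : coord (P 3) w ≠ h := by rw [h3, (subSubLetter_top m w k).2]; omega
  obtain ⟨N, hN, hNP⟩ := upLine_of_ruleDMu4P hU hP (hDP P hP) (g := 2) (j := 3) (by decide)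
    (by rw [h2]; exact onCeiling_ceilLetter (by norm_num) v) hna hk hkh
  have he0 : 0 < (N 3).1 - (P 3).1 := by have := hNP.2.1; omega
  have e : N 3 = ray (subSubLetter m w k) w ((N 3).1 - (P 3).1) := by rw [← h3]; exact hNP.2.2
  have hN0 : N 0 = floorLetter φ (m + 2) := (hNP.1 0 (by decide)).symm.trans h0
  have hN1 : N 1 = nodeTwoLetter u m := (hNP.1 1 (by decide)).symm.trans h1
  have hN2 : N 2 = ceilLetter h v 1 := (hNP.1 2 (by decide)).symm.trans h2
  rcases above_subSubLetter hh (by omega) he0 (hU.1 N hN 3) e with he1 | he2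
  · have hN3 : N 3 = subCeilLetter m w k := by rw [e, he1]; exact subSubLetter_up1 m w k
    exact fullCeilOneSub_N_absent hU hDN hDP hX hGu hh hm hk1 (by omega) hN0 hN1 hN2 hN3 hN
  · have hN3 : N 3 = ceilLetter h w (m + 1 - k) := by rw [e, he2]; exact subSubLetter_up2 hh w k
    exact ceilPairOne_N_absent hU hDN hDP hX hGu hh hm (c := m + 2) (by omega) (d' := m + 1 - k) (by omega) (by omega) hN0 hN1 hN2 hN3 hN

/-- **TN14.** `N{(m+2)·ℓ_φ, 2I + m·ℓ_u, y_1, t_k} ∉ C.lower`, `1 ≤ k ≤ m − 1` (`h = 2m+4`) [◇_h, RULE D, X⁺, `PermClosed C.upper`]: the floor node `0` × the node … (memo §1) -/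
theorem fullCeilOneSubSub_N_absent {h m k : ℤ} {C : MConfig} (hU : C.InDiamond h) (hDN : ∀ Z ∈ C.lower, RuleDMu4N C Z)
    (hDP : ∀ P ∈ C.upper, RuleDMu4P C P) (hX : XPlusClosed C) (hGu : PermClosed C.upper) (hh : h = 2 * m + 4) (hm : 1 ≤ m)
    (hk1 : 1 ≤ k) (hkm : k ≤ m - 1) {N : MCell} {φ u v w : Fin 4} (h0 : N 0 = floorLetter φ (m + 2)) (h1 : N 1 = nodeTwoLetter u m)
    (h2 : N 2 = ceilLetter h v 1) (h3 : N 3 = subSubLetter m w k) : N ∉ C.lower := fun hN => by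
  have hk : Adapted (N 0) (φ + 2) := by rw [h0]; exact (floorLetter_node φ (m + 2)).1
  have hk0 : coord (N 0) (φ + 2) = 0 := by rw [h0]; exact (floorLetter_node φ (m + 2)).2
  have hk' : Adapted (N 3) (w + 2) := by rw [h3]; exact (subSubLetter_node m w k).1
  have hk'c : coord (N 3) (w + 2) = 2 * k := by rw [h3]; exact (subSubLetter_node m w k).2
  have hne : coord (N 0) (φ + 2) ≠ coord (N 3) (w + 2) := by rw [hk0, hk'c]; omega
  have nob : ∀ P ∈ C.upper, ∀ r : Fin 4, (P 0).1 < (N 0).1 → N 0 = ray (P 0) r ((N 0).1 - (P 0).1) → r = φ :=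
    fun P hP r hlt e => below_floorLetter (hU.2 P hP 0) (by omega) (by omega) (h0.symm.trans e)
  rcases hDN N hN 0 3 (by decide) (φ + 2) (w + 2) hk hk' hne with
    ⟨r, hr, P, hP, hZP⟩ | ⟨r, hr, P, hP, hZP⟩ | ⟨a, a', ha, -, P, hP, -, hb1, hb2, -, -⟩
  · exact absurd ((nob P hP r hZP.2.1 hZP.2.2).trans (fin4_add_two_add_two φ).symm) hr
  · have hd0 : 0 < (N 3).1 - (P 3).1 := by have := hZP.2.1; omega
    have e : subSubLetter m w k = ray (P 3) r ((N 3).1 - (P 3).1) := by rw [← h3]; exact hZP.2.2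
    have hr' : r ≠ w := fun e' => hr (by rw [e', fin4_add_two_add_two])
    have hP0 : P 0 = floorLetter φ (m + 2) := (hZP.1 0 (by decide)).trans h0
    have hP1 : P 1 = nodeTwoLetter u m := (hZP.1 1 (by decide)).trans h1
    have hP2 : P 2 = ceilLetter h v 1 := (hZP.1 2 (by decide)).trans h2
    obtain ⟨k', hk'0, hk'k, hz⟩ := below_subSubLetter_offRay hkm (hU.2 P hP 3) hd0 hr' e
    rcases (show k' = 0 ∨ 1 ≤ k' by omega) with hz0 | hz1
    · subst hz0
      rw [subSubLetter_zero] at hz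
      exact ceilPairOneFull_P_absent_swap hU hDN hDP hX hGu hh hm (c := m) (by omega) hP0 hP1 hP2 hz hP
    · exact fullCeilOneSubSub_P_absent hU hDN hDP hX hGu hh hm hz1 (by omega) hP0 hP1 hP2 hz hP
  · have hφ := nob P hP a hb1 hb2
    rcases ha with e | ⟨-, hne2⟩
    · exact absurd (e.symm.trans hφ) (fin4_ne_add_two φ).symm
    · exact (hne2 (hφ.trans (fin4_add_two_add_two φ).symm)).elim

/-- **TN15.** `N{c·ℓ_φ, 2I + m·ℓ_u, cu_χ, t_k} ∉ C.lower`, `c ∈ {m+1, m+2}`, `1 ≤ k ≤ m − 1` (`h = 2m+4`) [◇_h, RULE D, X⁺, `PermClosed C.upper`]: the floor node … (memo §1) -/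
theorem twinFrameSubSub_N_absent {h m c k : ℤ} {C : MConfig} (hU : C.InDiamond h) (hDN : ∀ Z ∈ C.lower, RuleDMu4N C Z)
    (hDP : ∀ P ∈ C.upper, RuleDMu4P C P) (hX : XPlusClosed C) (hGu : PermClosed C.upper) (hh : h = 2 * m + 4) (hm : 1 ≤ m)
    (hc : c = m + 1 ∨ c = m + 2) (hk1 : 1 ≤ k) (hkm : k ≤ m - 1) {N : MCell} {φ u χ w : Fin 4} (h0 : N 0 = floorLetter φ c)
    (h1 : N 1 = nodeTwoLetter u m) (h2 : N 2 = ceilingUnit h χ) (h3 : N 3 = subSubLetter m w k) : N ∉ C.lower := fun hN => by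
  have hk : Adapted (N 0) (φ + 2) := by rw [h0]; exact (floorLetter_node φ c).1
  have hk0 : coord (N 0) (φ + 2) = 0 := by rw [h0]; exact (floorLetter_node φ c).2
  have hk' : Adapted (N 3) (w + 2) := by rw [h3]; exact (subSubLetter_node m w k).1
  have hk'c : coord (N 3) (w + 2) = 2 * k := by rw [h3]; exact (subSubLetter_node m w k).2
  have hne : coord (N 0) (φ + 2) ≠ coord (N 3) (w + 2) := by rw [hk0, hk'c]; omega
  have nob : ∀ P ∈ C.upper, ∀ r : Fin 4, (P 0).1 < (N 0).1 → N 0 = ray (P 0) r ((N 0).1 - (P 0).1) → r = φ :=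
    fun P hP r hlt e => below_floorLetter (hU.2 P hP 0) (by omega) (by omega) (h0.symm.trans e)
  rcases hDN N hN 0 3 (by decide) (φ + 2) (w + 2) hk hk' hne with
    ⟨r, hr, P, hP, hZP⟩ | ⟨r, hr, P, hP, hZP⟩ | ⟨a, a', ha, -, P, hP, -, hb1, hb2, -, -⟩
  · exact absurd ((nob P hP r hZP.2.1 hZP.2.2).trans (fin4_add_two_add_two φ).symm) hr
  · have hd0 : 0 < (N 3).1 - (P 3).1 := by have := hZP.2.1; omega
    have e : subSubLetter m w k = ray (P 3) r ((N 3).1 - (P 3).1) := by rw [← h3]; exact hZP.2.2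
    have hr' : r ≠ w := fun e' => hr (by rw [e', fin4_add_two_add_two])
    have hP0 : P 0 = floorLetter φ c := (hZP.1 0 (by decide)).trans h0
    have hP1 : P 1 = nodeTwoLetter u m := (hZP.1 1 (by decide)).trans h1
    have hP2 : P 2 = ceilingUnit h χ := (hZP.1 2 (by decide)).trans h2
    obtain ⟨k', hk'0, hk'k, hz⟩ := below_subSubLetter_offRay hkm (hU.2 P hP 3) hd0 hr' e
    rcases (show k' = 0 ∨ 1 ≤ k' by omega) with hz0 | hz1
    · subst hz0
      rw [subSubLetter_zero] at hz
      rcases hc with hc1 | hc2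
      · rw [hc1] at hP0
        exact subFull_P_absent_swap hU hDN hDP hX hGu hh hm (c := m) (by omega) hP0 hP1 hP2 hz hP
      · rw [hc2] at hP0
        exact twinFloor_full_absent_swap hU hDN hDP hX hGu hh hm hP0 hP1 hP2 (by rw [hz]; exact floorLetter_ne_origin w (by omega)) hP
    · exact subSub_P_absent hU hDN hDP hX hGu hh hm (by omega) hz1 (by omega) hP0 hP1 hP2 hz hP
  · have hφ := nob P hP a hb1 hb2
    rcases ha with e | ⟨-, hne2⟩
    · exact absurd (e.symm.trans hφ) (fin4_ne_add_two φ).symm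
    · exact (hne2 (hφ.trans (fin4_add_two_add_two φ).symm)).elim

/-! ## §1 THE `r`-LINE: the letter `r_k = 2kI + (m−1−k)ℓ_v` THREE nodes below the ceiling over the twin-fork base (control g21, v1.0)
Census (tool `famK.py`, memo §1): all members peel round 2, kinds `B:DP` ∕ `B:DN`; ◇₁₀: 384 round-2 orbits not typed before; none at ◇₈ (needs `m ≥ 3`). -/

/-- the letter THREE nodes below the ceiling on its ray: `r_k = 2k·I + (m − 1 − k)·ℓ_v` of ◇_{2m+4} (top `h − 6`); `r_k(m) = t_k(m−1)`. -/
abbrev rLetter (m : ℤ) (v : Fin 4) (k : ℤ) : BPoint := subSubLetter (m - 1) v k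

theorem rLetter_top (m : ℤ) (v : Fin 4) (k : ℤ) : Adapted (rLetter m v k) v ∧ coord (rLetter m v k) v = 2 * k + 2 * (m - 1 - k) :=
  subSubLetter_top (m - 1) v k

theorem rLetter_node (m : ℤ) (v : Fin 4) (k : ℤ) : Adapted (rLetter m v k) (v + 2) ∧ coord (rLetter m v k) (v + 2) = 2 * k :=
  subSubLetter_node (m - 1) v k

theorem rLetter_not_isApex {m k : ℤ} (v : Fin 4) (hk : m - 1 - k ≠ 0) : ¬ isApex (rLetter m v k) := subSubLetter_not_isApex v hk

theorem rLetter_zero (m : ℤ) (v : Fin 4) : rLetter m v 0 = floorLetter v (m - 1) := subSubLetter_zero (m - 1) v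

/-- above `r_k` along its ray there are at most three diamond steps (`h = 2m+4`). -/
theorem above_rLetter {h m k e : ℤ} {z : BPoint} {v : Fin 4} (hh : h = 2 * m + 4) (hk : k ≤ m - 1) (he : 0 < e)
    (hz : InDiamond h z) (hze : z = ray (rLetter m v k) v e) : e = 1 ∨ e = 2 ∨ e = 3 := by
  have htop := hz.2.2.2
  rw [hze, show ray (rLetter m v k) v e = ray ((2 * k, 0, 0) : BPoint) v (m - 1 - k + e) from (ray_add _ v _ e).symm,
    top_ray_apex (2 * k) v (by omega)] at htop
  omega

theorem rLetter_up1 (m : ℤ) (v : Fin 4) (k : ℤ) : ray (rLetter m v k) v 1 = subSubLetter m v k := by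
  show ray (ray ((2 * k, 0, 0) : BPoint) v (m - 1 - k)) v 1 = ray ((2 * k, 0, 0) : BPoint) v (m - k)
  rw [show m - k = m - 1 - k + 1 by ring]; exact (ray_add _ v _ 1).symm

theorem rLetter_up2 (m : ℤ) (v : Fin 4) (k : ℤ) : ray (rLetter m v k) v 2 = subCeilLetter m v k := by
  show ray (ray ((2 * k, 0, 0) : BPoint) v (m - 1 - k)) v 2 = ray ((2 * k, 0, 0) : BPoint) v (m + 1 - k)
  rw [show m + 1 - k = m - 1 - k + 2 by ring]; exact (ray_add _ v _ 2).symm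

theorem rLetter_up3 {h m : ℤ} (hh : h = 2 * m + 4) (v : Fin 4) (k : ℤ) : ray (rLetter m v k) v 3 = ceilLetter h v (m + 1 - k) := by
  show ray (ray ((2 * k, 0, 0) : BPoint) v (m - 1 - k)) v 3 = ray ((h - 2 - 2 * (m + 1 - k), 0, 0) : BPoint) v (1 + (m + 1 - k))
  rw [show (h - 2 - 2 * (m + 1 - k) : ℤ) = 2 * k by rw [hh]; ring, show (1 + (m + 1 - k) : ℤ) = m - 1 - k + 3 by ring]
  exact (ray_add _ v _ 3).symm

/-- below `r_k` (`k ≤ m − 2`, so charged) off its ray: exactly the `r_{k'}`, `0 ≤ k' < k`. -/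
theorem below_rLetter_offRay {h m k e : ℤ} {z : BPoint} {v r : Fin 4} (hk : k ≤ m - 2) (hz : InDiamond h z) (he : 0 < e)
    (hr : r ≠ v) (heq : rLetter m v k = ray z r e) : ∃ k', 0 ≤ k' ∧ k' < k ∧ z = rLetter m v k' :=
  below_subSubLetter_offRay (m := m - 1) (by omega) hz he hr heq

/-- above the floor letter `c·ℓ_ψ` along its ray: `c + e ≤ m + 2` (`h = 2m+4`). -/
theorem above_floorLetter {h m c e : ℤ} {z : BPoint} {ψ : Fin 4} (hh : h = 2 * m + 4) (hc : 0 ≤ c) (he : 0 < e)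
    (hz : InDiamond h z) (hze : z = ray (floorLetter ψ c) ψ e) : c + e ≤ m + 2 := by
  have htop := hz.2.2.2
  rw [hze, show ray (floorLetter ψ c) ψ e = ray ((0, 0, 0) : BPoint) ψ (c + e) from (ray_add _ ψ _ e).symm,
    top_ray_apex 0 ψ (by omega)] at htop
  omega

/-- **TP22.** `P{(m+2)·ℓ_φ, 2I + m·ℓ_u, y_1, r_k} ∉ C.upper`, `1 ≤ k ≤ m − 2` (`h = 2m+4`) [◇_h, RULE D, X⁺, `PermClosed C.upper`]: the up-line
of `r_k` pinned by `y_1` is `t_k` (TN14), `s_k` (TN13) or `y_{m+1−k}` (TN12). -/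
theorem fullCeilOneR_P_absent {h m k : ℤ} {C : MConfig} (hU : C.InDiamond h) (hDN : ∀ Z ∈ C.lower, RuleDMu4N C Z)
    (hDP : ∀ P ∈ C.upper, RuleDMu4P C P) (hX : XPlusClosed C) (hGu : PermClosed C.upper) (hh : h = 2 * m + 4) (hm : 1 ≤ m)
    (hk1 : 1 ≤ k) (hkm : k ≤ m - 2) {P : MCell} {φ u v w : Fin 4} (h0 : P 0 = floorLetter φ (m + 2)) (h1 : P 1 = nodeTwoLetter u m)
    (h2 : P 2 = ceilLetter h v 1) (h3 : P 3 = rLetter m w k) : P ∉ C.upper := fun hP => by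
  have hna : ¬ isApex (P 3) := by rw [h3]; exact rLetter_not_isApex w (by omega)
  have hk : Adapted (P 3) w := by rw [h3]; exact (rLetter_top m w k).1
  have hkh : coord (P 3) w ≠ h := by rw [h3, (rLetter_top m w k).2]; omega
  obtain ⟨N, hN, hNP⟩ := upLine_of_ruleDMu4P hU hP (hDP P hP) (g := 2) (j := 3) (by decide)
    (by rw [h2]; exact onCeiling_ceilLetter (by norm_num) v) hna hk hkh
  have he0 : 0 < (N 3).1 - (P 3).1 := by have := hNP.2.1; omega
  have e : N 3 = ray (rLetter m w k) w ((N 3).1 - (P 3).1) := by rw [← h3]; exact hNP.2.2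
  have hN0 : N 0 = floorLetter φ (m + 2) := (hNP.1 0 (by decide)).symm.trans h0
  have hN1 : N 1 = nodeTwoLetter u m := (hNP.1 1 (by decide)).symm.trans h1
  have hN2 : N 2 = ceilLetter h v 1 := (hNP.1 2 (by decide)).symm.trans h2
  rcases above_rLetter hh (by omega) he0 (hU.1 N hN 3) e with he1 | he2 | he3
  · have hN3 : N 3 = subSubLetter m w k := by rw [e, he1]; exact rLetter_up1 m w k
    exact fullCeilOneSubSub_N_absent hU hDN hDP hX hGu hh hm hk1 (by omega) hN0 hN1 hN2 hN3 hN
  · have hN3 : N 3 = subCeilLetter m w k := by rw [e, he2]; exact rLetter_up2 m w k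
    exact fullCeilOneSub_N_absent hU hDN hDP hX hGu hh hm hk1 (by omega) hN0 hN1 hN2 hN3 hN
  · have hN3 : N 3 = ceilLetter h w (m + 1 - k) := by rw [e, he3]; exact rLetter_up3 hh w k
    exact ceilPairOne_N_absent hU hDN hDP hX hGu hh hm (c := m + 2) (by omega) (d' := m + 1 - k) (by omega) (by omega) hN0 hN1 hN2 hN3 hN

/-- **TN19.** `N{(m+2)·ℓ_φ, 2I + m·ℓ_u, y_1, r_k} ∉ C.lower`, `1 ≤ k ≤ m − 2` (`h = 2m+4`) [◇_h, RULE D, X⁺, `PermClosed C.upper`]: floor node `0`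
× node `2k`; off-ray servers of `r_k` are `r_{k'}`, `k' < k` ⇒ TP22, `r_0 = (m−1)ℓ` ⇒ TP13F (slots 0↔3). -/
theorem fullCeilOneR_N_absent {h m k : ℤ} {C : MConfig} (hU : C.InDiamond h) (hDN : ∀ Z ∈ C.lower, RuleDMu4N C Z)
    (hDP : ∀ P ∈ C.upper, RuleDMu4P C P) (hX : XPlusClosed C) (hGu : PermClosed C.upper) (hh : h = 2 * m + 4) (hm : 1 ≤ m)
    (hk1 : 1 ≤ k) (hkm : k ≤ m - 2) {N : MCell} {φ u v w : Fin 4} (h0 : N 0 = floorLetter φ (m + 2)) (h1 : N 1 = nodeTwoLetter u m)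
    (h2 : N 2 = ceilLetter h v 1) (h3 : N 3 = rLetter m w k) : N ∉ C.lower := fun hN => by
  have hk : Adapted (N 0) (φ + 2) := by rw [h0]; exact (floorLetter_node φ (m + 2)).1
  have hk0 : coord (N 0) (φ + 2) = 0 := by rw [h0]; exact (floorLetter_node φ (m + 2)).2
  have hk' : Adapted (N 3) (w + 2) := by rw [h3]; exact (rLetter_node m w k).1
  have hk'c : coord (N 3) (w + 2) = 2 * k := by rw [h3]; exact (rLetter_node m w k).2
  have hne : coord (N 0) (φ + 2) ≠ coord (N 3) (w + 2) := by rw [hk0, hk'c]; omega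
  have nob : ∀ P ∈ C.upper, ∀ r : Fin 4, (P 0).1 < (N 0).1 → N 0 = ray (P 0) r ((N 0).1 - (P 0).1) → r = φ :=
    fun P hP r hlt e => below_floorLetter (hU.2 P hP 0) (by omega) (by omega) (h0.symm.trans e)
  rcases hDN N hN 0 3 (by decide) (φ + 2) (w + 2) hk hk' hne with
    ⟨r, hr, P, hP, hZP⟩ | ⟨r, hr, P, hP, hZP⟩ | ⟨a, a', ha, -, P, hP, -, hb1, hb2, -, -⟩
  · exact absurd ((nob P hP r hZP.2.1 hZP.2.2).trans (fin4_add_two_add_two φ).symm) hr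
  · have hd0 : 0 < (N 3).1 - (P 3).1 := by have := hZP.2.1; omega
    have e : rLetter m w k = ray (P 3) r ((N 3).1 - (P 3).1) := by rw [← h3]; exact hZP.2.2
    have hr' : r ≠ w := fun e' => hr (by rw [e', fin4_add_two_add_two])
    have hP0 : P 0 = floorLetter φ (m + 2) := (hZP.1 0 (by decide)).trans h0
    have hP1 : P 1 = nodeTwoLetter u m := (hZP.1 1 (by decide)).trans h1
    have hP2 : P 2 = ceilLetter h v 1 := (hZP.1 2 (by decide)).trans h2
    obtain ⟨k', hk'0, hk'k, hz⟩ := below_rLetter_offRay hkm (hU.2 P hP 3) hd0 hr' e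
    rcases (show k' = 0 ∨ 1 ≤ k' by omega) with hz0 | hz1
    · subst hz0
      rw [rLetter_zero] at hz
      exact ceilPairOneFull_P_absent_swap hU hDN hDP hX hGu hh hm (c := m - 1) (by omega) hP0 hP1 hP2 hz hP
    · exact fullCeilOneR_P_absent hU hDN hDP hX hGu hh hm hz1 (by omega) hP0 hP1 hP2 hz hP
  · have hφ := nob P hP a hb1 hb2
    rcases ha with e | ⟨-, hne2⟩
    · exact absurd (e.symm.trans hφ) (fin4_ne_add_two φ).symm
    · exact (hne2 (hφ.trans (fin4_add_two_add_two φ).symm)).elim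

/-- **TP23.** `P{(m+1)·ℓ_φ, 2I + m·ℓ_u, y_1, r_k} ∉ C.upper`, `1 ≤ k ≤ m − 2` (`h = 2m+4`) [◇_h, RULE D, X⁺, `PermClosed C.upper`]: the up-line
of `(m+1)ℓ` pinned by `y_1` is the full letter ⇒ TN19. -/
theorem subFullCeilOneR_P_absent {h m k : ℤ} {C : MConfig} (hU : C.InDiamond h) (hDN : ∀ Z ∈ C.lower, RuleDMu4N C Z)
    (hDP : ∀ P ∈ C.upper, RuleDMu4P C P) (hX : XPlusClosed C) (hGu : PermClosed C.upper) (hh : h = 2 * m + 4) (hm : 1 ≤ m)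
    (hk1 : 1 ≤ k) (hkm : k ≤ m - 2) {P : MCell} {φ u v w : Fin 4} (h0 : P 0 = floorLetter φ (m + 1)) (h1 : P 1 = nodeTwoLetter u m)
    (h2 : P 2 = ceilLetter h v 1) (h3 : P 3 = rLetter m w k) : P ∉ C.upper := fun hP => by
  have hna : ¬ isApex (P 0) := by rw [h0]; exact floorLetter_not_isApex φ (by omega)
  have hk : Adapted (P 0) φ := by rw [h0]; exact (floorLetter_top φ (m + 1)).1
  have hkh : coord (P 0) φ ≠ h := by rw [h0, (floorLetter_top φ (m + 1)).2]; omega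
  obtain ⟨N, hN, hNP⟩ := upLine_of_ruleDMu4P hU hP (hDP P hP) (g := 2) (j := 0) (by decide)
    (by rw [h2]; exact onCeiling_ceilLetter (by norm_num) v) hna hk hkh
  have he0 : 0 < (N 0).1 - (P 0).1 := by have := hNP.2.1; omega
  have e : N 0 = ray (floorLetter φ (m + 1)) φ ((N 0).1 - (P 0).1) := by rw [← h0]; exact hNP.2.2
  have he1 := above_subFullLetter hh (by omega) he0 (hU.1 N hN 0) e
  have hN0 : N 0 = floorLetter φ (m + 1 + 1) := by rw [e, he1]; exact (ray_add _ φ (m + 1) 1).symm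
  rw [show m + 1 + 1 = m + 2 by ring] at hN0
  exact fullCeilOneR_N_absent hU hDN hDP hX hGu hh hm hk1 hkm hN0 ((hNP.1 1 (by decide)).symm.trans h1)
    ((hNP.1 2 (by decide)).symm.trans h2) ((hNP.1 3 (by decide)).symm.trans h3) hN

/-- **TP24.** `P{c·ℓ_φ, 2I + m·ℓ_u, cu_χ, r_k} ∉ C.upper`, `c ∈ {m+1, m+2}`, `1 ≤ k ≤ m − 2` (`h = 2m+4`) [◇_h, RULE D, X⁺, `PermClosed C.upper`]:
the up-line of `r_k` pinned by `cu` is `t_k` (TN15), `s_k` (TN10) or `y_{m+1−k}` (TN8). -/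
theorem twinFrameR_P_absent {h m c k : ℤ} {C : MConfig} (hU : C.InDiamond h) (hDN : ∀ Z ∈ C.lower, RuleDMu4N C Z)
    (hDP : ∀ P ∈ C.upper, RuleDMu4P C P) (hX : XPlusClosed C) (hGu : PermClosed C.upper) (hh : h = 2 * m + 4) (hm : 1 ≤ m)
    (hc : c = m + 1 ∨ c = m + 2) (hk1 : 1 ≤ k) (hkm : k ≤ m - 2) {P : MCell} {φ u χ w : Fin 4} (h0 : P 0 = floorLetter φ c)
    (h1 : P 1 = nodeTwoLetter u m) (h2 : P 2 = ceilingUnit h χ) (h3 : P 3 = rLetter m w k) : P ∉ C.upper := fun hP => by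
  have hna : ¬ isApex (P 3) := by rw [h3]; exact rLetter_not_isApex w (by omega)
  have hk : Adapted (P 3) w := by rw [h3]; exact (rLetter_top m w k).1
  have hkh : coord (P 3) w ≠ h := by rw [h3, (rLetter_top m w k).2]; omega
  obtain ⟨N, hN, hNP⟩ := upLine_of_ruleDMu4P hU hP (hDP P hP) (g := 2) (j := 3) (by decide)
    (by rw [h2]; exact onCeiling_ceilingUnit h χ) hna hk hkh
  have he0 : 0 < (N 3).1 - (P 3).1 := by have := hNP.2.1; omega
  have e : N 3 = ray (rLetter m w k) w ((N 3).1 - (P 3).1) := by rw [← h3]; exact hNP.2.2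
  have hN0 : N 0 = floorLetter φ c := (hNP.1 0 (by decide)).symm.trans h0
  have hN1 : N 1 = nodeTwoLetter u m := (hNP.1 1 (by decide)).symm.trans h1
  have hN2 : N 2 = ceilingUnit h χ := (hNP.1 2 (by decide)).symm.trans h2
  rcases above_rLetter hh (by omega) he0 (hU.1 N hN 3) e with he1 | he2 | he3
  · have hN3 : N 3 = subSubLetter m w k := by rw [e, he1]; exact rLetter_up1 m w k
    exact twinFrameSubSub_N_absent hU hDN hDP hX hGu hh hm hc hk1 (by omega) hN0 hN1 hN2 hN3 hN
  · have hN3 : N 3 = subCeilLetter m w k := by rw [e, he2]; exact rLetter_up2 m w k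
    exact subCeil_N_absent hU hDN hDP hX hGu hh hm (by omega) hk1 (by omega) hN0 hN1 hN2 hN3 hN
  · have hN3 : N 3 = ceilLetter h w (m + 1 - k) := by rw [e, he3]; exact rLetter_up3 hh w k
    exact ceilLetter_N_absent hU hDN hDP hX hGu hh hm (by omega) (d := m + 1 - k) (by omega) (by omega) hN0 hN1 hN2 hN3 hN

/-- **TN20.** `N{c·ℓ_φ, 2I + m·ℓ_u, cu_χ, r_k} ∉ C.lower`, `c ∈ {m+1, m+2}`, `1 ≤ k ≤ m − 2` (`h = 2m+4`) [◇_h, RULE D, X⁺, `PermClosed C.upper`]: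
floor node `0` × node `2k`; servers `r_{k'}` ⇒ TP24, `r_0 = (m−1)ℓ` ⇒ TP8 (slots 0↔3; `c = m+1`) ∕ TP3 (slots 0↔3; `c = m+2`). -/
theorem twinFrameR_N_absent {h m c k : ℤ} {C : MConfig} (hU : C.InDiamond h) (hDN : ∀ Z ∈ C.lower, RuleDMu4N C Z)
    (hDP : ∀ P ∈ C.upper, RuleDMu4P C P) (hX : XPlusClosed C) (hGu : PermClosed C.upper) (hh : h = 2 * m + 4) (hm : 1 ≤ m)
    (hc : c = m + 1 ∨ c = m + 2) (hk1 : 1 ≤ k) (hkm : k ≤ m - 2) {N : MCell} {φ u χ w : Fin 4} (h0 : N 0 = floorLetter φ c)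
    (h1 : N 1 = nodeTwoLetter u m) (h2 : N 2 = ceilingUnit h χ) (h3 : N 3 = rLetter m w k) : N ∉ C.lower := fun hN => by
  have hk : Adapted (N 0) (φ + 2) := by rw [h0]; exact (floorLetter_node φ c).1
  have hk0 : coord (N 0) (φ + 2) = 0 := by rw [h0]; exact (floorLetter_node φ c).2
  have hk' : Adapted (N 3) (w + 2) := by rw [h3]; exact (rLetter_node m w k).1
  have hk'c : coord (N 3) (w + 2) = 2 * k := by rw [h3]; exact (rLetter_node m w k).2
  have hne : coord (N 0) (φ + 2) ≠ coord (N 3) (w + 2) := by rw [hk0, hk'c]; omega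
  have nob : ∀ P ∈ C.upper, ∀ r : Fin 4, (P 0).1 < (N 0).1 → N 0 = ray (P 0) r ((N 0).1 - (P 0).1) → r = φ :=
    fun P hP r hlt e => below_floorLetter (hU.2 P hP 0) (by omega) (by omega) (h0.symm.trans e)
  rcases hDN N hN 0 3 (by decide) (φ + 2) (w + 2) hk hk' hne with
    ⟨r, hr, P, hP, hZP⟩ | ⟨r, hr, P, hP, hZP⟩ | ⟨a, a', ha, -, P, hP, -, hb1, hb2, -, -⟩
  · exact absurd ((nob P hP r hZP.2.1 hZP.2.2).trans (fin4_add_two_add_two φ).symm) hr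
  · have hd0 : 0 < (N 3).1 - (P 3).1 := by have := hZP.2.1; omega
    have e : rLetter m w k = ray (P 3) r ((N 3).1 - (P 3).1) := by rw [← h3]; exact hZP.2.2
    have hr' : r ≠ w := fun e' => hr (by rw [e', fin4_add_two_add_two])
    have hP0 : P 0 = floorLetter φ c := (hZP.1 0 (by decide)).trans h0
    have hP1 : P 1 = nodeTwoLetter u m := (hZP.1 1 (by decide)).trans h1
    have hP2 : P 2 = ceilingUnit h χ := (hZP.1 2 (by decide)).trans h2
    obtain ⟨k', hk'0, hk'k, hz⟩ := below_rLetter_offRay hkm (hU.2 P hP 3) hd0 hr' e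
    rcases (show k' = 0 ∨ 1 ≤ k' by omega) with hz0 | hz1
    · subst hz0
      rw [rLetter_zero] at hz
      rcases hc with hc1 | hc2
      · rw [hc1] at hP0
        exact subFull_P_absent_swap hU hDN hDP hX hGu hh hm (c := m - 1) (by omega) hP0 hP1 hP2 hz hP
      · rw [hc2] at hP0
        exact twinFloor_full_absent_swap hU hDN hDP hX hGu hh hm hP0 hP1 hP2 (by rw [hz]; exact floorLetter_ne_origin w (by omega)) hP
    · exact twinFrameR_P_absent hU hDN hDP hX hGu hh hm hc hz1 (by omega) hP0 hP1 hP2 hz hP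
  · have hφ := nob P hP a hb1 hb2
    rcases ha with e | ⟨-, hne2⟩
    · exact absurd (e.symm.trans hφ) (fin4_ne_add_two φ).symm
    · exact (hne2 (hφ.trans (fin4_add_two_add_two φ).symm)).elim

/-- **TP25.** `P{m·ℓ_φ, 2I + m·ℓ_u, cu_χ, r_k} ∉ C.upper`, `1 ≤ k ≤ m − 2` (`h = 2m+4`) [◇_h, RULE D, X⁺, `PermClosed C.upper`]: the up-line of
`m·ℓ_φ` pinned by `cu` is `(m+1)ℓ_φ` or `(m+2)ℓ_φ` ⇒ TN20. -/
theorem midTwinFrameR_P_absent {h m k : ℤ} {C : MConfig} (hU : C.InDiamond h) (hDN : ∀ Z ∈ C.lower, RuleDMu4N C Z)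
    (hDP : ∀ P ∈ C.upper, RuleDMu4P C P) (hX : XPlusClosed C) (hGu : PermClosed C.upper) (hh : h = 2 * m + 4) (hm : 1 ≤ m)
    (hk1 : 1 ≤ k) (hkm : k ≤ m - 2) {P : MCell} {φ u χ w : Fin 4} (h0 : P 0 = floorLetter φ m) (h1 : P 1 = nodeTwoLetter u m)
    (h2 : P 2 = ceilingUnit h χ) (h3 : P 3 = rLetter m w k) : P ∉ C.upper := fun hP => by
  have hna : ¬ isApex (P 0) := by rw [h0]; exact floorLetter_not_isApex φ (by omega)
  have hk : Adapted (P 0) φ := by rw [h0]; exact (floorLetter_top φ m).1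
  have hkh : coord (P 0) φ ≠ h := by rw [h0, (floorLetter_top φ m).2]; omega
  obtain ⟨N, hN, hNP⟩ := upLine_of_ruleDMu4P hU hP (hDP P hP) (g := 2) (j := 0) (by decide)
    (by rw [h2]; exact onCeiling_ceilingUnit h χ) hna hk hkh
  have he0 : 0 < (N 0).1 - (P 0).1 := by have := hNP.2.1; omega
  have e : N 0 = ray (floorLetter φ m) φ ((N 0).1 - (P 0).1) := by rw [← h0]; exact hNP.2.2
  have hle := above_floorLetter hh (by omega) he0 (hU.1 N hN 0) e
  have hN0 : N 0 = floorLetter φ (m + ((N 0).1 - (P 0).1)) := e.trans (ray_add _ φ m _).symm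
  exact twinFrameR_N_absent hU hDN hDP hX hGu hh hm (c := m + ((N 0).1 - (P 0).1)) (by omega) hk1 hkm hN0
    ((hNP.1 1 (by decide)).symm.trans h1) ((hNP.1 2 (by decide)).symm.trans h2) ((hNP.1 3 (by decide)).symm.trans h3) hN

/-! ### §1b ◇₁₀ census representatives (`m = 3`, `k = 1`, `r_1 = 2I + ℓ`; all peel round 2, law-free kinds `B:DP` ∕ `B:DN`) -/

/-- ◇₁₀ `P[2I+l-1|5l-1|2I+3l-1|6I+2l-1]` (census var 286568, ROUND 2, `B:DP`): TP22. -/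
def repTP22 : MCell := ![(5, -5, 0), (5, -3, 0), (8, -2, 0), (3, -1, 0)]
theorem repTP22_absent {C : MConfig} (hU : C.InDiamond 10) (hG : C.G1Closed) (hS : C.StaticH1) : repTP22 ∉ C.upper :=
  fullCeilOneR_P_absent hU hS.1.1 hS.1.2 hS.2.1 hG.2.1 (m := 3) (k := 1) (by norm_num) (by norm_num) (by norm_num) (by norm_num)
    (φ := 2) (u := 2) (v := 2) (w := 2) (by simp [repTP22, ray]) (by simp [repTP22, ray]) (by simp [repTP22, ray]) (by simp [repTP22, ray])

/-- ◇₁₀ `N[2I+l-1|5l-1|2I+3l-1|6I+2l-1]` (census var 286567, ROUND 2, `B:DN`): TN19. -/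
theorem repTN19_absent {C : MConfig} (hU : C.InDiamond 10) (hG : C.G1Closed) (hS : C.StaticH1) : repTP22 ∉ C.lower :=
  fullCeilOneR_N_absent hU hS.1.1 hS.1.2 hS.2.1 hG.2.1 (m := 3) (k := 1) (by norm_num) (by norm_num) (by norm_num) (by norm_num)
    (φ := 2) (u := 2) (v := 2) (w := 2) (by simp [repTP22, ray]) (by simp [repTP22, ray]) (by simp [repTP22, ray]) (by simp [repTP22, ray])

/-- ◇₁₀ `P[2I+l-1|4l-1|2I+3l-1|6I+2l-1]` (census var 269480, ROUND 2, `B:DP`): TP23. -/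
def repTP23 : MCell := ![(4, -4, 0), (5, -3, 0), (8, -2, 0), (3, -1, 0)]
theorem repTP23_absent {C : MConfig} (hU : C.InDiamond 10) (hG : C.G1Closed) (hS : C.StaticH1) : repTP23 ∉ C.upper :=
  subFullCeilOneR_P_absent hU hS.1.1 hS.1.2 hS.2.1 hG.2.1 (m := 3) (k := 1) (by norm_num) (by norm_num) (by norm_num) (by norm_num)
    (φ := 2) (u := 2) (v := 2) (w := 2) (by simp [repTP23, ray]) (by simp [repTP23, ray]) (by simp [repTP23, ray]) (by simp [repTP23, ray])

/-- ◇₁₀ `P[2I+l-1|4l-1|2I+3l-1|8I+l-1]` (census var 269490, ROUND 2, `B:DP`): TP24 with `c = m+1 = 4`. -/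
def repTP24 : MCell := ![(4, -4, 0), (5, -3, 0), (9, -1, 0), (3, -1, 0)]
theorem repTP24_absent {C : MConfig} (hU : C.InDiamond 10) (hG : C.G1Closed) (hS : C.StaticH1) : repTP24 ∉ C.upper :=
  twinFrameR_P_absent hU hS.1.1 hS.1.2 hS.2.1 hG.2.1 (m := 3) (c := 4) (k := 1) (by norm_num) (by norm_num) (by norm_num) (by norm_num)
    (by norm_num) (φ := 2) (u := 2) (χ := 2) (w := 2) (by simp [repTP24, ray]) (by simp [repTP24, ray]) (by simp [repTP24, ray])
    (by simp [repTP24, ray])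

/-- ◇₁₀ `N[2I+l-1|4l-1|2I+3l-1|8I+l-1]` (census var 269489, ROUND 2, `B:DN`): TN20 with `c = m+1 = 4`. -/
theorem repTN20_absent {C : MConfig} (hU : C.InDiamond 10) (hG : C.G1Closed) (hS : C.StaticH1) : repTP24 ∉ C.lower :=
  twinFrameR_N_absent hU hS.1.1 hS.1.2 hS.2.1 hG.2.1 (m := 3) (c := 4) (k := 1) (by norm_num) (by norm_num) (by norm_num) (by norm_num)
    (by norm_num) (φ := 2) (u := 2) (χ := 2) (w := 2) (by simp [repTP24, ray]) (by simp [repTP24, ray]) (by simp [repTP24, ray])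
    (by simp [repTP24, ray])

/-- ◇₁₀ `P[3l-1|2I+l-1|2I+3l-1|8I+l-1]` (census var 209916, ROUND 2, `B:DP`): TP25. -/
def repTP25 : MCell := ![(3, -3, 0), (5, -3, 0), (9, -1, 0), (3, -1, 0)]
theorem repTP25_absent {C : MConfig} (hU : C.InDiamond 10) (hG : C.G1Closed) (hS : C.StaticH1) : repTP25 ∉ C.upper :=
  midTwinFrameR_P_absent hU hS.1.1 hS.1.2 hS.2.1 hG.2.1 (m := 3) (k := 1) (by norm_num) (by norm_num) (by norm_num) (by norm_num)
    (φ := 2) (u := 2) (χ := 2) (w := 2) (by simp [repTP25, ray]) (by simp [repTP25, ray]) (by simp [repTP25, ray]) (by simp [repTP25, ray])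


/-! ## §2 NEW (g21): THE FULL-LETTER FRAME WITH A FREE SLOT, THE SUB-APEX `(h−2)·I`, THE SUB-FULL FRAME (law-free; ◇_h, RULE D on both levels, X⁺, `S₄` on E₊;
`h = 2m+4`, `m ≥ 1`; slots 0,1,2,3 = floor letter, `B = 2I + m·ℓ_u`, ceiling-side letter, FREE letter)

ONE MECHANISM.  A ceiling letter is a PIN from above (nothing of ◇_h sits above it off its node ray: `not_inDiamond_above_offnode`) and a floor letter is a PIN
from below (`below_floorLetter`); RULE D on (pin) × (the NODE frame of a ceiling-line letter `y_d`, or any frame of the free letter) has no cover branch and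
moves ONE letter only: `y_d` up its node ray to `y_{d−e}` (`P`-cells, `above_ceilLetter_offRay`) or down to `y_{d+e}` (`N`-cells, `below_ceilLetter_offRay`),
the sub-apex `(h−2)I` up to a ceiling unit `cu_r` (`above_subApex`), or the free letter to ANY letter below it — so the fourth slot is FREE (`x ≠ O`) or
half-free (node level `≥ 2`, i.e. neither `O` nor a floor letter).  The free-slot statements below subsume, at `c = m+2` resp. `c = m+1`, the fixed-letter
families TP15 TP17a TP22 (⊂ TP30), TN13 TN14 TN19 (⊂ TN23), TP17b TP23 (⊂ TP32), TN10 TN15 TN20 (⊂ TN26), TP25 (⊂ TP34) — those stay as stated (and proved) in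
`CeilingPair.lean` ∕ §1; nothing is withdrawn. -/

/-- a letter of ◇_h of node level `≥ 2` (so neither `O` nor a floor letter) has an adapted direction with NON-ZERO coordinate: its node direction. -/
theorem exists_coord_ne_zero_of_nodeLevel {h : ℤ} {x : BPoint} (hx : InDiamond h x) (h2 : 2 ≤ nodeLevel x) :
    ∃ k : Fin 4, Adapted x k ∧ coord x k ≠ 0 := by
  obtain ⟨k, hk, hkc⟩ := exists_node_dir hx.1
  exact ⟨k, hk, by rw [hkc]; unfold nodeLevel at h2; omega⟩

/-- the diamond servers below a letter of node level `≥ 2` are not the origin (the node level of `O + d·ℓ_r` is `0`). -/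
theorem server_ne_origin_of_nodeLevel {x z : BPoint} {r : Fin 4} {d : ℤ} (hd : 0 ≤ d) (hx : x = ray z r d) (h2 : 2 ≤ nodeLevel x) :
    z ≠ (0, 0, 0) := fun hz => by
  rw [hz] at hx
  rw [hx, nodeLevel_ray_apex 0 r hd] at h2
  omega

/-! ### §2a `N{(m+2)ℓ, B, cu, x}` (every `x ≠ O`) → `P{(m+2)ℓ, B, y_1, x}` (every `x ≠ O`) → `N{(m+2)ℓ, B, y_1, W}` → `P{(m+2)ℓ, B, y_2, W}`, `P{(m+2)ℓ, B, s_m, W}`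
(every `W` of node level ≥ 2) -/

/-- **TN21 (free slot).** `N{(m+2)·ℓ_φ, 2I + m·ℓ_u, cu_χ, x} ∉ C.lower` for EVERY letter `x` with a non-zero adapted coordinate (= every `x ≠ O`, TN21′)
[◇_h, RULE D, X⁺, `S₄` on E₊]: RULE D on (x, that coordinate) × (floor node of the full letter, `0`): the full letter is served below only along `φ` and admits
no cover, so `x` is served below by some `x′` — the child `P{(m+2)ℓ, B, cu, x′}` is TP3 (`x′ ≠ O`, slot form `twinFloor_full_absent_swap`) or, for `x′ = O`,
lifts through `cu` (pinned by the full letter) to the floor tower TN0 `N{(m+2)ℓ, B, hI, O}`.  Census (j318002 peel tables): ◇₈ 632 ∕ ◇₁₀ 968 orbits, all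
peel round 2 `B:DN`; 32 ∕ 112 of them untyped before (the classes `x = 2jI`, `x = r_k` at `c ≠ m+1, m+2`, …). -/
theorem twinFull_N_absent {h m : ℤ} {C : MConfig} (hU : C.InDiamond h) (hDN : ∀ Z ∈ C.lower, RuleDMu4N C Z)
    (hDP : ∀ P ∈ C.upper, RuleDMu4P C P) (hX : XPlusClosed C) (hGu : PermClosed C.upper) (hh : h = 2 * m + 4) (hm : 1 ≤ m)
    {N : MCell} {φ u χ k : Fin 4} (h0 : N 0 = floorLetter φ (m + 2)) (h1 : N 1 = nodeTwoLetter u m) (h2 : N 2 = ceilingUnit h χ)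
    (hk : Adapted (N 3) k) (hk0 : coord (N 3) k ≠ 0) : N ∉ C.lower := fun hN => by
  have hk' : Adapted (N 0) (φ + 2) := by rw [h0]; exact (floorLetter_node φ (m + 2)).1
  have hk'0 : coord (N 0) (φ + 2) = 0 := by rw [h0]; exact (floorLetter_node φ (m + 2)).2
  have hne : coord (N 3) k ≠ coord (N 0) (φ + 2) := by rw [hk'0]; exact hk0
  have nob : ∀ P ∈ C.upper, ∀ r : Fin 4, (P 0).1 < (N 0).1 → N 0 = ray (P 0) r ((N 0).1 - (P 0).1) → r = φ :=
    fun P hP r hlt e => below_floorLetter (hU.2 P hP 0) (by omega) (by omega) (h0.symm.trans e)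
  rcases hDN N hN 3 0 (by decide) k (φ + 2) hk hk' hne with
    ⟨r, -, P, hP, hZP⟩ | ⟨r, hr, P, hP, hZP⟩ | ⟨a, a', -, ha', P, hP, -, -, -, hc1, hc2⟩
  · have hP0 : P 0 = floorLetter φ (m + 2) := (hZP.1 0 (by decide)).trans h0
    have hP1 : P 1 = nodeTwoLetter u m := (hZP.1 1 (by decide)).trans h1
    have hP2 : P 2 = ceilingUnit h χ := (hZP.1 2 (by decide)).trans h2
    by_cases hx : P 3 = (0, 0, 0)
    · obtain ⟨N', hN', hN'P, hN'2⟩ := lift_of_ceilingUnit hU hP (hDP P hP) (a := 0) (d := 2) (by decide)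
        (by rw [hP0]; exact onCeiling_fullLetter hh (by omega) φ) hP2
      exact twinTower_N_absent hU hDN hDP hX hh hm (by omega : (0 : ℤ) ≤ m + 2) le_rfl (Or.inl (by omega)) (ψ := φ)
        ((hN'P.1 0 (by decide)).symm.trans hP0) ((hN'P.1 1 (by decide)).symm.trans hP1) hN'2
        (((hN'P.1 3 (by decide)).symm.trans hx).trans (ray_zero _ φ).symm) hN'
    · exact twinFloor_full_absent_swap hU hDN hDP hX hGu hh hm hP0 hP1 hP2 hx hP
  · exact absurd ((nob P hP r hZP.2.1 hZP.2.2).trans (fin4_add_two_add_two φ).symm) hr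
  · have hφ := nob P hP a' hc1 hc2
    rcases ha' with e | ⟨-, hne2⟩
    · exact absurd (e.symm.trans hφ) (fin4_ne_add_two φ).symm
    · exact (hne2 (hφ.trans (fin4_add_two_add_two φ).symm)).elim

/-- TN21′: the same with the hypothesis `x ≠ O`. -/
theorem twinFull_N_absent' {h m : ℤ} {C : MConfig} (hU : C.InDiamond h) (hDN : ∀ Z ∈ C.lower, RuleDMu4N C Z)
    (hDP : ∀ P ∈ C.upper, RuleDMu4P C P) (hX : XPlusClosed C) (hGu : PermClosed C.upper) (hh : h = 2 * m + 4) (hm : 1 ≤ m)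
    {N : MCell} {φ u χ : Fin 4} (h0 : N 0 = floorLetter φ (m + 2)) (h1 : N 1 = nodeTwoLetter u m) (h2 : N 2 = ceilingUnit h χ)
    (hx : N 3 ≠ (0, 0, 0)) : N ∉ C.lower := fun hN => by
  obtain ⟨k, hk, hk0⟩ := exists_coord_ne_zero (hU.1 N hN 3) hx
  exact twinFull_N_absent hU hDN hDP hX hGu hh hm h0 h1 h2 hk hk0 hN

/-- **TP30 (free slot).** `P{(m+2)·ℓ_φ, 2I + m·ℓ_u, y_1, x} ∉ C.upper` for EVERY `x ≠ O` (`y_1 = (h−4)I + 2ℓ_v`) [◇_h, RULE D, X⁺, `S₄` on E₊]: RULE D on (the full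
letter, top `h`: a pin) × (the NODE frame `v + 2` of `y_1`, coordinate `h − 4`) is up-line service of `y_1` in the direction `v + 2`: above `y_1` on that ray sit
only `cu_v` and `hI` (`above_ceilLetter_offRay`), and the children `N{(m+2)ℓ, B, cu_v, x}`, `N{(m+2)ℓ, B, hI, x}` are TN21′ and TN3.  Subsumes TP15, TP17a, TP22
at `c = m+2`.  Census: ◇₈ 632 ∕ ◇₁₀ 968 orbits (616 ∕ 952 round 2 `B:DP`, 16 ∕ 16 round 1 `P:Xp`); 48 ∕ 128 untyped before (`x = 2jI`, …). -/
theorem fullCeilOne_free_P_absent {h m : ℤ} {C : MConfig} (hU : C.InDiamond h) (hDN : ∀ Z ∈ C.lower, RuleDMu4N C Z)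
    (hDP : ∀ P ∈ C.upper, RuleDMu4P C P) (hX : XPlusClosed C) (hGu : PermClosed C.upper) (hh : h = 2 * m + 4) (hm : 1 ≤ m)
    {P : MCell} {φ u v : Fin 4} (h0 : P 0 = floorLetter φ (m + 2)) (h1 : P 1 = nodeTwoLetter u m) (h2 : P 2 = ceilLetter h v 1)
    (hx : P 3 ≠ (0, 0, 0)) : P ∉ C.upper := fun hP => by
  have hna : ¬ isApex (P 2) := by rw [h2]; exact ceilLetter_not_isApex v (by norm_num)
  have hk : Adapted (P 2) (v + 2) := by rw [h2]; exact (ceilLetter_node h v 1).1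
  have hkh : coord (P 2) (v + 2) ≠ h := by rw [h2, (ceilLetter_node h v 1).2]; omega
  obtain ⟨N, hN, hNP⟩ := upLine_of_ruleDMu4P hU hP (hDP P hP) (g := 0) (j := 2) (by decide)
    (by rw [h0]; exact onCeiling_fullLetter hh (by omega) φ) hna hk hkh
  have he0 : 0 < (N 2).1 - (P 2).1 := by have := hNP.2.1; omega
  have e : N 2 = ray (ceilLetter h v 1) (v + 2) ((N 2).1 - (P 2).1) := by rw [← h2]; exact hNP.2.2
  obtain ⟨-, hle, hN2⟩ := above_ceilLetter_offRay (by norm_num) (hU.1 N hN 2) he0 e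
  have hN0 : N 0 = floorLetter φ (m + 2) := (hNP.1 0 (by decide)).symm.trans h0
  have hN1 : N 1 = nodeTwoLetter u m := (hNP.1 1 (by decide)).symm.trans h1
  have hN3 : N 3 ≠ (0, 0, 0) := by rw [← hNP.1 3 (by decide)]; exact hx
  obtain ⟨k, hk3, hk30⟩ := exists_coord_ne_zero (hU.1 N hN 3) hN3
  rcases (show (N 2).1 - (P 2).1 = 1 ∨ (N 2).1 - (P 2).1 = 2 by omega) with e1 | e2
  · rw [e1, show (1 - 1 : ℤ) = 0 by norm_num, ceilLetter_zero] at hN2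
    exact twinFull_N_absent hU hDN hDP hX hGu hh hm hN0 hN1 hN2 hk3 hk30 hN
  · rw [e2, show (1 - 2 : ℤ) = -1 by norm_num, ceilLetter_neg_one] at hN2
    exact twinFloor_N_absent_slot3 hU hDN hDP hX hh hm (by omega : (0 : ℤ) ≤ m + 2) hN0 hN1 hN2 hk3 hk30 hN

/-- **TN23 (half-free slot).** `N{(m+2)·ℓ_φ, 2I + m·ℓ_u, y_1, W} ∉ C.lower` for EVERY `W` of node level `≥ 2` [◇_h, RULE D, X⁺, `S₄` on E₊]: RULE D on (`W`, its node
direction, coordinate `≥ 2`) × (floor node of the full letter, `0`): the full letter is a pin from below, so `W` is served below by some `x′`, and `x′ ≠ O` because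
`O + d·ℓ_r` has node level `0`; the child `P{(m+2)ℓ, B, y_1, x′}` is TP30.  Subsumes TN13, TN14, TN19 (and TN12 at `c = m+2`).  A floor letter `W` is NOT
claimed (`N{(m+2)ℓ, B, y_1, c·ℓ}` is peel round 5, kind `P:Am`).  Census: ◇₈ 400 ∕ ◇₁₀ 672 orbits, all round 2 `B:DN`; 48 ∕ 128 untyped before. -/
theorem fullCeilOne_N_absent {h m : ℤ} {C : MConfig} (hU : C.InDiamond h) (hDN : ∀ Z ∈ C.lower, RuleDMu4N C Z)
    (hDP : ∀ P ∈ C.upper, RuleDMu4P C P) (hX : XPlusClosed C) (hGu : PermClosed C.upper) (hh : h = 2 * m + 4) (hm : 1 ≤ m)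
    {N : MCell} {φ u v : Fin 4} (h0 : N 0 = floorLetter φ (m + 2)) (h1 : N 1 = nodeTwoLetter u m) (h2 : N 2 = ceilLetter h v 1)
    (hW : 2 ≤ nodeLevel (N 3)) : N ∉ C.lower := fun hN => by
  obtain ⟨k, hk, hk0⟩ := exists_coord_ne_zero_of_nodeLevel (hU.1 N hN 3) hW
  have hk' : Adapted (N 0) (φ + 2) := by rw [h0]; exact (floorLetter_node φ (m + 2)).1
  have hk'0 : coord (N 0) (φ + 2) = 0 := by rw [h0]; exact (floorLetter_node φ (m + 2)).2
  have hne : coord (N 3) k ≠ coord (N 0) (φ + 2) := by rw [hk'0]; exact hk0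
  have nob : ∀ P ∈ C.upper, ∀ r : Fin 4, (P 0).1 < (N 0).1 → N 0 = ray (P 0) r ((N 0).1 - (P 0).1) → r = φ :=
    fun P hP r hlt e => below_floorLetter (hU.2 P hP 0) (by omega) (by omega) (h0.symm.trans e)
  rcases hDN N hN 3 0 (by decide) k (φ + 2) hk hk' hne with
    ⟨r, -, P, hP, hZP⟩ | ⟨r, hr, P, hP, hZP⟩ | ⟨a, a', -, ha', P, hP, -, -, -, hc1, hc2⟩
  · have hx : P 3 ≠ (0, 0, 0) := server_ne_origin_of_nodeLevel (by have := hZP.2.1; omega) hZP.2.2 hW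
    exact fullCeilOne_free_P_absent hU hDN hDP hX hGu hh hm ((hZP.1 0 (by decide)).trans h0) ((hZP.1 1 (by decide)).trans h1)
      ((hZP.1 2 (by decide)).trans h2) hx hP
  · exact absurd ((nob P hP r hZP.2.1 hZP.2.2).trans (fin4_add_two_add_two φ).symm) hr
  · have hφ := nob P hP a' hc1 hc2
    rcases ha' with e | ⟨-, hne2⟩
    · exact absurd (e.symm.trans hφ) (fin4_ne_add_two φ).symm
    · exact (hne2 (hφ.trans (fin4_add_two_add_two φ).symm)).elim

/-- **TP31 (half-free slot).** `P{(m+2)·ℓ_φ, 2I + m·ℓ_u, y_2, W} ∉ C.upper` for EVERY `W` of node level `≥ 2` (`y_2 = (h−6)I + 3ℓ_v`) [◇_h, RULE D, X⁺, `S₄` on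
E₊]: up-line service of `y_2` in its node direction (pin = the full letter): above `y_2` sit `y_1`, `cu_v`, `hI`, and the children are TN23, TN21, TN3.  Census:
◇₈ 400 ∕ ◇₁₀ 672 orbits (320 ∕ 656 round 2 `B:DP`, the rest round 1); 152 ∕ 360 untyped before — the `y_2`-frame classes `W ∈ {r_1, s_1, s_2, t_1, t_2, 2jI}`. -/
theorem fullCeilTwo_P_absent {h m : ℤ} {C : MConfig} (hU : C.InDiamond h) (hDN : ∀ Z ∈ C.lower, RuleDMu4N C Z)
    (hDP : ∀ P ∈ C.upper, RuleDMu4P C P) (hX : XPlusClosed C) (hGu : PermClosed C.upper) (hh : h = 2 * m + 4) (hm : 1 ≤ m)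
    {P : MCell} {φ u v : Fin 4} (h0 : P 0 = floorLetter φ (m + 2)) (h1 : P 1 = nodeTwoLetter u m) (h2 : P 2 = ceilLetter h v 2)
    (hW : 2 ≤ nodeLevel (P 3)) : P ∉ C.upper := fun hP => by
  have hna : ¬ isApex (P 2) := by rw [h2]; exact ceilLetter_not_isApex v (by norm_num)
  have hk : Adapted (P 2) (v + 2) := by rw [h2]; exact (ceilLetter_node h v 2).1
  have hkh : coord (P 2) (v + 2) ≠ h := by rw [h2, (ceilLetter_node h v 2).2]; omega
  obtain ⟨N, hN, hNP⟩ := upLine_of_ruleDMu4P hU hP (hDP P hP) (g := 0) (j := 2) (by decide)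
    (by rw [h0]; exact onCeiling_fullLetter hh (by omega) φ) hna hk hkh
  have he0 : 0 < (N 2).1 - (P 2).1 := by have := hNP.2.1; omega
  have e : N 2 = ray (ceilLetter h v 2) (v + 2) ((N 2).1 - (P 2).1) := by rw [← h2]; exact hNP.2.2
  obtain ⟨-, hle, hN2⟩ := above_ceilLetter_offRay (by norm_num) (hU.1 N hN 2) he0 e
  have hN0 : N 0 = floorLetter φ (m + 2) := (hNP.1 0 (by decide)).symm.trans h0
  have hN1 : N 1 = nodeTwoLetter u m := (hNP.1 1 (by decide)).symm.trans h1
  have hN3 : 2 ≤ nodeLevel (N 3) := by rw [← hNP.1 3 (by decide)]; exact hW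
  obtain ⟨k, hk3, hk30⟩ := exists_coord_ne_zero_of_nodeLevel (hU.1 N hN 3) hN3
  rcases (show (N 2).1 - (P 2).1 = 1 ∨ (N 2).1 - (P 2).1 = 2 ∨ (N 2).1 - (P 2).1 = 3 by omega) with e1 | e2 | e3
  · rw [e1, show (2 - 1 : ℤ) = 1 by norm_num] at hN2
    exact fullCeilOne_N_absent hU hDN hDP hX hGu hh hm hN0 hN1 hN2 hN3 hN
  · rw [e2, show (2 - 2 : ℤ) = 0 by norm_num, ceilLetter_zero] at hN2
    exact twinFull_N_absent hU hDN hDP hX hGu hh hm hN0 hN1 hN2 hk3 hk30 hN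
  · rw [e3, show (2 - 3 : ℤ) = -1 by norm_num, ceilLetter_neg_one] at hN2
    exact twinFloor_N_absent_slot3 hU hDN hDP hX hh hm (by omega : (0 : ℤ) ≤ m + 2) hN0 hN1 hN2 hk3 hk30 hN

/-- **TP29 (half-free slot).** `P{(m+2)·ℓ_φ, 2I + m·ℓ_u, s_m, W} ∉ C.upper` for EVERY `W` of node level `≥ 2` (`s_m = (h−4)I + ℓ_w`, top `h − 2`) [◇_h, RULE D,
X⁺, `S₄` on E₊]: up-line service of `s_m` along its ray (pin = the full letter) reaches `y_1` only (`above_subCeilLetter`); the child is TN23.  Census: ◇₈ 400 ∕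
◇₁₀ 672 orbits (320 ∕ 656 round 2 `B:DP`, the rest round 1); 192 ∕ 400 untyped before — the whole `s_m`-frame `W ∈ {r_1, s_1, s_2, s_m, t_1, t_2, 2jI}`. -/
theorem fullSubTop_P_absent {h m : ℤ} {C : MConfig} (hU : C.InDiamond h) (hDN : ∀ Z ∈ C.lower, RuleDMu4N C Z)
    (hDP : ∀ P ∈ C.upper, RuleDMu4P C P) (hX : XPlusClosed C) (hGu : PermClosed C.upper) (hh : h = 2 * m + 4) (hm : 1 ≤ m)
    {P : MCell} {φ u w : Fin 4} (h0 : P 0 = floorLetter φ (m + 2)) (h1 : P 1 = nodeTwoLetter u m) (h2 : P 2 = subCeilLetter m w m)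
    (hW : 2 ≤ nodeLevel (P 3)) : P ∉ C.upper := fun hP => by
  have hna : ¬ isApex (P 2) := by rw [h2]; exact subCeilLetter_not_isApex w (by omega)
  have hk : Adapted (P 2) w := by rw [h2]; exact (subCeilLetter_top m w m).1
  have hkh : coord (P 2) w ≠ h := by rw [h2, (subCeilLetter_top m w m).2]; omega
  obtain ⟨N, hN, hNP⟩ := upLine_of_ruleDMu4P hU hP (hDP P hP) (g := 0) (j := 2) (by decide)
    (by rw [h0]; exact onCeiling_fullLetter hh (by omega) φ) hna hk hkh
  have he0 : 0 < (N 2).1 - (P 2).1 := by have := hNP.2.1; omega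
  have e : N 2 = ray (subCeilLetter m w m) w ((N 2).1 - (P 2).1) := by rw [← h2]; exact hNP.2.2
  have he1 := above_subCeilLetter hh (by omega) he0 (hU.1 N hN 2) e
  have hN2 : N 2 = ceilLetter h w (m + 1 - m) := by rw [e, he1]; exact subCeilLetter_up hh w m
  rw [show (m + 1 - m : ℤ) = 1 by ring] at hN2
  exact fullCeilOne_N_absent hU hDN hDP hX hGu hh hm ((hNP.1 0 (by decide)).symm.trans h0) ((hNP.1 1 (by decide)).symm.trans h1) hN2
    (by rw [← hNP.1 3 (by decide)]; exact hW) hN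

/-! ### §2b The sub-apex `(h−2)·I` beside a ceiling pin: `P{(m+2)ℓ, B, (h−2)I, x}` (every `x ≠ O`), `P{c·ℓ, B, (h−2)I, y_d}` (`c ≥ 0`), `P{c·ℓ, B, (h−2)I, (m+2)ℓ}`,
`N{c·ℓ, B, (h−2)I, y_d}` (`c ≥ 1`) -/

/-- THE SUB-APEX UP-SERVER: a present `P`-cell with a ceiling pin on slot `g` and the sub-apex `(h−2)·I` on slot `j` has a lower neighbour agreeing off `j` with a
ceiling unit `cu_r` on `j` (RULE D on (pin, top `h`) × (`j`, frame `0`, `h − 2`): the pin is served above only along its node ray and admits no cover; one diamond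
step above `(h−2)I` is a unit). -/
theorem subApex_upServer {h : ℤ} {C : MConfig} (hU : C.InDiamond h) {P : MCell} (hP : P ∈ C.upper) (hD : RuleDMu4P C P) {g j : Fin 4}
    (hgj : g ≠ j) (hgc : OnCeiling h (P g)) (hj : P j = (h - 2, 0, 0)) :
    ∃ N ∈ C.lower, ∃ r : Fin 4, (∀ i, i ≠ j → N i = P i) ∧ N j = ceilingUnit h r := by
  obtain ⟨m, hm, hmh⟩ := exists_top_dir hgc (hU.2 P hP g).1
  have hk' : Adapted (P j) 0 := by rw [hj]; simp [Adapted]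
  have hk'c : coord (P j) 0 = h - 2 := by rw [hj]; simp [coord]
  have hne : coord (P g) m ≠ coord (P j) 0 := by rw [hmh, hk'c]; omega
  have above : ∀ N ∈ C.lower, ∀ a : Fin 4, a ≠ m + 2 → (P g).1 < (N g).1 → N g = ray (P g) a ((N g).1 - (P g).1) → False :=
    fun N hN a ha hlt hray =>
      not_inDiamond_above_offnode hgc (hU.2 P hP g).1 hm hmh ha (by omega) hray (hU.1 N hN g).1 (hU.1 N hN g).2.2.2
  rcases hD g j hgj m 0 hm hk' hne with ⟨r, hr, N, hN, hNP⟩ | ⟨r, -, N, hN, hNP⟩ | ⟨a, b, ha, -, N, hN, -, hg1, hg2, -, -⟩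
  · exact (above N hN r hr hNP.2.1 hNP.2.2).elim
  · have he0 : 0 < (N j).1 - (P j).1 := by have := hNP.2.1; omega
    have e : N j = ray ((h - 2, 0, 0) : BPoint) r ((N j).1 - (P j).1) := by rw [← hj]; exact hNP.2.2
    have he1 := above_subApex he0 (hU.1 N hN j) e
    rw [he1] at e
    exact ⟨N, hN, r, fun i hi => (hNP.1 i hi).symm, e⟩
  · have ha' : a ≠ m + 2 := by
      rcases ha with e | ⟨_, hne2⟩
      · rw [e]; exact fin4_ne_add_two m
      · exact hne2
    exact (above N hN a ha' hg1 hg2).elim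

/-- **TP26 (free slot).** `P{(m+2)·ℓ_φ, 2I + m·ℓ_u, (h−2)·I, x} ∉ C.upper` for EVERY `x ≠ O` [◇_h, RULE D, X⁺, `S₄` on E₊]: the sub-apex up-server (pin = the
full letter) gives `N{(m+2)ℓ, B, cu_r, x}` = TN21′.  Subsumes TP10 at `c = m+2`.  Census: ◇₈ 164 ∕ ◇₁₀ 248 orbits (160 ∕ 244 round 2 `B:DP`, 4 ∕ 4 round 1
`P:Xp`); 144 ∕ 228 untyped before — the whole class `P A=FL X=(h−2)I`. -/
theorem fullSubApex_P_absent {h m : ℤ} {C : MConfig} (hU : C.InDiamond h) (hDN : ∀ Z ∈ C.lower, RuleDMu4N C Z)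
    (hDP : ∀ P ∈ C.upper, RuleDMu4P C P) (hX : XPlusClosed C) (hGu : PermClosed C.upper) (hh : h = 2 * m + 4) (hm : 1 ≤ m)
    {P : MCell} {φ u : Fin 4} (h0 : P 0 = floorLetter φ (m + 2)) (h1 : P 1 = nodeTwoLetter u m) (h2 : P 2 = (h - 2, 0, 0))
    (hx : P 3 ≠ (0, 0, 0)) : P ∉ C.upper := fun hP => by
  obtain ⟨N, hN, r, hNP, hN2⟩ := subApex_upServer hU hP (hDP P hP) (g := 0) (j := 2) (by decide)
    (by rw [h0]; exact onCeiling_fullLetter hh (by omega) φ) h2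
  exact twinFull_N_absent' hU hDN hDP hX hGu hh hm ((hNP 0 (by decide)).trans h0) ((hNP 1 (by decide)).trans h1) hN2
    (by rw [hNP 3 (by decide)]; exact hx) hN

/-- **TP27.** `P{c·ℓ_φ, 2I + m·ℓ_u, (h−2)·I, y_d} ∉ C.upper`, `c ≥ 0` (`c = 0`: the letter `O`), `0 ≤ d ≤ m` [◇_h, RULE D, X⁺, `S₄` on E₊]: the sub-apex up-server
(pin = `y_d`) gives `N{c·ℓ, B, cu_r, y_d}` = TN8.  (`d = 0`, `y_0 = cu`: two units over the sub-apex.)  Census: ◇₈ 204 ∕ ◇₁₀ 336 orbits, all round 2 `B:DP`; 136 ∕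
252 untyped before — the classes `P A ∈ {O, ℓ, 2ℓ, …, (m+1)ℓ} X=(h−2)I W=y_d`. -/
theorem floorSubApexCeil_P_absent {h m c d : ℤ} {C : MConfig} (hU : C.InDiamond h) (hDN : ∀ Z ∈ C.lower, RuleDMu4N C Z)
    (hDP : ∀ P ∈ C.upper, RuleDMu4P C P) (hX : XPlusClosed C) (hGu : PermClosed C.upper) (hh : h = 2 * m + 4) (hm : 1 ≤ m) (hc : 0 ≤ c)
    (hd : 0 ≤ d) (hdm : d ≤ m) {P : MCell} {φ u v : Fin 4} (h0 : P 0 = floorLetter φ c) (h1 : P 1 = nodeTwoLetter u m)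
    (h2 : P 2 = (h - 2, 0, 0)) (h3 : P 3 = ceilLetter h v d) : P ∉ C.upper := fun hP => by
  obtain ⟨N, hN, r, hNP, hN2⟩ := subApex_upServer hU hP (hDP P hP) (g := 3) (j := 2) (by decide)
    (by rw [h3]; exact onCeiling_ceilLetter (by omega) v) h2
  exact ceilLetter_N_absent hU hDN hDP hX hGu hh hm hc hd hdm ((hNP 0 (by decide)).trans h0) ((hNP 1 (by decide)).trans h1) hN2
    ((hNP 3 (by decide)).trans h3) hN

/-- **TP27F.** `P{c·ℓ_φ, 2I + m·ℓ_u, (h−2)·I, (m+2)·ℓ_ψ} ∉ C.upper`, `c ≥ 1` [◇_h, RULE D, X⁺]: the sub-apex up-server (pin = the full letter on slot 3) gives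
`N{c·ℓ, B, cu_r, (m+2)ℓ}` = TN6.  Census: ◇₈ 58 ∕ ◇₁₀ 74 orbits, all round 2 `B:DP`, all untyped before except the overlap `c = m+2` with TP26. -/
theorem floorSubApexFull_P_absent {h m c : ℤ} {C : MConfig} (hU : C.InDiamond h) (hDN : ∀ Z ∈ C.lower, RuleDMu4N C Z)
    (hDP : ∀ P ∈ C.upper, RuleDMu4P C P) (hX : XPlusClosed C) (hh : h = 2 * m + 4) (hm : 1 ≤ m) (hc : 1 ≤ c)
    {P : MCell} {φ u ψ : Fin 4} (h0 : P 0 = floorLetter φ c) (h1 : P 1 = nodeTwoLetter u m) (h2 : P 2 = (h - 2, 0, 0))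
    (h3 : P 3 = floorLetter ψ (m + 2)) : P ∉ C.upper := fun hP => by
  obtain ⟨N, hN, r, hNP, hN2⟩ := subApex_upServer hU hP (hDP P hP) (g := 3) (j := 2) (by decide)
    (by rw [h3]; exact onCeiling_fullLetter hh (by omega) ψ) h2
  exact fullFloor_N_absent hU hDN hDP hX hh hm hc ((hNP 0 (by decide)).trans h0) ((hNP 1 (by decide)).trans h1) hN2
    ((hNP 3 (by decide)).trans h3) hN

/-- **TN25.** `N{c·ℓ_φ, 2I + m·ℓ_u, (h−2)·I, y_d} ∉ C.lower`, `c ≥ 1`, `0 ≤ d ≤ m` [◇_h, RULE D, X⁺, `S₄` on E₊]: RULE D on (floor node, `0`) × (NODE frame of `y_d`,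
`h − 2 − 2d ≥ 2`): the floor letter is a pin from below, so `y_d` is served below OFF its ray, i.e. by `y_{d+e}` (`below_ceilLetter_offRay`) — the child `P{c·ℓ, B,
(h−2)I, y_{d+e}}` is TP27 (`d + e ≤ m`) or TP27F (`y_{m+1} = (m+2)ℓ_v`).  The sub-apex is not touched.  (`d = 0`: TN11.)  Census: ◇₈ 192 ∕ ◇₁₀ 320 orbits, all
round 2 `B:DN`; 128 ∕ 240 untyped before — the classes `N A ∈ {ℓ, …, (m+2)ℓ} X=(h−2)I W ∈ {y_1, …, y_m}`. -/
theorem floorSubApexCeil_N_absent {h m c d : ℤ} {C : MConfig} (hU : C.InDiamond h) (hDN : ∀ Z ∈ C.lower, RuleDMu4N C Z)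
    (hDP : ∀ P ∈ C.upper, RuleDMu4P C P) (hX : XPlusClosed C) (hGu : PermClosed C.upper) (hh : h = 2 * m + 4) (hm : 1 ≤ m) (hc : 1 ≤ c)
    (hd : 0 ≤ d) (hdm : d ≤ m) {N : MCell} {φ u v : Fin 4} (h0 : N 0 = floorLetter φ c) (h1 : N 1 = nodeTwoLetter u m)
    (h2 : N 2 = (h - 2, 0, 0)) (h3 : N 3 = ceilLetter h v d) : N ∉ C.lower := fun hN => by
  have hk : Adapted (N 0) (φ + 2) := by rw [h0]; exact (floorLetter_node φ c).1
  have hk0 : coord (N 0) (φ + 2) = 0 := by rw [h0]; exact (floorLetter_node φ c).2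
  have hk' : Adapted (N 3) (v + 2) := by rw [h3]; exact (ceilLetter_node h v d).1
  have hk'c : coord (N 3) (v + 2) = h - 2 - 2 * d := by rw [h3]; exact (ceilLetter_node h v d).2
  have hne : coord (N 0) (φ + 2) ≠ coord (N 3) (v + 2) := by rw [hk0, hk'c]; omega
  have nob : ∀ P ∈ C.upper, ∀ r : Fin 4, (P 0).1 < (N 0).1 → N 0 = ray (P 0) r ((N 0).1 - (P 0).1) → r = φ :=
    fun P hP r hlt e => below_floorLetter (hU.2 P hP 0) (by omega) (by omega) (h0.symm.trans e)
  rcases hDN N hN 0 3 (by decide) (φ + 2) (v + 2) hk hk' hne with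
    ⟨r, hr, P, hP, hZP⟩ | ⟨r, hr, P, hP, hZP⟩ | ⟨a, a', ha, -, P, hP, -, hb1, hb2, -, -⟩
  · exact absurd ((nob P hP r hZP.2.1 hZP.2.2).trans (fin4_add_two_add_two φ).symm) hr
  · have hd0 : 0 < (N 3).1 - (P 3).1 := by have := hZP.2.1; omega
    have e : ceilLetter h v d = ray (P 3) r ((N 3).1 - (P 3).1) := by rw [← h3]; exact hZP.2.2
    have hr' : r ≠ v := fun e' => hr (by rw [e', fin4_add_two_add_two])
    obtain ⟨hP3, hle⟩ := below_ceilLetter_offRay hd (hU.2 P hP 3) hd0 hr' e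
    have hP0 : P 0 = floorLetter φ c := (hZP.1 0 (by decide)).trans h0
    have hP1 : P 1 = nodeTwoLetter u m := (hZP.1 1 (by decide)).trans h1
    have hP2 : P 2 = (h - 2, 0, 0) := (hZP.1 2 (by decide)).trans h2
    by_cases htop : d + ((N 3).1 - (P 3).1) ≤ m
    · exact floorSubApexCeil_P_absent hU hDN hDP hX hGu hh hm (by omega) (d := d + ((N 3).1 - (P 3).1)) (by omega) htop hP0 hP1 hP2 hP3 hP
    · have hdf : d + ((N 3).1 - (P 3).1) = m + 1 := by omega
      rw [hdf, ceilLetter_full hh] at hP3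
      exact floorSubApexFull_P_absent hU hDN hDP hX hh hm hc hP0 hP1 hP2 hP3 hP
  · have hφ := nob P hP a hb1 hb2
    rcases ha with e | ⟨-, hne2⟩
    · exact absurd (e.symm.trans hφ) (fin4_ne_add_two φ).symm
    · exact (hne2 (hφ.trans (fin4_add_two_add_two φ).symm)).elim

/-! ### §2c The sub-full frame: `P{(m+1)ℓ, B, cu, x}` (every `x ≠ O`) → `N{(m+1)ℓ, B, cu, W}` → `P{m·ℓ, B, cu, W}`; `P{(m+1)ℓ, B, y_1, W}` (every `W` of node level ≥ 2) -/

/-- **TP33 (free slot).** `P{(m+1)·ℓ_φ, 2I + m·ℓ_u, cu_χ, x} ∉ C.upper` for EVERY `x ≠ O` [◇_h, RULE D, X⁺, `S₄` on E₊]: up-line service of `(m+1)ℓ` (pin = `cu`)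
reaches the full letter; the child is TN21′.  Subsumes TP8, TP11, TP24 (`c = m+1`).  Census: ◇₈ 632 ∕ ◇₁₀ 968 orbits (524 ∕ 860 round 2 `B:DP`, the rest round
1); 16 ∕ 96 untyped before (`x = 2jI`, …). -/
theorem subFullUnit_free_P_absent {h m : ℤ} {C : MConfig} (hU : C.InDiamond h) (hDN : ∀ Z ∈ C.lower, RuleDMu4N C Z)
    (hDP : ∀ P ∈ C.upper, RuleDMu4P C P) (hX : XPlusClosed C) (hGu : PermClosed C.upper) (hh : h = 2 * m + 4) (hm : 1 ≤ m)
    {P : MCell} {φ u χ : Fin 4} (h0 : P 0 = floorLetter φ (m + 1)) (h1 : P 1 = nodeTwoLetter u m) (h2 : P 2 = ceilingUnit h χ)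
    (hx : P 3 ≠ (0, 0, 0)) : P ∉ C.upper := fun hP => by
  have hna : ¬ isApex (P 0) := by rw [h0]; exact floorLetter_not_isApex φ (by omega)
  have hk : Adapted (P 0) φ := by rw [h0]; exact (floorLetter_top φ (m + 1)).1
  have hkh : coord (P 0) φ ≠ h := by rw [h0, (floorLetter_top φ (m + 1)).2]; omega
  obtain ⟨N, hN, hNP⟩ := upLine_of_ruleDMu4P hU hP (hDP P hP) (g := 2) (j := 0) (by decide)
    (by rw [h2]; exact onCeiling_ceilingUnit h χ) hna hk hkh
  have he0 : 0 < (N 0).1 - (P 0).1 := by have := hNP.2.1; omega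
  have e : N 0 = ray (floorLetter φ (m + 1)) φ ((N 0).1 - (P 0).1) := by rw [← h0]; exact hNP.2.2
  have he1 := above_subFullLetter hh (by omega) he0 (hU.1 N hN 0) e
  have hN0 : N 0 = floorLetter φ (m + 1 + 1) := by rw [e, he1]; exact (ray_add _ φ (m + 1) 1).symm
  rw [show m + 1 + 1 = m + 2 by ring] at hN0
  exact twinFull_N_absent' hU hDN hDP hX hGu hh hm hN0 ((hNP.1 1 (by decide)).symm.trans h1) ((hNP.1 2 (by decide)).symm.trans h2)
    (by rw [← hNP.1 3 (by decide)]; exact hx) hN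

/-- **TN26 (half-free slot).** `N{(m+1)·ℓ_φ, 2I + m·ℓ_u, cu_χ, W} ∉ C.lower` for EVERY `W` of node level `≥ 2` [◇_h, RULE D, X⁺, `S₄` on E₊]: the floor letter is a
pin from below, `W` is served below by some `x′ ≠ O`, and the child is TP33.  Subsumes TN10, TN15, TN20 at `c = m+1`.  Census: ◇₈ 400 ∕ ◇₁₀ 672 orbits (396 ∕ 668
round 2 `B:DN`, 4 ∕ 4 round 1); 32 ∕ 112 untyped before (`W = 2jI`). -/
theorem subFullUnit_N_absent {h m : ℤ} {C : MConfig} (hU : C.InDiamond h) (hDN : ∀ Z ∈ C.lower, RuleDMu4N C Z)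
    (hDP : ∀ P ∈ C.upper, RuleDMu4P C P) (hX : XPlusClosed C) (hGu : PermClosed C.upper) (hh : h = 2 * m + 4) (hm : 1 ≤ m)
    {N : MCell} {φ u χ : Fin 4} (h0 : N 0 = floorLetter φ (m + 1)) (h1 : N 1 = nodeTwoLetter u m) (h2 : N 2 = ceilingUnit h χ)
    (hW : 2 ≤ nodeLevel (N 3)) : N ∉ C.lower := fun hN => by
  obtain ⟨k, hk, hk0⟩ := exists_coord_ne_zero_of_nodeLevel (hU.1 N hN 3) hW
  have hk' : Adapted (N 0) (φ + 2) := by rw [h0]; exact (floorLetter_node φ (m + 1)).1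
  have hk'0 : coord (N 0) (φ + 2) = 0 := by rw [h0]; exact (floorLetter_node φ (m + 1)).2
  have hne : coord (N 3) k ≠ coord (N 0) (φ + 2) := by rw [hk'0]; exact hk0
  have nob : ∀ P ∈ C.upper, ∀ r : Fin 4, (P 0).1 < (N 0).1 → N 0 = ray (P 0) r ((N 0).1 - (P 0).1) → r = φ :=
    fun P hP r hlt e => below_floorLetter (hU.2 P hP 0) (by omega) (by omega) (h0.symm.trans e)
  rcases hDN N hN 3 0 (by decide) k (φ + 2) hk hk' hne with
    ⟨r, -, P, hP, hZP⟩ | ⟨r, hr, P, hP, hZP⟩ | ⟨a, a', -, ha', P, hP, -, -, -, hc1, hc2⟩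
  · have hx : P 3 ≠ (0, 0, 0) := server_ne_origin_of_nodeLevel (by have := hZP.2.1; omega) hZP.2.2 hW
    exact subFullUnit_free_P_absent hU hDN hDP hX hGu hh hm ((hZP.1 0 (by decide)).trans h0) ((hZP.1 1 (by decide)).trans h1)
      ((hZP.1 2 (by decide)).trans h2) hx hP
  · exact absurd ((nob P hP r hZP.2.1 hZP.2.2).trans (fin4_add_two_add_two φ).symm) hr
  · have hφ := nob P hP a' hc1 hc2
    rcases ha' with e | ⟨-, hne2⟩
    · exact absurd (e.symm.trans hφ) (fin4_ne_add_two φ).symm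
    · exact (hne2 (hφ.trans (fin4_add_two_add_two φ).symm)).elim

/-- **TP34 (half-free slot).** `P{m·ℓ_φ, 2I + m·ℓ_u, cu_χ, W} ∉ C.upper` for EVERY `W` of node level `≥ 2` [◇_h, RULE D, X⁺, `S₄` on E₊]: up-line service of `m·ℓ`
(pin = `cu`) reaches `(m+1)ℓ` or the full letter (`above_floorLetter`); the children are TN26 and TN21.  Subsumes TP25.  Census: ◇₈ 400 ∕ ◇₁₀ 672 orbits (296 ∕ 568
round 2 `B:DP`, the rest round 1); 16 ∕ 96 untyped before (`W = 2jI`). -/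
theorem midUnit_P_absent {h m : ℤ} {C : MConfig} (hU : C.InDiamond h) (hDN : ∀ Z ∈ C.lower, RuleDMu4N C Z)
    (hDP : ∀ P ∈ C.upper, RuleDMu4P C P) (hX : XPlusClosed C) (hGu : PermClosed C.upper) (hh : h = 2 * m + 4) (hm : 1 ≤ m)
    {P : MCell} {φ u χ : Fin 4} (h0 : P 0 = floorLetter φ m) (h1 : P 1 = nodeTwoLetter u m) (h2 : P 2 = ceilingUnit h χ)
    (hW : 2 ≤ nodeLevel (P 3)) : P ∉ C.upper := fun hP => by
  have hna : ¬ isApex (P 0) := by rw [h0]; exact floorLetter_not_isApex φ (by omega)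
  have hk : Adapted (P 0) φ := by rw [h0]; exact (floorLetter_top φ m).1
  have hkh : coord (P 0) φ ≠ h := by rw [h0, (floorLetter_top φ m).2]; omega
  obtain ⟨N, hN, hNP⟩ := upLine_of_ruleDMu4P hU hP (hDP P hP) (g := 2) (j := 0) (by decide)
    (by rw [h2]; exact onCeiling_ceilingUnit h χ) hna hk hkh
  have he0 : 0 < (N 0).1 - (P 0).1 := by have := hNP.2.1; omega
  have e : N 0 = ray (floorLetter φ m) φ ((N 0).1 - (P 0).1) := by rw [← h0]; exact hNP.2.2
  have hle := above_floorLetter hh (by omega) he0 (hU.1 N hN 0) e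
  have hN0 : N 0 = floorLetter φ (m + ((N 0).1 - (P 0).1)) := e.trans (ray_add _ φ m _).symm
  have hN1 : N 1 = nodeTwoLetter u m := (hNP.1 1 (by decide)).symm.trans h1
  have hN2 : N 2 = ceilingUnit h χ := (hNP.1 2 (by decide)).symm.trans h2
  have hN3 : 2 ≤ nodeLevel (N 3) := by rw [← hNP.1 3 (by decide)]; exact hW
  rcases (show (N 0).1 - (P 0).1 = 1 ∨ (N 0).1 - (P 0).1 = 2 by omega) with e1 | e2
  · rw [e1] at hN0
    exact subFullUnit_N_absent hU hDN hDP hX hGu hh hm hN0 hN1 hN2 hN3 hN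
  · rw [e2] at hN0
    obtain ⟨k, hk3, hk30⟩ := exists_coord_ne_zero_of_nodeLevel (hU.1 N hN 3) hN3
    exact twinFull_N_absent hU hDN hDP hX hGu hh hm hN0 hN1 hN2 hk3 hk30 hN

/-- **TP32 (half-free slot).** `P{(m+1)·ℓ_φ, 2I + m·ℓ_u, y_1, W} ∉ C.upper` for EVERY `W` of node level `≥ 2` [◇_h, RULE D, X⁺, `S₄` on E₊]: up-line service of
`(m+1)ℓ` (pin = `y_1`) reaches the full letter; the child is TN23.  Subsumes TP17b, TP23.  Census: ◇₈ 400 ∕ ◇₁₀ 672 orbits (384 ∕ 656 round 2 `B:DP`, 16 ∕ 16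
round 1); 48 ∕ 128 untyped before (`W = 2jI`). -/
theorem subFullCeilOne_P_absent {h m : ℤ} {C : MConfig} (hU : C.InDiamond h) (hDN : ∀ Z ∈ C.lower, RuleDMu4N C Z)
    (hDP : ∀ P ∈ C.upper, RuleDMu4P C P) (hX : XPlusClosed C) (hGu : PermClosed C.upper) (hh : h = 2 * m + 4) (hm : 1 ≤ m)
    {P : MCell} {φ u v : Fin 4} (h0 : P 0 = floorLetter φ (m + 1)) (h1 : P 1 = nodeTwoLetter u m) (h2 : P 2 = ceilLetter h v 1)
    (hW : 2 ≤ nodeLevel (P 3)) : P ∉ C.upper := fun hP => by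
  have hna : ¬ isApex (P 0) := by rw [h0]; exact floorLetter_not_isApex φ (by omega)
  have hk : Adapted (P 0) φ := by rw [h0]; exact (floorLetter_top φ (m + 1)).1
  have hkh : coord (P 0) φ ≠ h := by rw [h0, (floorLetter_top φ (m + 1)).2]; omega
  obtain ⟨N, hN, hNP⟩ := upLine_of_ruleDMu4P hU hP (hDP P hP) (g := 2) (j := 0) (by decide)
    (by rw [h2]; exact onCeiling_ceilLetter (by norm_num) v) hna hk hkh
  have he0 : 0 < (N 0).1 - (P 0).1 := by have := hNP.2.1; omega
  have e : N 0 = ray (floorLetter φ (m + 1)) φ ((N 0).1 - (P 0).1) := by rw [← h0]; exact hNP.2.2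
  have he1 := above_subFullLetter hh (by omega) he0 (hU.1 N hN 0) e
  have hN0 : N 0 = floorLetter φ (m + 1 + 1) := by rw [e, he1]; exact (ray_add _ φ (m + 1) 1).symm
  rw [show m + 1 + 1 = m + 2 by ring] at hN0
  exact fullCeilOne_N_absent hU hDN hDP hX hGu hh hm hN0 ((hNP.1 1 (by decide)).symm.trans h1) ((hNP.1 2 (by decide)).symm.trans h2)
    (by rw [← hNP.1 3 (by decide)]; exact hW) hN

/-! ### §2d ◇₁₀ census representatives of §2 (j318002 ◇₁₀ peel table 74004db439790926; every one peel ROUND 2, untyped before this file) -/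

/-- ◇₁₀ `N[2I|5l-1|2I+3l-1|8I+l-1]` (an apex letter in the free slot; census var of the orbit: see memo §2; ROUND 2, `B:DN`): TN21. -/
def repTN21 : MCell := ![(5, -5, 0), (5, -3, 0), (9, -1, 0), (2, 0, 0)]
theorem repTN21_absent {C : MConfig} (hU : C.InDiamond 10) (hG : C.G1Closed) (hS : C.StaticH1) : repTN21 ∉ C.lower :=
  twinFull_N_absent' hU hS.1.1 hS.1.2 hS.2.1 hG.2.1 (m := 3) (by norm_num) (by norm_num)
    (φ := 2) (u := 2) (χ := 2) (by simp [repTN21, ray]) (by simp [repTN21, ray]) (by simp [repTN21, ray]) (by simp [repTN21])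

/-- ◇₁₀ `P[4I|5l-1|2I+3l-1|6I+2l-1]` (ROUND 2, `B:DP`): TP30. -/
def repTP30 : MCell := ![(5, -5, 0), (5, -3, 0), (8, -2, 0), (4, 0, 0)]
theorem repTP30_absent {C : MConfig} (hU : C.InDiamond 10) (hG : C.G1Closed) (hS : C.StaticH1) : repTP30 ∉ C.upper :=
  fullCeilOne_free_P_absent hU hS.1.1 hS.1.2 hS.2.1 hG.2.1 (m := 3) (by norm_num) (by norm_num)
    (φ := 2) (u := 2) (v := 2) (by simp [repTP30, ray]) (by simp [repTP30, ray]) (by simp [repTP30, ray]) (by simp [repTP30])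

/-- ◇₁₀ `N[4I|5l-1|2I+3l-1|6I+2l-1]` (ROUND 2, `B:DN`): TN23. -/
theorem repTN23_absent {C : MConfig} (hU : C.InDiamond 10) (hG : C.G1Closed) (hS : C.StaticH1) : repTP30 ∉ C.lower :=
  fullCeilOne_N_absent hU hS.1.1 hS.1.2 hS.2.1 hG.2.1 (m := 3) (by norm_num) (by norm_num)
    (φ := 2) (u := 2) (v := 2) (by simp [repTP30, ray]) (by simp [repTP30, ray]) (by simp [repTP30, ray]) (by simp [repTP30, nodeLevel, absCharge, chargeOf])

/-- ◇₁₀ `P[5l-1|2I+3l-1|4I+3l-1|2I+l-1]` (`W = r_1`; ROUND 2, `B:DP`): TP31. -/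
def repTP31 : MCell := ![(5, -5, 0), (5, -3, 0), (7, -3, 0), (3, -1, 0)]
theorem repTP31_absent {C : MConfig} (hU : C.InDiamond 10) (hG : C.G1Closed) (hS : C.StaticH1) : repTP31 ∉ C.upper :=
  fullCeilTwo_P_absent hU hS.1.1 hS.1.2 hS.2.1 hG.2.1 (m := 3) (by norm_num) (by norm_num)
    (φ := 2) (u := 2) (v := 2) (by simp [repTP31, ray]) (by simp [repTP31, ray]) (by simp [repTP31, ray]) (by simp [repTP31, nodeLevel, absCharge, chargeOf])

/-- ◇₁₀ `P[5l-1|2I+3l-1|6I+l-1|2I+l-1]` (`W = r_1`; ROUND 2, `B:DP`): TP29. -/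
def repTP29 : MCell := ![(5, -5, 0), (5, -3, 0), (7, -1, 0), (3, -1, 0)]
theorem repTP29_absent {C : MConfig} (hU : C.InDiamond 10) (hG : C.G1Closed) (hS : C.StaticH1) : repTP29 ∉ C.upper :=
  fullSubTop_P_absent hU hS.1.1 hS.1.2 hS.2.1 hG.2.1 (m := 3) (by norm_num) (by norm_num)
    (φ := 2) (u := 2) (w := 2) (by simp [repTP29, ray]) (by simp [repTP29, ray]) (by simp [repTP29, ray]) (by simp [repTP29, nodeLevel, absCharge, chargeOf])

/-- ◇₁₀ `P[2I|5l-1|2I+3l-1|8I]` (ROUND 2, `B:DP`): TP26. -/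
def repTP26 : MCell := ![(5, -5, 0), (5, -3, 0), (8, 0, 0), (2, 0, 0)]
theorem repTP26_absent {C : MConfig} (hU : C.InDiamond 10) (hG : C.G1Closed) (hS : C.StaticH1) : repTP26 ∉ C.upper :=
  fullSubApex_P_absent hU hS.1.1 hS.1.2 hS.2.1 hG.2.1 (m := 3) (by norm_num) (by norm_num)
    (φ := 2) (u := 2) (by simp [repTP26, ray]) (by simp [repTP26, ray]) (by simp [repTP26]) (by simp [repTP26])

/-- ◇₁₀ `P[l-1|2I+3l-1|6I+2l-1|8I]` (ROUND 2, `B:DP`): TP27 (`c = 1`, `d = 1`). -/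
def repTP27 : MCell := ![(1, -1, 0), (5, -3, 0), (8, 0, 0), (8, -2, 0)]
theorem repTP27_absent {C : MConfig} (hU : C.InDiamond 10) (hG : C.G1Closed) (hS : C.StaticH1) : repTP27 ∉ C.upper :=
  floorSubApexCeil_P_absent hU hS.1.1 hS.1.2 hS.2.1 hG.2.1 (m := 3) (c := 1) (d := 1) (by norm_num) (by norm_num) (by norm_num) (by norm_num)
    (by norm_num) (φ := 2) (u := 2) (v := 2) (by simp [repTP27, ray]) (by simp [repTP27, ray]) (by simp [repTP27]) (by simp [repTP27, ray])

/-- ◇₁₀ `N[l-1|2I+3l-1|6I+2l-1|8I]` (ROUND 2, `B:DN`): TN25 (`c = 1`, `d = 1`). -/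
theorem repTN25_absent {C : MConfig} (hU : C.InDiamond 10) (hG : C.G1Closed) (hS : C.StaticH1) : repTP27 ∉ C.lower :=
  floorSubApexCeil_N_absent hU hS.1.1 hS.1.2 hS.2.1 hG.2.1 (m := 3) (c := 1) (d := 1) (by norm_num) (by norm_num) (by norm_num) (by norm_num)
    (by norm_num) (φ := 2) (u := 2) (v := 2) (by simp [repTP27, ray]) (by simp [repTP27, ray]) (by simp [repTP27]) (by simp [repTP27, ray])

/-- ◇₁₀ `P[l-1|2I+3l-1|8I|5l-1]` (ROUND 2, `B:DP`): TP27F (`c = 1`). -/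
def repTP27F : MCell := ![(1, -1, 0), (5, -3, 0), (8, 0, 0), (5, -5, 0)]
theorem repTP27F_absent {C : MConfig} (hU : C.InDiamond 10) (hS : C.StaticH1) : repTP27F ∉ C.upper :=
  floorSubApexFull_P_absent hU hS.1.1 hS.1.2 hS.2.1 (m := 3) (c := 1) (by norm_num) (by norm_num) (by norm_num)
    (φ := 2) (u := 2) (ψ := 2) (by simp [repTP27F, ray]) (by simp [repTP27F, ray]) (by simp [repTP27F]) (by simp [repTP27F, ray])

/-- ◇₁₀ `P[2I|4l-1|2I+3l-1|8I+l-1]` (ROUND 2, `B:DP`): TP33. -/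
def repTP33 : MCell := ![(4, -4, 0), (5, -3, 0), (9, -1, 0), (2, 0, 0)]
theorem repTP33_absent {C : MConfig} (hU : C.InDiamond 10) (hG : C.G1Closed) (hS : C.StaticH1) : repTP33 ∉ C.upper :=
  subFullUnit_free_P_absent hU hS.1.1 hS.1.2 hS.2.1 hG.2.1 (m := 3) (by norm_num) (by norm_num)
    (φ := 2) (u := 2) (χ := 2) (by simp [repTP33, ray]) (by simp [repTP33, ray]) (by simp [repTP33, ray]) (by simp [repTP33])

/-- ◇₁₀ `N[2I|4l-1|2I+3l-1|8I+l-1]` (ROUND 2, `B:DN`): TN26. -/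
theorem repTN26_absent {C : MConfig} (hU : C.InDiamond 10) (hG : C.G1Closed) (hS : C.StaticH1) : repTP33 ∉ C.lower :=
  subFullUnit_N_absent hU hS.1.1 hS.1.2 hS.2.1 hG.2.1 (m := 3) (by norm_num) (by norm_num)
    (φ := 2) (u := 2) (χ := 2) (by simp [repTP33, ray]) (by simp [repTP33, ray]) (by simp [repTP33, ray]) (by simp [repTP33, nodeLevel, absCharge, chargeOf])

/-- ◇₁₀ `P[2I|3l-1|2I+3l-1|8I+l-1]` (ROUND 2, `B:DP`): TP34. -/
def repTP34 : MCell := ![(3, -3, 0), (5, -3, 0), (9, -1, 0), (2, 0, 0)]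
theorem repTP34_absent {C : MConfig} (hU : C.InDiamond 10) (hG : C.G1Closed) (hS : C.StaticH1) : repTP34 ∉ C.upper :=
  midUnit_P_absent hU hS.1.1 hS.1.2 hS.2.1 hG.2.1 (m := 3) (by norm_num) (by norm_num)
    (φ := 2) (u := 2) (χ := 2) (by simp [repTP34, ray]) (by simp [repTP34, ray]) (by simp [repTP34, ray]) (by simp [repTP34, nodeLevel, absCharge, chargeOf])

/-- ◇₁₀ `P[2I|4l-1|2I+3l-1|6I+2l-1]` (ROUND 2, `B:DP`): TP32. -/
def repTP32 : MCell := ![(4, -4, 0), (5, -3, 0), (8, -2, 0), (2, 0, 0)]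
theorem repTP32_absent {C : MConfig} (hU : C.InDiamond 10) (hG : C.G1Closed) (hS : C.StaticH1) : repTP32 ∉ C.upper :=
  subFullCeilOne_P_absent hU hS.1.1 hS.1.2 hS.2.1 hG.2.1 (m := 3) (by norm_num) (by norm_num)
    (φ := 2) (u := 2) (v := 2) (by simp [repTP32, ray]) (by simp [repTP32, ray]) (by simp [repTP32, ray]) (by simp [repTP32, nodeLevel, absCharge, chargeOf])


/-! ## §3 The UNIT-PAIR base `{ℓ_φ, cu_χ, cu_χ'}` (`χ' ≠ χ`) completed on the `N`-side, and the sub-apex `(h−2)·I` lifted over it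
(control g21; all KERNEL, every `h : ℤ` — no `h = 2m+4` needed except TN27 ∕ WP1 —, law-free: ◇_h, RULE D, X⁺, `S₄` on E₊).  Roots: the pair forks
A1 `pairFork_nodeTwo_absent`, A2 `pairFork_floorUnit_absent` and TN2 `unitNodeTwo_pair_N_absent` of `CeilingFork`∕`CeilingPair` (restated in §0).
Mechanism as in §2: the floor unit `ℓ_φ` is a pin from below (`servedBelow_of_floorLetter`), a ceiling unit a pin from above
(`upLine_of_ruleDMu4P`, `subApex_upServer'`), and the moving letter runs along ONE line: a floor letter down its ray, a node-4 letter
`4I + n·ℓ_u` down its node line (`2I + (n+1)ℓ_u`, then `(n+2)ℓ_u`), the sub-apex `(h−2)I` up to a ceiling unit `cu_r` with `r ≠ χ`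
(frame `χ+2`), the sub-top letter `s_m` up its node line (`(h−2)I`, then `cu_{w+2}`).  Families UN1 UN2 · UP1 UP2 UP3 · VN1 VN3 · TN27 ·
WP1a WP1c WP2; census (`tools/famM.py 8 10`, memo §3): every member peel round ≤ 2, 0 survivors; ◇₁₀ 1 040 member orbits (1 024 round 2,
16 round 1), 876 untyped by all earlier kernel families; ◇₈ 712 (564 new). -/

/-- below a floor letter along its own ray sit the shorter floor letters (and `O`). -/
theorem floorLetter_downRay {h c d : ℤ} {z : BPoint} {ψ : Fin 4} (hz : InDiamond h z)
    (heq : floorLetter ψ c = ray z ψ d) : 0 ≤ c - d ∧ z = floorLetter ψ (c - d) := by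
  obtain ⟨α, a, b⟩ := z
  obtain ⟨hax, h1, -, -⟩ := hz
  simp only [AxisPt, absCharge, chargeOf, ray, Prod.mk.injEq] at hax h1 heq ⊢
  fin_cases ψ <;> simp at hax h1 heq ⊢ <;>
    (simp only [abs_eq_max_neg, max_def] at h1; split_ifs at h1 <;> omega)

/-- below the node-4 letter `4I + n·ℓ_u` in its node direction `u+2` sit exactly `2I + (n+1)·ℓ_u` and `(n+2)·ℓ_u`. -/
theorem nodeFourLine_downRay {h n d : ℤ} {z : BPoint} {u : Fin 4} (hn : 0 ≤ n) (hz : InDiamond h z) (hd : 0 < d)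
    (heq : ray ((4, 0, 0) : BPoint) u n = ray z (u + 2) d) : z = nodeTwoLetter u (n + 1) ∨ z = floorLetter u (n + 2) := by
  obtain ⟨α, a, b⟩ := z
  obtain ⟨hax, h1, -, -⟩ := hz
  simp only [AxisPt, absCharge, chargeOf, ray, Prod.mk.injEq] at hax h1 heq ⊢
  fin_cases u <;> simp at hax h1 heq ⊢ <;>
    (simp only [abs_eq_max_neg, max_def] at h1; split_ifs at h1 <;> omega)

theorem nodeFourLine_not_isApex (u : Fin 4) {n : ℤ} (hn : n ≠ 0) : ¬ isApex (ray ((4, 0, 0) : BPoint) u n) := by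
  fin_cases u <;> simp [isApex] <;> omega

/-- **UN1.** `N{ℓ_φ, c·ℓ_ψ, cu_χ, cu_χ'} ∉ C.lower` (`c ≥ 1`, `χ' ≠ χ`; ALL `φ, ψ`) [◇_h, RULE D, X⁺, `S₄` on E₊; every `h`]: the floor engine at the pin `ℓ_φ`
serves `c·ℓ_ψ` below along its ray — the children `P{ℓ_φ, c'·ℓ_ψ, cu_χ, cu_χ'}` (`0 ≤ c' < c`) are the pair fork A2.  (`c = 1` is B3 without `Δ`.)
Census: ◇₈ 88 ∕ ◇₁₀ 112 orbits (16 round 1 `P:Xp`, the rest round 2 `B:DN`), 72 ∕ 96 untyped before. -/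
theorem unitPairFloor_N_absent {h c : ℤ} {C : MConfig} (hU : C.InDiamond h) (hDN : ∀ Z ∈ C.lower, RuleDMu4N C Z)
    (hDP : ∀ P ∈ C.upper, RuleDMu4P C P) (hX : XPlusClosed C) (hGu : PermClosed C.upper) (hc : 1 ≤ c) {N : MCell}
    {φ ψ χ χ' : Fin 4} (hχ : χ' ≠ χ) (h0 : N 0 = floorUnit φ) (h1 : N 1 = floorLetter ψ c) (h2 : N 2 = ceilingUnit h χ)
    (h3 : N 3 = ceilingUnit h χ') : N ∉ C.lower := fun hN => by
  have hfl : OnFloor (N 0) := onFloor_of_coord_zero (hU.1 N hN 0) (k := φ + 2) (by rw [h0]; exact (floorLetter_node φ 1).2)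
  have hna : ¬ isApex (N 1) := by rw [h1]; exact floorLetter_not_isApex ψ (by omega)
  have hk : Adapted (N 1) ψ := by rw [h1]; exact (floorLetter_top ψ c).1
  have hk0 : coord (N 1) ψ ≠ 0 := by rw [h1, (floorLetter_top ψ c).2]; omega
  obtain ⟨P, hP, hZP⟩ := servedBelow_of_floorLetter hU hN (hDN N hN) (i := 0) (g := 1) (by decide) hfl hna hk hk0
  obtain ⟨hc', hP1⟩ := floorLetter_downRay (hU.2 P hP 1) (h1.symm.trans hZP.2.2)
  exact pairFork_floorUnit_absent hU hDN hDP hX hGu hc' hχ ((hZP.1 0 (by decide)).trans h0) hP1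
    ((hZP.1 2 (by decide)).trans h2) ((hZP.1 3 (by decide)).trans h3) hP

/-- **UN2.** `N{ℓ_φ, 4I + n·ℓ_u, cu_χ, cu_χ'} ∉ C.lower` (`n ≥ 1`, `χ' ≠ χ`; the node-4 line `t_2, s_2, y_2, …` of ◇_h, up to the ceiling) [same
hypotheses; every `h`]: the floor engine serves `4I + nℓ_u` below in its node direction — the children are A1 (`2I + (n+1)ℓ_u`) and A2 (`(n+2)ℓ_u`).
Census: ◇₈ 48 ∕ ◇₁₀ 72 orbits, all round 2 `B:DN`, all untyped before. -/
theorem unitPairNodeFour_N_absent {h n : ℤ} {C : MConfig} (hU : C.InDiamond h) (hDN : ∀ Z ∈ C.lower, RuleDMu4N C Z)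
    (hDP : ∀ P ∈ C.upper, RuleDMu4P C P) (hX : XPlusClosed C) (hGu : PermClosed C.upper) (hn : 1 ≤ n) {N : MCell}
    {φ u χ χ' : Fin 4} (hχ : χ' ≠ χ) (h0 : N 0 = floorUnit φ) (h1 : N 1 = ray ((4, 0, 0) : BPoint) u n)
    (h2 : N 2 = ceilingUnit h χ) (h3 : N 3 = ceilingUnit h χ') : N ∉ C.lower := fun hN => by
  have hfl : OnFloor (N 0) := onFloor_of_coord_zero (hU.1 N hN 0) (k := φ + 2) (by rw [h0]; exact (floorLetter_node φ 1).2)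
  have hna : ¬ isApex (N 1) := by rw [h1]; exact nodeFourLine_not_isApex u (by omega)
  have hk : Adapted (N 1) (u + 2) := by rw [h1]; exact (adapted_ray_apex 4 u n).2
  have hk0 : coord (N 1) (u + 2) ≠ 0 := by rw [h1, coord_ray_apex_antip]; norm_num
  obtain ⟨P, hP, hZP⟩ := servedBelow_of_floorLetter hU hN (hDN N hN) (i := 0) (g := 1) (by decide) hfl hna hk hk0
  have hP0 : P 0 = floorUnit φ := (hZP.1 0 (by decide)).trans h0
  have hP2 : P 2 = ceilingUnit h χ := (hZP.1 2 (by decide)).trans h2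
  have hP3 : P 3 = ceilingUnit h χ' := (hZP.1 3 (by decide)).trans h3
  rcases nodeFourLine_downRay (by omega) (hU.2 P hP 1) (by have := hZP.2.1; omega) (h1.symm.trans hZP.2.2) with hP1 | hP1
  · exact pairFork_nodeTwo_absent hU hDN hDP hX hGu (by norm_num : (0 : ℤ) ≤ 1) (by omega : 1 ≤ n + 1) hχ hP0 hP1 hP2 hP3 hP
  · exact pairFork_floorUnit_absent hU hDN hDP hX hGu (by omega : (0 : ℤ) ≤ n + 2) hχ hP0 hP1 hP2 hP3 hP

/-- the sub-apex up-server of §2 with the frame of `(h−2)I` as a parameter: the serving ceiling unit `cu_r` has `r ≠ k' + 2`. -/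
theorem subApex_upServer' {h : ℤ} {C : MConfig} (hU : C.InDiamond h) {P : MCell} (hP : P ∈ C.upper) (hD : RuleDMu4P C P) {g j : Fin 4}
    (hgj : g ≠ j) (hgc : OnCeiling h (P g)) (hj : P j = (h - 2, 0, 0)) (k' : Fin 4) :
    ∃ N ∈ C.lower, ∃ r : Fin 4, r ≠ k' + 2 ∧ (∀ i, i ≠ j → N i = P i) ∧ N j = ceilingUnit h r := by
  obtain ⟨m, hm, hmh⟩ := exists_top_dir hgc (hU.2 P hP g).1
  have hk' : Adapted (P j) k' := by rw [hj]; fin_cases k' <;> simp [Adapted]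
  have hk'c : coord (P j) k' = h - 2 := by rw [hj]; exact coord_of_isApex ⟨rfl, rfl⟩ k'
  have hne : coord (P g) m ≠ coord (P j) k' := by rw [hmh, hk'c]; omega
  have above : ∀ N ∈ C.lower, ∀ a : Fin 4, a ≠ m + 2 → (P g).1 < (N g).1 → N g = ray (P g) a ((N g).1 - (P g).1) → False :=
    fun N hN a ha hlt hray =>
      not_inDiamond_above_offnode hgc (hU.2 P hP g).1 hm hmh ha (by omega) hray (hU.1 N hN g).1 (hU.1 N hN g).2.2.2
  rcases hD g j hgj m k' hm hk' hne with ⟨r, hr, N, hN, hNP⟩ | ⟨r, hr, N, hN, hNP⟩ | ⟨a, b, ha, -, N, hN, -, hg1, hg2, -, -⟩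
  · exact (above N hN r hr hNP.2.1 hNP.2.2).elim
  · have he0 : 0 < (N j).1 - (P j).1 := by have := hNP.2.1; omega
    have e : N j = ray ((h - 2, 0, 0) : BPoint) r ((N j).1 - (P j).1) := by rw [← hj]; exact hNP.2.2
    have he1 := above_subApex he0 (hU.1 N hN j) e
    rw [he1] at e
    exact ⟨N, hN, r, hr, fun i hi => (hNP.1 i hi).symm, e⟩
  · have ha' : a ≠ m + 2 := by
      rcases ha with e | ⟨_, hne2⟩
      · rw [e]; exact fin4_ne_add_two m
      · exact hne2
    exact (above N hN a ha' hg1 hg2).elim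

/-- **UP1.** `P{ℓ_φ, 2I + n·ℓ_u, (h−2)·I, cu_χ} ∉ C.upper` (`n ≥ 1`) [◇_h, RULE D, X⁺, `S₄` on E₊; every `h`]: the sub-apex up-server in the frame `χ+2`
(pin `cu_χ`) gives `N{ℓ_φ, 2I + nℓ_u, cu_r, cu_χ}` with `r ≠ χ` = TN2.  Census: ◇₈ 48 ∕ ◇₁₀ 64 orbits (round 2 `B:DP`), 32 ∕ 48 untyped before. -/
theorem unitNodeTwoSubApex_P_absent {h n : ℤ} {C : MConfig} (hU : C.InDiamond h) (hDN : ∀ Z ∈ C.lower, RuleDMu4N C Z)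
    (hDP : ∀ P ∈ C.upper, RuleDMu4P C P) (hX : XPlusClosed C) (hGu : PermClosed C.upper) (hn : 1 ≤ n) {P : MCell}
    {φ u χ : Fin 4} (h0 : P 0 = floorUnit φ) (h1 : P 1 = nodeTwoLetter u n) (h2 : P 2 = (h - 2, 0, 0))
    (h3 : P 3 = ceilingUnit h χ) : P ∉ C.upper := fun hP => by
  obtain ⟨N, hN, r, hr, hNP, hN2⟩ := subApex_upServer' hU hP (hDP P hP) (g := 3) (j := 2) (by decide)
    (by rw [h3]; exact onCeiling_ceilingUnit h χ) h2 (χ + 2)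
  have hrχ : χ ≠ r := by rintro rfl; exact hr (fin4_add_two_add_two χ).symm
  exact unitNodeTwo_pair_N_absent hU hDN hDP hX hGu hn hrχ ((hNP 0 (by decide)).trans h0) ((hNP 1 (by decide)).trans h1)
    hN2 ((hNP 3 (by decide)).trans h3) hN

/-- **UP2.** `P{ℓ_φ, c·ℓ_ψ, (h−2)·I, cu_χ} ∉ C.upper` (`c ≥ 1`; ALL `φ, ψ`) [same; every `h`]: the sub-apex up-server gives UN1.  Census: ◇₈ 58 ∕ ◇₁₀ 74
orbits (round 2 `B:DP`), all untyped before. -/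
theorem unitFloorSubApex_P_absent {h c : ℤ} {C : MConfig} (hU : C.InDiamond h) (hDN : ∀ Z ∈ C.lower, RuleDMu4N C Z)
    (hDP : ∀ P ∈ C.upper, RuleDMu4P C P) (hX : XPlusClosed C) (hGu : PermClosed C.upper) (hc : 1 ≤ c) {P : MCell}
    {φ ψ χ : Fin 4} (h0 : P 0 = floorUnit φ) (h1 : P 1 = floorLetter ψ c) (h2 : P 2 = (h - 2, 0, 0))
    (h3 : P 3 = ceilingUnit h χ) : P ∉ C.upper := fun hP => by
  obtain ⟨N, hN, r, hr, hNP, hN2⟩ := subApex_upServer' hU hP (hDP P hP) (g := 3) (j := 2) (by decide)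
    (by rw [h3]; exact onCeiling_ceilingUnit h χ) h2 (χ + 2)
  have hrχ : χ ≠ r := by rintro rfl; exact hr (fin4_add_two_add_two χ).symm
  exact unitPairFloor_N_absent hU hDN hDP hX hGu hc hrχ ((hNP 0 (by decide)).trans h0) ((hNP 1 (by decide)).trans h1)
    hN2 ((hNP 3 (by decide)).trans h3) hN

/-- **UP3.** `P{ℓ_φ, 4I + n·ℓ_u, (h−2)·I, cu_χ} ∉ C.upper` (`n ≥ 1`) [same; every `h`]: the sub-apex up-server gives UN2.  Census: ◇₈ 32 ∕ ◇₁₀ 48 orbits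
(round 2 `B:DP`), all untyped before. -/
theorem unitNodeFourSubApex_P_absent {h n : ℤ} {C : MConfig} (hU : C.InDiamond h) (hDN : ∀ Z ∈ C.lower, RuleDMu4N C Z)
    (hDP : ∀ P ∈ C.upper, RuleDMu4P C P) (hX : XPlusClosed C) (hGu : PermClosed C.upper) (hn : 1 ≤ n) {P : MCell}
    {φ u χ : Fin 4} (h0 : P 0 = floorUnit φ) (h1 : P 1 = ray ((4, 0, 0) : BPoint) u n) (h2 : P 2 = (h - 2, 0, 0))
    (h3 : P 3 = ceilingUnit h χ) : P ∉ C.upper := fun hP => by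
  obtain ⟨N, hN, r, hr, hNP, hN2⟩ := subApex_upServer' hU hP (hDP P hP) (g := 3) (j := 2) (by decide)
    (by rw [h3]; exact onCeiling_ceilingUnit h χ) h2 (χ + 2)
  have hrχ : χ ≠ r := by rintro rfl; exact hr (fin4_add_two_add_two χ).symm
  exact unitPairNodeFour_N_absent hU hDN hDP hX hGu hn hrχ ((hNP 0 (by decide)).trans h0) ((hNP 1 (by decide)).trans h1)
    hN2 ((hNP 3 (by decide)).trans h3) hN

/-- **VN1.** `N{ℓ_φ, 2I + n·ℓ_u, (h−2)·I, cu_χ} ∉ C.lower` (`n ≥ 1`) [same; every `h`]: the floor engine serves `2I + nℓ_u` below in its node direction —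
the only child is `P{ℓ_φ, (n+1)ℓ_u, (h−2)I, cu_χ}` = UP2.  Census: ◇₈ 48 ∕ ◇₁₀ 64 orbits (round 2 `B:DN`), 32 ∕ 48 untyped before. -/
theorem unitNodeTwoSubApex_N_absent {h n : ℤ} {C : MConfig} (hU : C.InDiamond h) (hDN : ∀ Z ∈ C.lower, RuleDMu4N C Z)
    (hDP : ∀ P ∈ C.upper, RuleDMu4P C P) (hX : XPlusClosed C) (hGu : PermClosed C.upper) (hn : 1 ≤ n) {N : MCell}
    {φ u χ : Fin 4} (h0 : N 0 = floorUnit φ) (h1 : N 1 = nodeTwoLetter u n) (h2 : N 2 = (h - 2, 0, 0))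
    (h3 : N 3 = ceilingUnit h χ) : N ∉ C.lower := fun hN => by
  obtain ⟨P, hP, hNP, hP1⟩ := descent_of_floorNode_nodeTwo hU (by norm_num : (0 : ℤ) ≤ 1) hn (hDN N hN) (b := 0) (c := 1)
    (by decide) h0 h1
  exact unitFloorSubApex_P_absent hU hDN hDP hX hGu (by omega : 1 ≤ n + 1) ((hNP.1 0 (by decide)).trans h0) hP1
    ((hNP.1 2 (by decide)).trans h2) ((hNP.1 3 (by decide)).trans h3) hP

/-- **VN3.** `N{ℓ_φ, 4I + n·ℓ_u, (h−2)·I, cu_χ} ∉ C.lower` (`n ≥ 1`) [same; every `h`]: the floor engine serves the node-4 letter below in its node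
direction — children UP1 (`2I + (n+1)ℓ_u`) and UP2 (`(n+2)ℓ_u`).  Census: ◇₈ 32 ∕ ◇₁₀ 48 orbits (round 2 `B:DN`), all untyped before. -/
theorem unitNodeFourSubApex_N_absent {h n : ℤ} {C : MConfig} (hU : C.InDiamond h) (hDN : ∀ Z ∈ C.lower, RuleDMu4N C Z)
    (hDP : ∀ P ∈ C.upper, RuleDMu4P C P) (hX : XPlusClosed C) (hGu : PermClosed C.upper) (hn : 1 ≤ n) {N : MCell}
    {φ u χ : Fin 4} (h0 : N 0 = floorUnit φ) (h1 : N 1 = ray ((4, 0, 0) : BPoint) u n) (h2 : N 2 = (h - 2, 0, 0))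
    (h3 : N 3 = ceilingUnit h χ) : N ∉ C.lower := fun hN => by
  have hfl : OnFloor (N 0) := onFloor_of_coord_zero (hU.1 N hN 0) (k := φ + 2) (by rw [h0]; exact (floorLetter_node φ 1).2)
  have hna : ¬ isApex (N 1) := by rw [h1]; exact nodeFourLine_not_isApex u (by omega)
  have hk : Adapted (N 1) (u + 2) := by rw [h1]; exact (adapted_ray_apex 4 u n).2
  have hk0 : coord (N 1) (u + 2) ≠ 0 := by rw [h1, coord_ray_apex_antip]; norm_num
  obtain ⟨P, hP, hZP⟩ := servedBelow_of_floorLetter hU hN (hDN N hN) (i := 0) (g := 1) (by decide) hfl hna hk hk0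
  have hP0 : P 0 = floorUnit φ := (hZP.1 0 (by decide)).trans h0
  have hP2 : P 2 = (h - 2, 0, 0) := (hZP.1 2 (by decide)).trans h2
  have hP3 : P 3 = ceilingUnit h χ := (hZP.1 3 (by decide)).trans h3
  rcases nodeFourLine_downRay (by omega) (hU.2 P hP 1) (by have := hZP.2.1; omega) (h1.symm.trans hZP.2.2) with hP1 | hP1
  · exact unitNodeTwoSubApex_P_absent hU hDN hDP hX hGu (by omega : 1 ≤ n + 1) hP0 hP1 hP2 hP3 hP
  · exact unitFloorSubApex_P_absent hU hDN hDP hX hGu (by omega : 1 ≤ n + 2) hP0 hP1 hP2 hP3 hP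

/-- **TN27 (half-free slot).** `N{(m+2)·ℓ_φ, 2I + m·ℓ_u, (h−2)·I, W} ∉ C.lower` for EVERY `W` of node level `≥ 2` [◇_h, RULE D, X⁺, `S₄` on E₊]: `W` is
served below by a letter `x ≠ O` (pin = the full letter) and `P{(m+2)ℓ, B, (h−2)I, x}` is TP26.  Census: ◇₈ 106 ∕ ◇₁₀ 174 orbits (round 2 `B:DN`),
54 ∕ 106 untyped before — the classes `N{FL, B, (h−2)I, W}`, `W ∈ {s_k, t_k, r_k, 2jI, B, (h−2)I}`; closes the twin-fork base with a floor letter. -/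
theorem fullSubApex_N_absent {h m : ℤ} {C : MConfig} (hU : C.InDiamond h) (hDN : ∀ Z ∈ C.lower, RuleDMu4N C Z)
    (hDP : ∀ P ∈ C.upper, RuleDMu4P C P) (hX : XPlusClosed C) (hGu : PermClosed C.upper) (hh : h = 2 * m + 4) (hm : 1 ≤ m)
    {N : MCell} {φ u : Fin 4} (h0 : N 0 = floorLetter φ (m + 2)) (h1 : N 1 = nodeTwoLetter u m) (h2 : N 2 = (h - 2, 0, 0))
    (hW : 2 ≤ nodeLevel (N 3)) : N ∉ C.lower := fun hN => by
  obtain ⟨k, hk, hk0⟩ := exists_coord_ne_zero_of_nodeLevel (hU.1 N hN 3) hW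
  have hk' : Adapted (N 0) (φ + 2) := by rw [h0]; exact (floorLetter_node φ (m + 2)).1
  have hk'0 : coord (N 0) (φ + 2) = 0 := by rw [h0]; exact (floorLetter_node φ (m + 2)).2
  have hne : coord (N 3) k ≠ coord (N 0) (φ + 2) := by rw [hk'0]; exact hk0
  have nob : ∀ P ∈ C.upper, ∀ r : Fin 4, (P 0).1 < (N 0).1 → N 0 = ray (P 0) r ((N 0).1 - (P 0).1) → r = φ :=
    fun P hP r hlt e => below_floorLetter (hU.2 P hP 0) (by omega) (by omega) (h0.symm.trans e)
  rcases hDN N hN 3 0 (by decide) k (φ + 2) hk hk' hne with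
    ⟨r, -, P, hP, hZP⟩ | ⟨r, hr, P, hP, hZP⟩ | ⟨a, a', -, ha', P, hP, -, -, -, hc1, hc2⟩
  · have hx : P 3 ≠ (0, 0, 0) := server_ne_origin_of_nodeLevel (by have := hZP.2.1; omega) hZP.2.2 hW
    exact fullSubApex_P_absent hU hDN hDP hX hGu hh hm ((hZP.1 0 (by decide)).trans h0) ((hZP.1 1 (by decide)).trans h1)
      ((hZP.1 2 (by decide)).trans h2) hx hP
  · exact absurd ((nob P hP r hZP.2.1 hZP.2.2).trans (fin4_add_two_add_two φ).symm) hr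
  · have hφ := nob P hP a' hc1 hc2
    rcases ha' with e | ⟨-, hne2⟩
    · exact absurd (e.symm.trans hφ) (fin4_ne_add_two φ).symm
    · exact (hne2 (hφ.trans (fin4_add_two_add_two φ).symm)).elim

/-- above the sub-top letter `s_m(w) = (h−4)I + ℓ_w` in its node direction `w+2` sit exactly `(h−2)I` and `cu_{w+2}`. -/
theorem subTop_upNode {h m e : ℤ} {z : BPoint} {w : Fin 4} (hh : h = 2 * m + 4) (hz : InDiamond h z) (he : 0 < e)
    (heq : z = ray (subCeilLetter m w m) (w + 2) e) : z = (h - 2, 0, 0) ∨ z = ceilingUnit h (w + 2) := by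
  subst heq hh
  obtain ⟨hax, h1, -, h3⟩ := hz
  simp only [AxisPt, absCharge, chargeOf, ray, Prod.mk.injEq] at hax h1 h3 ⊢
  fin_cases w <;> simp at hax h1 h3 ⊢ <;>
    (simp only [abs_eq_max_neg, max_def] at h1 h3; split_ifs at h1 h3 <;> omega)

/-- the SUB-TOP NODE UP-SERVER: in a `P`-cell with a ceiling letter at `g` and `s_m(w)` at `j`, the slot `j` is served above in the node direction of
`s_m` by `(h−2)I` or by `cu_{w+2}` (`upLine_of_ruleDMu4P` + `subTop_upNode`). -/
theorem subTopNode_upServer {h m : ℤ} {C : MConfig} (hU : C.InDiamond h) (hh : h = 2 * m + 4) {P : MCell}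
    (hP : P ∈ C.upper) (hD : RuleDMu4P C P) {g j : Fin 4} (hgj : g ≠ j) (hgc : OnCeiling h (P g)) {w : Fin 4}
    (hj : P j = subCeilLetter m w m) :
    ∃ N ∈ C.lower, (∀ i, i ≠ j → N i = P i) ∧ (N j = (h - 2, 0, 0) ∨ N j = ceilingUnit h (w + 2)) := by
  have hna : ¬ isApex (P j) := by rw [hj]; exact subCeilLetter_not_isApex w (by omega)
  have hk : Adapted (P j) (w + 2) := by rw [hj]; exact (subCeilLetter_node m w m).1
  have hkh : coord (P j) (w + 2) ≠ h := by rw [hj, (subCeilLetter_node m w m).2]; omega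
  obtain ⟨N, hN, hNP⟩ := upLine_of_ruleDMu4P hU hP hD hgj hgc hna hk hkh
  have e : N j = ray (subCeilLetter m w m) (w + 2) ((N j).1 - (P j).1) := by rw [← hj]; exact hNP.2.2
  exact ⟨N, hN, fun i hi => (hNP.1 i hi).symm, subTop_upNode hh (hU.1 N hN j) (by have := hNP.2.1; omega) e⟩

/-- **WP1a.** `P{ℓ_φ, 2I + n·ℓ_u, s_m(w), cu_χ} ∉ C.upper` (`n ≥ 1`, `χ ≠ w + 2`; `s_m(w) = (h−4)I + ℓ_w`) [◇_h, RULE D, X⁺, `S₄` on E₊]: the sub-top node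
up-server (pin `cu_χ`) gives `N{ℓ_φ, 2I + nℓ_u, (h−2)I, cu_χ}` = VN1 or `N{ℓ_φ, 2I + nℓ_u, cu_{w+2}, cu_χ}` = TN2.  Census: ◇₈ 144 ∕ ◇₁₀ 192 orbits
(◇₁₀: all round 2 `B:DP`; ◇₈: 48 round 1), 96 ∕ 144 untyped before — the classes `P{ℓ, t_1 ∕ r_1 ∕ y_m ∕ B, s_m, cu}` with `χ ≠ w+2`. -/
theorem unitNodeTwoSubTop_P_absent {h m n : ℤ} {C : MConfig} (hU : C.InDiamond h) (hDN : ∀ Z ∈ C.lower, RuleDMu4N C Z)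
    (hDP : ∀ P ∈ C.upper, RuleDMu4P C P) (hX : XPlusClosed C) (hGu : PermClosed C.upper) (hh : h = 2 * m + 4)
    (hn : 1 ≤ n) {P : MCell} {φ u w χ : Fin 4} (hχ : χ ≠ w + 2) (h0 : P 0 = floorUnit φ) (h1 : P 1 = nodeTwoLetter u n)
    (h2 : P 2 = subCeilLetter m w m) (h3 : P 3 = ceilingUnit h χ) : P ∉ C.upper := fun hP => by
  obtain ⟨N, hN, hNP, hN2 | hN2⟩ := subTopNode_upServer hU hh hP (hDP P hP) (g := 3) (j := 2) (by decide)
    (by rw [h3]; exact onCeiling_ceilingUnit h χ) h2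
  · exact unitNodeTwoSubApex_N_absent hU hDN hDP hX hGu hn ((hNP 0 (by decide)).trans h0) ((hNP 1 (by decide)).trans h1) hN2
      ((hNP 3 (by decide)).trans h3) hN
  · exact unitNodeTwo_pair_N_absent hU hDN hDP hX hGu hn hχ ((hNP 0 (by decide)).trans h0) ((hNP 1 (by decide)).trans h1) hN2
      ((hNP 3 (by decide)).trans h3) hN

/-- **WP1c.** `P{ℓ_φ, 4I + n·ℓ_u, s_m(w), cu_χ} ∉ C.upper` (`n ≥ 1`, `χ ≠ w + 2`) [same]: the sub-top node up-server gives VN3 or UN2.  Census: ◇₈ 84 ∕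
◇₁₀ 144 orbits (round 2 `B:DP`), all untyped before — the classes `P{ℓ, t_2 ∕ s_2 ∕ y_2, s_m, cu}` with `χ ≠ w+2`. -/
theorem unitNodeFourSubTop_P_absent {h m n : ℤ} {C : MConfig} (hU : C.InDiamond h) (hDN : ∀ Z ∈ C.lower, RuleDMu4N C Z)
    (hDP : ∀ P ∈ C.upper, RuleDMu4P C P) (hX : XPlusClosed C) (hGu : PermClosed C.upper) (hh : h = 2 * m + 4)
    (hn : 1 ≤ n) {P : MCell} {φ u w χ : Fin 4} (hχ : χ ≠ w + 2) (h0 : P 0 = floorUnit φ)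
    (h1 : P 1 = ray ((4, 0, 0) : BPoint) u n) (h2 : P 2 = subCeilLetter m w m) (h3 : P 3 = ceilingUnit h χ) :
    P ∉ C.upper := fun hP => by
  obtain ⟨N, hN, hNP, hN2 | hN2⟩ := subTopNode_upServer hU hh hP (hDP P hP) (g := 3) (j := 2) (by decide)
    (by rw [h3]; exact onCeiling_ceilingUnit h χ) h2
  · exact unitNodeFourSubApex_N_absent hU hDN hDP hX hGu hn ((hNP 0 (by decide)).trans h0) ((hNP 1 (by decide)).trans h1) hN2
      ((hNP 3 (by decide)).trans h3) hN
  · exact unitPairNodeFour_N_absent hU hDN hDP hX hGu hn hχ ((hNP 0 (by decide)).trans h0) ((hNP 1 (by decide)).trans h1) hN2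
      ((hNP 3 (by decide)).trans h3) hN

/-- **WP2.** `P{ℓ_φ, 4I + n·ℓ_u, cu_χ, cu_χ'} ∉ C.upper` (`n ≥ 1`, `χ' ≠ χ`, the node-4 letter strictly below the ceiling: `4 + 2n < h`) [same; every `h`]:
the up-line of `4I + nℓ_u` along its ray (pin `cu_χ`) stays on the node-4 line — UN2.  Census: ◇₈ 24 ∕ ◇₁₀ 48 orbits (round 2 `B:DP`), all untyped
before. -/
theorem unitPairNodeFour_P_absent {h n : ℤ} {C : MConfig} (hU : C.InDiamond h) (hDN : ∀ Z ∈ C.lower, RuleDMu4N C Z)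
    (hDP : ∀ P ∈ C.upper, RuleDMu4P C P) (hX : XPlusClosed C) (hGu : PermClosed C.upper) (hn : 1 ≤ n) (hnh : 4 + 2 * n < h)
    {P : MCell} {φ u χ χ' : Fin 4} (hχ : χ' ≠ χ) (h0 : P 0 = floorUnit φ) (h1 : P 1 = ray ((4, 0, 0) : BPoint) u n)
    (h2 : P 2 = ceilingUnit h χ) (h3 : P 3 = ceilingUnit h χ') : P ∉ C.upper := fun hP => by
  have hna : ¬ isApex (P 1) := by rw [h1]; exact nodeFourLine_not_isApex u (by omega)
  have hk : Adapted (P 1) u := by rw [h1]; exact (adapted_ray_apex 4 u n).1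
  have hkh : coord (P 1) u ≠ h := by rw [h1, coord_ray_self, coord_of_isApex ⟨rfl, rfl⟩]; simp only; omega
  obtain ⟨N, hN, hNP⟩ := upLine_of_ruleDMu4P hU hP (hDP P hP) (g := 2) (j := 1) (by decide)
    (by rw [h2]; exact onCeiling_ceilingUnit h χ) hna hk hkh
  have e : N 1 = ray ((4, 0, 0) : BPoint) u (n + ((N 1).1 - (P 1).1)) := by rw [ray_add, ← h1]; exact hNP.2.2
  exact unitPairNodeFour_N_absent hU hDN hDP hX hGu (by have := hNP.2.1; omega) hχ ((hNP.1 0 (by decide)).symm.trans h0) e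
    ((hNP.1 2 (by decide)).symm.trans h2) ((hNP.1 3 (by decide)).symm.trans h3) hN

/-! ### ◇₁₀ census representatives of the §3 families (`h = 10`, `m = 3`; orbits of the j318002 peel tables, all peel round 2) -/

def repUN1 : MCell := ![(1, -1, 0), (2, -2, 0), (9, -1, 0), (9, 0, -1)]
theorem repUN1_absent {C : MConfig} (hU : C.InDiamond 10) (hG : C.G1Closed) (hS : C.StaticH1) : repUN1 ∉ C.lower :=
  unitPairFloor_N_absent hU hS.1.1 hS.1.2 hS.2.1 hG.2.1 (c := 2) (by norm_num) (φ := 2) (ψ := 2) (χ := 2) (χ' := 1) (by decide)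
    (by simp [repUN1, ray]) (by simp [repUN1, ray]) (by simp [repUN1, ray]) (by simp [repUN1, ray])

def repUN2 : MCell := ![(1, -1, 0), (5, -1, 0), (9, -1, 0), (9, 0, -1)]
theorem repUN2_absent {C : MConfig} (hU : C.InDiamond 10) (hG : C.G1Closed) (hS : C.StaticH1) : repUN2 ∉ C.lower :=
  unitPairNodeFour_N_absent hU hS.1.1 hS.1.2 hS.2.1 hG.2.1 (n := 1) (by norm_num) (φ := 2) (u := 2) (χ := 2) (χ' := 1) (by decide)
    (by simp [repUN2, ray]) (by simp [repUN2, ray]) (by simp [repUN2, ray]) (by simp [repUN2, ray])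

def repUP1 : MCell := ![(1, -1, 0), (3, -1, 0), (8, 0, 0), (9, -1, 0)]
theorem repUP1_absent {C : MConfig} (hU : C.InDiamond 10) (hG : C.G1Closed) (hS : C.StaticH1) : repUP1 ∉ C.upper :=
  unitNodeTwoSubApex_P_absent hU hS.1.1 hS.1.2 hS.2.1 hG.2.1 (n := 1) (by norm_num) (φ := 2) (u := 2) (χ := 2)
    (by simp [repUP1, ray]) (by simp [repUP1, ray]) (by simp [repUP1]) (by simp [repUP1, ray])
theorem repVN1_absent {C : MConfig} (hU : C.InDiamond 10) (hG : C.G1Closed) (hS : C.StaticH1) : repUP1 ∉ C.lower :=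
  unitNodeTwoSubApex_N_absent hU hS.1.1 hS.1.2 hS.2.1 hG.2.1 (n := 1) (by norm_num) (φ := 2) (u := 2) (χ := 2)
    (by simp [repUP1, ray]) (by simp [repUP1, ray]) (by simp [repUP1]) (by simp [repUP1, ray])

def repUP2 : MCell := ![(1, -1, 0), (2, -2, 0), (8, 0, 0), (9, -1, 0)]
theorem repUP2_absent {C : MConfig} (hU : C.InDiamond 10) (hG : C.G1Closed) (hS : C.StaticH1) : repUP2 ∉ C.upper :=
  unitFloorSubApex_P_absent hU hS.1.1 hS.1.2 hS.2.1 hG.2.1 (c := 2) (by norm_num) (φ := 2) (ψ := 2) (χ := 2)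
    (by simp [repUP2, ray]) (by simp [repUP2, ray]) (by simp [repUP2]) (by simp [repUP2, ray])

def repUP3 : MCell := ![(1, -1, 0), (5, -1, 0), (8, 0, 0), (9, -1, 0)]
theorem repUP3_absent {C : MConfig} (hU : C.InDiamond 10) (hG : C.G1Closed) (hS : C.StaticH1) : repUP3 ∉ C.upper :=
  unitNodeFourSubApex_P_absent hU hS.1.1 hS.1.2 hS.2.1 hG.2.1 (n := 1) (by norm_num) (φ := 2) (u := 2) (χ := 2)
    (by simp [repUP3, ray]) (by simp [repUP3, ray]) (by simp [repUP3]) (by simp [repUP3, ray])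
theorem repVN3_absent {C : MConfig} (hU : C.InDiamond 10) (hG : C.G1Closed) (hS : C.StaticH1) : repUP3 ∉ C.lower :=
  unitNodeFourSubApex_N_absent hU hS.1.1 hS.1.2 hS.2.1 hG.2.1 (n := 1) (by norm_num) (φ := 2) (u := 2) (χ := 2)
    (by simp [repUP3, ray]) (by simp [repUP3, ray]) (by simp [repUP3]) (by simp [repUP3, ray])

def repTN27 : MCell := ![(5, -5, 0), (5, -3, 0), (8, 0, 0), (2, 0, 0)]
theorem repTN27_absent {C : MConfig} (hU : C.InDiamond 10) (hG : C.G1Closed) (hS : C.StaticH1) : repTN27 ∉ C.lower :=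
  fullSubApex_N_absent hU hS.1.1 hS.1.2 hS.2.1 hG.2.1 (m := 3) (by norm_num) (by norm_num) (φ := 2) (u := 2)
    (by simp [repTN27, ray]) (by simp [repTN27, ray]) (by simp [repTN27])
    (by simp [repTN27, nodeLevel, absCharge, chargeOf])

def repWP1a : MCell := ![(1, -1, 0), (3, -1, 0), (7, -1, 0), (9, -1, 0)]
theorem repWP1a_absent {C : MConfig} (hU : C.InDiamond 10) (hG : C.G1Closed) (hS : C.StaticH1) : repWP1a ∉ C.upper :=
  unitNodeTwoSubTop_P_absent hU hS.1.1 hS.1.2 hS.2.1 hG.2.1 (m := 3) (by norm_num) (n := 1) (by norm_num)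
    (φ := 2) (u := 2) (w := 2) (χ := 2) (by decide)
    (by simp [repWP1a, ray]) (by simp [repWP1a, ray]) (by simp [repWP1a, ray]) (by simp [repWP1a, ray])

def repWP1c : MCell := ![(1, -1, 0), (5, -1, 0), (7, -1, 0), (9, -1, 0)]
theorem repWP1c_absent {C : MConfig} (hU : C.InDiamond 10) (hG : C.G1Closed) (hS : C.StaticH1) : repWP1c ∉ C.upper :=
  unitNodeFourSubTop_P_absent hU hS.1.1 hS.1.2 hS.2.1 hG.2.1 (m := 3) (by norm_num) (n := 1) (by norm_num)
    (φ := 2) (u := 2) (w := 2) (χ := 2) (by decide)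
    (by simp [repWP1c, ray]) (by simp [repWP1c, ray]) (by simp [repWP1c, ray]) (by simp [repWP1c, ray])

theorem repWP2_absent {C : MConfig} (hU : C.InDiamond 10) (hG : C.G1Closed) (hS : C.StaticH1) : repUN2 ∉ C.upper :=
  unitPairNodeFour_P_absent hU hS.1.1 hS.1.2 hS.2.1 hG.2.1 (n := 1) (by norm_num) (by norm_num) (φ := 2) (u := 2) (χ := 2)
    (χ' := 1) (by decide) (by simp [repUN2, ray]) (by simp [repUN2, ray]) (by simp [repUN2, ray]) (by simp [repUN2, ray])


/-! ## §4 The node-2 APEX `2I` as second letter over the unit-pair ∕ sub-apex ∕ sub-top bases (v1.2; law-free, every `h`)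
An apex letter is adapted to every frame, so RULE D at (floor pin) × (apex, any frame) resp. (ceiling pin) × (apex, any frame) serves the apex in
SOME direction `r` (`servedBelow_floor_apex`, `servedAbove_ceiling_apex` — the two tree engines with the `¬ isApex` hypothesis traded for an
existential direction); below `2I` in direction `r` sits only the floor unit `ℓ_{r+2}` (`apexTwo_downRay`), above it the node-2 line `2I + e·ℓ_r`.
Families UN3 UP4 VN4 UP5 WP1d; census (`tools/famN.py 8 10`): ◇₈ 110 ∕ ◇₁₀ 136 member orbits, all peel round 2, 0 survivors; 98 ∕ 124 untyped before. -/

/-- below the apex `2I` in any direction `r` sits only the floor unit `ℓ_{r+2}`. -/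
theorem apexTwo_downRay {h d : ℤ} {z : BPoint} {r : Fin 4} (hz : InDiamond h z) (hd : 0 < d)
    (heq : ((2 : ℤ), (0 : ℤ), (0 : ℤ)) = ray z r d) : z = floorUnit (r + 2) := by
  obtain ⟨α, a, b⟩ := z
  obtain ⟨hax, h1, -, -⟩ := hz
  simp only [floorUnit, AxisPt, absCharge, chargeOf, ray, Prod.mk.injEq] at hax h1 heq ⊢
  fin_cases r <;> simp at hax h1 heq ⊢ <;>
    (simp only [abs_eq_max_neg, max_def] at h1; split_ifs at h1 <;> omega)

/-- **SERVICE BELOW OF AN APEX FORCED BY A FLOOR LETTER** (= `servedBelow_of_floorLetter` of the tree for an apex at `g`: served in SOME direction). -/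
theorem servedBelow_floor_apex {h : ℤ} {C : MConfig} (hU : C.InDiamond h) {Z : MCell} (hZ : Z ∈ C.lower) (hD : RuleDMu4N C Z) {i g : Fin 4}
    (hig : i ≠ g) (hi : OnFloor (Z i)) {k : Fin 4} (hk : Adapted (Z g) k) (hk0 : coord (Z g) k ≠ 0) : ∃ r, MServedBelow C Z g r := by
  obtain ⟨m, hm, hm0⟩ := exists_node_dir (hU.1 Z hZ i).1
  have hm0' : coord (Z i) m = 0 := by rw [hm0, hi, sub_self]
  have hne : coord (Z i) m ≠ coord (Z g) k := by rw [hm0']; exact Ne.symm hk0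
  have below : ∀ P ∈ C.upper, ∀ a : Fin 4, a ≠ m + 2 → (P i).1 < (Z i).1 → Z i = ray (P i) a ((Z i).1 - (P i).1) → False :=
    fun P hP a ha hlt hray =>
      not_inDiamond_below_offtop hi (hU.1 Z hZ i).1 hm hm0' ha (by omega) hray (hU.2 P hP i).1 (hU.2 P hP i).2.1
  rcases hD i g hig m k hm hk hne with ⟨r, hr, P, hP, hZP⟩ | ⟨r, -, P, hP, hZP⟩ | ⟨a, b, ha, -, P, hP, -, hi1, hi2, -, -⟩
  · exact (below P hP r hr hZP.2.1 hZP.2.2).elim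
  · exact ⟨r, P, hP, hZP⟩
  · have ha' : a ≠ m + 2 := by
      rcases ha with e | ⟨-, hne2⟩
      · rw [e]; exact fin4_ne_add_two m
      · exact hne2
    exact (below P hP a ha' hi1 hi2).elim

/-- **SERVICE ABOVE OF AN APEX FORCED BY A CEILING LETTER** (= `upLine_of_ruleDMu4P` of the tree for an apex at `j`: served in SOME direction). -/
theorem servedAbove_ceiling_apex {h : ℤ} {C : MConfig} (hU : C.InDiamond h) {P : MCell} (hP : P ∈ C.upper) (hD : RuleDMu4P C P) {g j : Fin 4}
    (hgj : g ≠ j) (hgc : OnCeiling h (P g)) {k : Fin 4} (hk : Adapted (P j) k) (hkh : coord (P j) k ≠ h) : ∃ r, MServedAbove C P j r := by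
  obtain ⟨m, hm, hmh⟩ := exists_top_dir hgc (hU.2 P hP g).1
  have hne : coord (P g) m ≠ coord (P j) k := by rw [hmh]; exact Ne.symm hkh
  have above : ∀ N ∈ C.lower, ∀ a : Fin 4, a ≠ m + 2 → (P g).1 < (N g).1 → N g = ray (P g) a ((N g).1 - (P g).1) → False :=
    fun N hN a ha hlt hray =>
      not_inDiamond_above_offnode hgc (hU.2 P hP g).1 hm hmh ha (by omega) hray (hU.1 N hN g).1 (hU.1 N hN g).2.2.2
  rcases hD g j hgj m k hm hk hne with ⟨r, hr, N, hN, hNP⟩ | ⟨r, -, N, hN, hNP⟩ | ⟨a, b, ha, -, N, hN, -, hg1, hg2, -, -⟩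
  · exact (above N hN r hr hNP.2.1 hNP.2.2).elim
  · exact ⟨r, N, hN, hNP⟩
  · have ha' : a ≠ m + 2 := by
      rcases ha with e | ⟨-, hne2⟩
      · rw [e]; exact fin4_ne_add_two m
      · exact hne2
    exact (above N hN a ha' hg1 hg2).elim

theorem adapted_apexTwo (k : Fin 4) : Adapted (((2 : ℤ), (0 : ℤ), (0 : ℤ)) : BPoint) k := by fin_cases k <;> simp [Adapted]
theorem coord_apexTwo (k : Fin 4) : coord (((2 : ℤ), (0 : ℤ), (0 : ℤ)) : BPoint) k = 2 := coord_of_isApex ⟨rfl, rfl⟩ k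

/-- **UN3.** `N{c·ℓ_ψ, 2I, cu_χ, cu_χ'} ∉ C.lower` (`c ≥ 1`, `χ' ≠ χ`) [◇_h, RULE D, X⁺, `S₄` on E₊; every `h`]: the floor pin serves the apex `2I` below in some
direction `r`, by the floor unit `ℓ_{r+2}` — the child `P{c·ℓ_ψ, ℓ_{r+2}, cu_χ, cu_χ'}` is the pair fork A2 (slots 0 ↔ 1 by `S₄`).  Census: ◇₈ 24 ∕ ◇₁₀ 30
orbits (round 2 `B:DN`), all untyped before. -/
theorem floorApexTwo_pair_N_absent {h c : ℤ} {C : MConfig} (hU : C.InDiamond h) (hDN : ∀ Z ∈ C.lower, RuleDMu4N C Z)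
    (hDP : ∀ P ∈ C.upper, RuleDMu4P C P) (hX : XPlusClosed C) (hGu : PermClosed C.upper) (hc : 1 ≤ c) {N : MCell}
    {ψ χ χ' : Fin 4} (hχ : χ' ≠ χ) (h0 : N 0 = floorLetter ψ c) (h1 : N 1 = (2, 0, 0)) (h2 : N 2 = ceilingUnit h χ)
    (h3 : N 3 = ceilingUnit h χ') : N ∉ C.lower := fun hN => by
  have hfl : OnFloor (N 0) := onFloor_of_coord_zero (hU.1 N hN 0) (k := ψ + 2) (by rw [h0]; exact (floorLetter_node ψ c).2)
  obtain ⟨r, P, hP, hZP⟩ := servedBelow_floor_apex hU hN (hDN N hN) (i := 0) (g := 1) (by decide) hfl (k := 0)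
    (by rw [h1]; exact adapted_apexTwo 0) (by rw [h1, coord_apexTwo]; norm_num)
  have hP1 : P 1 = floorUnit (r + 2) := apexTwo_downRay (hU.2 P hP 1) (by have := hZP.2.1; omega) (h1.symm.trans hZP.2.2)
  exact pairFork_floorUnit_absent hU hDN hDP hX hGu (by omega : 0 ≤ c) hχ (P := P.perm (Equiv.swap 0 1)) (φ := r + 2) (ψ := ψ)
    (by show P (Equiv.swap (0 : Fin 4) 1 0) = _; simpa using hP1)
    (by show P (Equiv.swap (0 : Fin 4) 1 1) = _; simpa using (hZP.1 0 (by decide)).trans h0)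
    (by show P (Equiv.swap (0 : Fin 4) 1 2) = _; simpa [Equiv.swap_apply_of_ne_of_ne] using (hZP.1 2 (by decide)).trans h2)
    (by show P (Equiv.swap (0 : Fin 4) 1 3) = _; simpa [Equiv.swap_apply_of_ne_of_ne] using (hZP.1 3 (by decide)).trans h3)
    (hGu _ P hP)

/-- **UP4.** `P{c·ℓ_ψ, 2I, (h−2)·I, cu_χ} ∉ C.upper` (`c ≥ 1`) [same; every `h`]: the sub-apex up-server (frame `χ+2`, pin `cu_χ`) gives UN3.  Census: ◇₈ 16 ∕
◇₁₀ 20 orbits (round 2 `B:DP`), all untyped before. -/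
theorem floorApexTwoSubApex_P_absent {h c : ℤ} {C : MConfig} (hU : C.InDiamond h) (hDN : ∀ Z ∈ C.lower, RuleDMu4N C Z)
    (hDP : ∀ P ∈ C.upper, RuleDMu4P C P) (hX : XPlusClosed C) (hGu : PermClosed C.upper) (hc : 1 ≤ c) {P : MCell}
    {ψ χ : Fin 4} (h0 : P 0 = floorLetter ψ c) (h1 : P 1 = (2, 0, 0)) (h2 : P 2 = (h - 2, 0, 0)) (h3 : P 3 = ceilingUnit h χ) :
    P ∉ C.upper := fun hP => by
  obtain ⟨N, hN, r, hr, hNP, hN2⟩ := subApex_upServer' hU hP (hDP P hP) (g := 3) (j := 2) (by decide)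
    (by rw [h3]; exact onCeiling_ceilingUnit h χ) h2 (χ + 2)
  have hrχ : χ ≠ r := by rintro rfl; exact hr (fin4_add_two_add_two χ).symm
  exact floorApexTwo_pair_N_absent hU hDN hDP hX hGu hc hrχ ((hNP 0 (by decide)).trans h0) ((hNP 1 (by decide)).trans h1) hN2
    ((hNP 3 (by decide)).trans h3) hN

/-- **VN4.** `N{c·ℓ_ψ, 2I, (h−2)·I, cu_χ} ∉ C.lower` (`c ≥ 1`) [same; every `h`]: the floor pin serves `2I` below by a floor unit `ℓ_{r+2}`; the child
`P{c·ℓ_ψ, ℓ_{r+2}, (h−2)I, cu_χ}` is UP2 (slots 0 ↔ 1).  Census: ◇₈ 16 ∕ ◇₁₀ 20 orbits (round 2 `B:DN`), all untyped before. -/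
theorem floorApexTwoSubApex_N_absent {h c : ℤ} {C : MConfig} (hU : C.InDiamond h) (hDN : ∀ Z ∈ C.lower, RuleDMu4N C Z)
    (hDP : ∀ P ∈ C.upper, RuleDMu4P C P) (hX : XPlusClosed C) (hGu : PermClosed C.upper) (hc : 1 ≤ c) {N : MCell}
    {ψ χ : Fin 4} (h0 : N 0 = floorLetter ψ c) (h1 : N 1 = (2, 0, 0)) (h2 : N 2 = (h - 2, 0, 0)) (h3 : N 3 = ceilingUnit h χ) :
    N ∉ C.lower := fun hN => by
  have hfl : OnFloor (N 0) := onFloor_of_coord_zero (hU.1 N hN 0) (k := ψ + 2) (by rw [h0]; exact (floorLetter_node ψ c).2)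
  obtain ⟨r, P, hP, hZP⟩ := servedBelow_floor_apex hU hN (hDN N hN) (i := 0) (g := 1) (by decide) hfl (k := 0)
    (by rw [h1]; exact adapted_apexTwo 0) (by rw [h1, coord_apexTwo]; norm_num)
  have hP1 : P 1 = floorUnit (r + 2) := apexTwo_downRay (hU.2 P hP 1) (by have := hZP.2.1; omega) (h1.symm.trans hZP.2.2)
  exact unitFloorSubApex_P_absent hU hDN hDP hX hGu hc (P := P.perm (Equiv.swap 0 1)) (φ := r + 2) (ψ := ψ) (χ := χ)
    (by show P (Equiv.swap (0 : Fin 4) 1 0) = _; simpa using hP1)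
    (by show P (Equiv.swap (0 : Fin 4) 1 1) = _; simpa using (hZP.1 0 (by decide)).trans h0)
    (by show P (Equiv.swap (0 : Fin 4) 1 2) = _; simpa [Equiv.swap_apply_of_ne_of_ne] using (hZP.1 2 (by decide)).trans h2)
    (by show P (Equiv.swap (0 : Fin 4) 1 3) = _; simpa [Equiv.swap_apply_of_ne_of_ne] using (hZP.1 3 (by decide)).trans h3)
    (hGu _ P hP)

/-- **UP5.** `P{ℓ_φ, 2I, cu_χ, cu_χ'} ∉ C.upper` (`χ' ≠ χ`, `h ≠ 2`) [same]: the ceiling pin `cu_χ` serves `2I` above in some direction `r`, along the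
node-2 line `2I + e·ℓ_r` (`e ≥ 1`) — TN2.  Census: ◇₈ 6 ∕ ◇₁₀ 6 orbits (round 2 `B:DP`), all untyped before. -/
theorem unitApexTwo_pair_P_absent {h : ℤ} {C : MConfig} (hU : C.InDiamond h) (hDN : ∀ Z ∈ C.lower, RuleDMu4N C Z)
    (hDP : ∀ P ∈ C.upper, RuleDMu4P C P) (hX : XPlusClosed C) (hGu : PermClosed C.upper) (hh : h ≠ 2) {P : MCell}
    {φ χ χ' : Fin 4} (hχ : χ' ≠ χ) (h0 : P 0 = floorUnit φ) (h1 : P 1 = (2, 0, 0)) (h2 : P 2 = ceilingUnit h χ)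
    (h3 : P 3 = ceilingUnit h χ') : P ∉ C.upper := fun hP => by
  obtain ⟨r, N, hN, hNP⟩ := servedAbove_ceiling_apex hU hP (hDP P hP) (g := 2) (j := 1) (by decide)
    (by rw [h2]; exact onCeiling_ceilingUnit h χ) (k := 0) (by rw [h1]; exact adapted_apexTwo 0) (by rw [h1, coord_apexTwo]; exact hh.symm)
  have e : N 1 = nodeTwoLetter r ((N 1).1 - (P 1).1) := by
    show N 1 = ray ((2, 0, 0) : BPoint) r _
    rw [← h1]; exact hNP.2.2
  exact unitNodeTwo_pair_N_absent hU hDN hDP hX hGu (by have := hNP.2.1; omega) hχ ((hNP.1 0 (by decide)).symm.trans h0) e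
    ((hNP.1 2 (by decide)).symm.trans h2) ((hNP.1 3 (by decide)).symm.trans h3) hN

/-- **WP1d.** `P{c·ℓ_ψ, 2I, s_m(w), cu_χ} ∉ C.upper` (`c ≥ 1`, `χ ≠ w + 2`, `h = 2m+4`) [same]: the sub-top node up-server gives VN4 or UN3.  Census: ◇₈ 48 ∕
◇₁₀ 60 orbits (round 2 `B:DP`), 36 ∕ 48 untyped before. -/
theorem floorApexTwoSubTop_P_absent {h m c : ℤ} {C : MConfig} (hU : C.InDiamond h) (hDN : ∀ Z ∈ C.lower, RuleDMu4N C Z)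
    (hDP : ∀ P ∈ C.upper, RuleDMu4P C P) (hX : XPlusClosed C) (hGu : PermClosed C.upper) (hh : h = 2 * m + 4) (hc : 1 ≤ c)
    {P : MCell} {ψ w χ : Fin 4} (hχ : χ ≠ w + 2) (h0 : P 0 = floorLetter ψ c) (h1 : P 1 = (2, 0, 0))
    (h2 : P 2 = subCeilLetter m w m) (h3 : P 3 = ceilingUnit h χ) : P ∉ C.upper := fun hP => by
  obtain ⟨N, hN, hNP, hN2 | hN2⟩ := subTopNode_upServer hU hh hP (hDP P hP) (g := 3) (j := 2) (by decide)
    (by rw [h3]; exact onCeiling_ceilingUnit h χ) h2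
  · exact floorApexTwoSubApex_N_absent hU hDN hDP hX hGu hc ((hNP 0 (by decide)).trans h0) ((hNP 1 (by decide)).trans h1) hN2
      ((hNP 3 (by decide)).trans h3) hN
  · exact floorApexTwo_pair_N_absent hU hDN hDP hX hGu hc hχ ((hNP 0 (by decide)).trans h0) ((hNP 1 (by decide)).trans h1) hN2
      ((hNP 3 (by decide)).trans h3) hN

/-! ### ◇₁₀ census representatives of the §4 families -/

def repUN3 : MCell := ![(1, -1, 0), (2, 0, 0), (9, -1, 0), (9, 0, -1)]
theorem repUN3_absent {C : MConfig} (hU : C.InDiamond 10) (hG : C.G1Closed) (hS : C.StaticH1) : repUN3 ∉ C.lower :=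
  floorApexTwo_pair_N_absent hU hS.1.1 hS.1.2 hS.2.1 hG.2.1 (c := 1) (by norm_num) (ψ := 2) (χ := 2) (χ' := 1) (by decide)
    (by simp [repUN3, ray]) (by simp [repUN3]) (by simp [repUN3, ray]) (by simp [repUN3, ray])
theorem repUP5_absent {C : MConfig} (hU : C.InDiamond 10) (hG : C.G1Closed) (hS : C.StaticH1) : repUN3 ∉ C.upper :=
  unitApexTwo_pair_P_absent hU hS.1.1 hS.1.2 hS.2.1 hG.2.1 (by norm_num) (φ := 2) (χ := 2) (χ' := 1) (by decide)
    (by simp [repUN3, ray]) (by simp [repUN3]) (by simp [repUN3, ray]) (by simp [repUN3, ray])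

def repUP4 : MCell := ![(1, -1, 0), (2, 0, 0), (8, 0, 0), (9, -1, 0)]
theorem repUP4_absent {C : MConfig} (hU : C.InDiamond 10) (hG : C.G1Closed) (hS : C.StaticH1) : repUP4 ∉ C.upper :=
  floorApexTwoSubApex_P_absent hU hS.1.1 hS.1.2 hS.2.1 hG.2.1 (c := 1) (by norm_num) (ψ := 2) (χ := 2)
    (by simp [repUP4, ray]) (by simp [repUP4]) (by simp [repUP4]) (by simp [repUP4, ray])
theorem repVN4_absent {C : MConfig} (hU : C.InDiamond 10) (hG : C.G1Closed) (hS : C.StaticH1) : repUP4 ∉ C.lower :=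
  floorApexTwoSubApex_N_absent hU hS.1.1 hS.1.2 hS.2.1 hG.2.1 (c := 1) (by norm_num) (ψ := 2) (χ := 2)
    (by simp [repUP4, ray]) (by simp [repUP4]) (by simp [repUP4]) (by simp [repUP4, ray])

def repWP1d : MCell := ![(1, -1, 0), (2, 0, 0), (7, -1, 0), (9, -1, 0)]
theorem repWP1d_absent {C : MConfig} (hU : C.InDiamond 10) (hG : C.G1Closed) (hS : C.StaticH1) : repWP1d ∉ C.upper :=
  floorApexTwoSubTop_P_absent hU hS.1.1 hS.1.2 hS.2.1 hG.2.1 (m := 3) (by norm_num) (c := 1) (by norm_num) (ψ := 2) (w := 2)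
    (χ := 2) (by decide) (by simp [repWP1d, ray]) (by simp [repWP1d]) (by simp [repWP1d, ray]) (by simp [repWP1d, ray])

/-! ## §5 The node-2 line `2I + n·ℓ_v` over `c·ℓ_ψ` and floor CLIMBS onto the §4 apex base (v1.4; law-free, every `h`)
`nodeTwoLetter_downRay`: below `2I + n·ℓ_v` along `v` sit the node-2 line, `2I`, `ℓ_{v+2}`; under a ceiling pin a floor letter with `2c ≠ h`
CLIMBS its ray (`upLine_of_ruleDMu4P`).  VN5 → UP4 ∕ UP2; UP5g → UN3; UP6 → VN5; UN4 → A1 ∕ UP5g ∕ A2.  Census (`tools/famO.py 8 10`):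
◇₈ 346 ∕ ◇₁₀ 552 member orbits (round 2 `B:*`; the `c = 1` members of UN4 are TN2, round 1), 0 survivors; 188 ∕ 346 new. -/

theorem nodeTwoLetter_downRay {h n d : ℤ} {z : BPoint} {v : Fin 4} (hz : InDiamond h z)
    (heq : nodeTwoLetter v n = ray z v d) : (1 ≤ n - d ∧ z = nodeTwoLetter v (n - d)) ∨ z = (2, 0, 0) ∨ z = floorUnit (v + 2) := by
  obtain ⟨α, a, b⟩ := z
  obtain ⟨hax, h1, -, -⟩ := hz
  simp only [floorUnit, AxisPt, absCharge, chargeOf, ray, Prod.mk.injEq] at hax h1 heq ⊢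
  fin_cases v <;> simp at hax h1 heq ⊢ <;>
    (simp only [abs_eq_max_neg, max_def] at h1; split_ifs at h1 <;> omega)

/-- **VN5.** `N{c·ℓ_ψ, 2I+ℓ_v, (h−2)·I, cu_χ} ∉ C.lower` (`c ≥ 1`): floor pin, `2I+ℓ_v` down `v` → UP4 ∕ UP2 (0 ↔ 1).  ◇₈ 64 ∕ ◇₁₀ 80, 48 ∕ 64 new. -/
theorem floorNodeTwoOneSubApex_N_absent {h c : ℤ} {C : MConfig} (hU : C.InDiamond h) (hDN : ∀ Z ∈ C.lower, RuleDMu4N C Z)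
    (hDP : ∀ P ∈ C.upper, RuleDMu4P C P) (hX : XPlusClosed C) (hGu : PermClosed C.upper) (hc : 1 ≤ c) {N : MCell}
    {ψ v χ : Fin 4} (h0 : N 0 = floorLetter ψ c) (h1 : N 1 = nodeTwoLetter v 1) (h2 : N 2 = (h - 2, 0, 0))
    (h3 : N 3 = ceilingUnit h χ) : N ∉ C.lower := fun hN => by
  have hfl : OnFloor (N 0) := onFloor_of_coord_zero (hU.1 N hN 0) (k := ψ + 2) (by rw [h0]; exact (floorLetter_node ψ c).2)
  have hna : ¬ isApex (N 1) := by rw [h1]; exact nodeTwoLetter_not_isApex v one_ne_zero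
  have hk : Adapted (N 1) v := by rw [h1]; exact (nodeTwoLetter_top v 1).1
  have hk0 : coord (N 1) v ≠ 0 := by rw [h1, (nodeTwoLetter_top v 1).2]; norm_num
  obtain ⟨P, hP, hZP⟩ := servedBelow_of_floorLetter hU hN (hDN N hN) (i := 0) (g := 1) (by decide) hfl hna hk hk0
  have hlt := hZP.2.1
  rcases nodeTwoLetter_downRay (hU.2 P hP 1) (h1.symm.trans hZP.2.2) with ⟨hle, -⟩ | hP1 | hP1
  · omega
  · exact floorApexTwoSubApex_P_absent hU hDN hDP hX hGu hc ((hZP.1 0 (by decide)).trans h0) hP1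
      ((hZP.1 2 (by decide)).trans h2) ((hZP.1 3 (by decide)).trans h3) hP
  · exact unitFloorSubApex_P_absent hU hDN hDP hX hGu hc (P := P.perm (Equiv.swap 0 1)) (φ := v + 2) (ψ := ψ) (χ := χ)
      (by show P (Equiv.swap (0 : Fin 4) 1 0) = _; simpa using hP1)
      (by show P (Equiv.swap (0 : Fin 4) 1 1) = _; simpa using (hZP.1 0 (by decide)).trans h0)
      (by show P (Equiv.swap (0 : Fin 4) 1 2) = _; simpa [Equiv.swap_apply_of_ne_of_ne] using (hZP.1 2 (by decide)).trans h2)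
      (by show P (Equiv.swap (0 : Fin 4) 1 3) = _; simpa [Equiv.swap_apply_of_ne_of_ne] using (hZP.1 3 (by decide)).trans h3)
      (hGu _ P hP)

/-- **UP5g.** `P{c·ℓ_ψ, 2I, cu_χ, cu_χ'} ∉ C.upper` (`c ≥ 1`, `2c ≠ h`, `χ' ≠ χ`): pin `cu_χ`, the floor letter CLIMBS its ray
(frame `ψ`, coordinate `2c ≠ h`) → UN3 at `c+e`.  ◇₈ 18 ∕ ◇₁₀ 24, 12 ∕ 18 new. -/
theorem floorClimbApexTwo_pair_P_absent {h c : ℤ} {C : MConfig} (hU : C.InDiamond h) (hDN : ∀ Z ∈ C.lower, RuleDMu4N C Z)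
    (hDP : ∀ P ∈ C.upper, RuleDMu4P C P) (hX : XPlusClosed C) (hGu : PermClosed C.upper) (hc : 1 ≤ c) (hch : 2 * c ≠ h)
    {P : MCell} {ψ χ χ' : Fin 4} (hχ : χ' ≠ χ) (h0 : P 0 = floorLetter ψ c) (h1 : P 1 = (2, 0, 0)) (h2 : P 2 = ceilingUnit h χ)
    (h3 : P 3 = ceilingUnit h χ') : P ∉ C.upper := fun hP => by
  obtain ⟨N, hN, hNP⟩ := upLine_of_ruleDMu4P hU hP (hDP P hP) (g := 2) (j := 0) (by decide) (by rw [h2]; exact onCeiling_ceilingUnit h χ)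
    (by rw [h0]; exact floorLetter_not_isApex ψ (by omega)) (k := ψ) (by rw [h0]; exact (floorLetter_top ψ c).1)
    (by rw [h0, (floorLetter_top ψ c).2]; exact hch)
  have hlt := hNP.2.1
  have e : N 0 = floorLetter ψ (c + ((N 0).1 - (P 0).1)) := hNP.2.2.trans (by rw [h0]; exact (ray_add _ ψ _ _).symm)
  exact floorApexTwo_pair_N_absent hU hDN hDP hX hGu (by omega) hχ e ((hNP.1 1 (by decide)).symm.trans h1)
    ((hNP.1 2 (by decide)).symm.trans h2) ((hNP.1 3 (by decide)).symm.trans h3) hN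

/-- **UP6.** `P{c·ℓ_ψ, 2I+ℓ_v, (h−2)·I, cu_χ} ∉ C.upper` (`c ≥ 1`, `2c ≠ h`): pin `cu_χ`, climb → VN5.  ◇₈ 48 ∕ ◇₁₀ 64, 32 ∕ 48 new. -/
theorem floorClimbNodeTwoOneSubApex_P_absent {h c : ℤ} {C : MConfig} (hU : C.InDiamond h) (hDN : ∀ Z ∈ C.lower, RuleDMu4N C Z)
    (hDP : ∀ P ∈ C.upper, RuleDMu4P C P) (hX : XPlusClosed C) (hGu : PermClosed C.upper) (hc : 1 ≤ c) (hch : 2 * c ≠ h)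
    {P : MCell} {ψ v χ : Fin 4} (h0 : P 0 = floorLetter ψ c) (h1 : P 1 = nodeTwoLetter v 1) (h2 : P 2 = (h - 2, 0, 0))
    (h3 : P 3 = ceilingUnit h χ) : P ∉ C.upper := fun hP => by
  obtain ⟨N, hN, hNP⟩ := upLine_of_ruleDMu4P hU hP (hDP P hP) (g := 3) (j := 0) (by decide) (by rw [h3]; exact onCeiling_ceilingUnit h χ)
    (by rw [h0]; exact floorLetter_not_isApex ψ (by omega)) (k := ψ) (by rw [h0]; exact (floorLetter_top ψ c).1)
    (by rw [h0, (floorLetter_top ψ c).2]; exact hch)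
  have hlt := hNP.2.1
  have e : N 0 = floorLetter ψ (c + ((N 0).1 - (P 0).1)) := hNP.2.2.trans (by rw [h0]; exact (ray_add _ ψ _ _).symm)
  exact floorNodeTwoOneSubApex_N_absent hU hDN hDP hX hGu (by omega) e ((hNP.1 1 (by decide)).symm.trans h1)
    ((hNP.1 2 (by decide)).symm.trans h2) ((hNP.1 3 (by decide)).symm.trans h3) hN

/-- **UN4.** `N{c·ℓ_ψ, 2I+n·ℓ_v, cu_χ, cu_χ'} ∉ C.lower` (`c ≥ 1`, `2c ≠ h`, `n ≥ 1`, `χ' ≠ χ`; the node-2 line up to `y_{m+1}`):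
floor pin, `2I+nℓ_v` down `v` → A1 ∕ UP5g (`2I`) ∕ A2 (`ℓ_{v+2}`, 0 ↔ 1); `c = 1` is TN2.  ◇₈ 216 ∕ ◇₁₀ 384, 96 ∕ 216 new. -/
theorem floorNodeTwo_pair_N_absent {h c n : ℤ} {C : MConfig} (hU : C.InDiamond h) (hDN : ∀ Z ∈ C.lower, RuleDMu4N C Z)
    (hDP : ∀ P ∈ C.upper, RuleDMu4P C P) (hX : XPlusClosed C) (hGu : PermClosed C.upper) (hc : 1 ≤ c) (hch : 2 * c ≠ h) (hn : 1 ≤ n)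
    {N : MCell} {ψ v χ χ' : Fin 4} (hχ : χ' ≠ χ) (h0 : N 0 = floorLetter ψ c) (h1 : N 1 = nodeTwoLetter v n)
    (h2 : N 2 = ceilingUnit h χ) (h3 : N 3 = ceilingUnit h χ') : N ∉ C.lower := fun hN => by
  have hfl : OnFloor (N 0) := onFloor_of_coord_zero (hU.1 N hN 0) (k := ψ + 2) (by rw [h0]; exact (floorLetter_node ψ c).2)
  have hna : ¬ isApex (N 1) := by rw [h1]; exact nodeTwoLetter_not_isApex v (by omega)
  have hk : Adapted (N 1) v := by rw [h1]; exact (nodeTwoLetter_top v n).1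
  have hk0 : coord (N 1) v ≠ 0 := by rw [h1, (nodeTwoLetter_top v n).2]; omega
  obtain ⟨P, hP, hZP⟩ := servedBelow_of_floorLetter hU hN (hDN N hN) (i := 0) (g := 1) (by decide) hfl hna hk hk0
  have hlt := hZP.2.1
  rcases nodeTwoLetter_downRay (hU.2 P hP 1) (h1.symm.trans hZP.2.2) with ⟨hle, hP1⟩ | hP1 | hP1
  · exact pairFork_nodeTwo_absent hU hDN hDP hX hGu (by omega : 0 ≤ c) hle hχ ((hZP.1 0 (by decide)).trans h0) hP1
      ((hZP.1 2 (by decide)).trans h2) ((hZP.1 3 (by decide)).trans h3) hP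
  · exact floorClimbApexTwo_pair_P_absent hU hDN hDP hX hGu hc hch hχ ((hZP.1 0 (by decide)).trans h0) hP1
      ((hZP.1 2 (by decide)).trans h2) ((hZP.1 3 (by decide)).trans h3) hP
  · exact pairFork_floorUnit_absent hU hDN hDP hX hGu (by omega : 0 ≤ c) hχ (P := P.perm (Equiv.swap 0 1)) (φ := v + 2) (ψ := ψ)
      (by show P (Equiv.swap (0 : Fin 4) 1 0) = _; simpa using hP1)
      (by show P (Equiv.swap (0 : Fin 4) 1 1) = _; simpa using (hZP.1 0 (by decide)).trans h0)
      (by show P (Equiv.swap (0 : Fin 4) 1 2) = _; simpa [Equiv.swap_apply_of_ne_of_ne] using (hZP.1 2 (by decide)).trans h2)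
      (by show P (Equiv.swap (0 : Fin 4) 1 3) = _; simpa [Equiv.swap_apply_of_ne_of_ne] using (hZP.1 3 (by decide)).trans h3)
      (hGu _ P hP)

/-! ### ◇₁₀ reps (`c = 2`) -/
def repVN5 : MCell := ![(2, -2, 0), (3, -1, 0), (8, 0, 0), (9, -1, 0)]
theorem repVN5_absent {C : MConfig} (hU : C.InDiamond 10) (hG : C.G1Closed) (hS : C.StaticH1) : repVN5 ∉ C.lower :=
  floorNodeTwoOneSubApex_N_absent hU hS.1.1 hS.1.2 hS.2.1 hG.2.1 (c := 2) (by norm_num) (ψ := 2) (v := 2) (χ := 2)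
    (by simp [repVN5, ray]) (by simp [repVN5, ray]) (by simp [repVN5]) (by simp [repVN5, ray])
theorem repUP6_absent {C : MConfig} (hU : C.InDiamond 10) (hG : C.G1Closed) (hS : C.StaticH1) : repVN5 ∉ C.upper :=
  floorClimbNodeTwoOneSubApex_P_absent hU hS.1.1 hS.1.2 hS.2.1 hG.2.1 (c := 2) (by norm_num) (by norm_num) (ψ := 2) (v := 2) (χ := 2)
    (by simp [repVN5, ray]) (by simp [repVN5, ray]) (by simp [repVN5]) (by simp [repVN5, ray])
def repUP5g : MCell := ![(2, -2, 0), (2, 0, 0), (9, -1, 0), (9, 0, -1)]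
theorem repUP5g_absent {C : MConfig} (hU : C.InDiamond 10) (hG : C.G1Closed) (hS : C.StaticH1) : repUP5g ∉ C.upper :=
  floorClimbApexTwo_pair_P_absent hU hS.1.1 hS.1.2 hS.2.1 hG.2.1 (c := 2) (by norm_num) (by norm_num) (ψ := 2) (χ := 2) (χ' := 1)
    (by decide) (by simp [repUP5g, ray]) (by simp [repUP5g]) (by simp [repUP5g, ray]) (by simp [repUP5g, ray])
def repVN5b : MCell := ![(2, -2, 0), (3, -1, 0), (9, -1, 0), (9, 0, -1)]
theorem repUN4_absent {C : MConfig} (hU : C.InDiamond 10) (hG : C.G1Closed) (hS : C.StaticH1) : repVN5b ∉ C.lower :=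
  floorNodeTwo_pair_N_absent hU hS.1.1 hS.1.2 hS.2.1 hG.2.1 (c := 2) (n := 1) (by norm_num) (by norm_num) (by norm_num) (ψ := 2) (v := 2)
    (χ := 2) (χ' := 1)
    (by decide) (by simp [repVN5b, ray]) (by simp [repVN5b, ray]) (by simp [repVN5b, ray]) (by simp [repVN5b, ray])

end Summit.HodgeConjecture.HodgeConjecture.Cruxes.BlochSeedDiscOne.CeilingPair2
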